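import Summits.ValiantsHypothesis.ValiantsHypothesis.Theses.LacunarySymmetroid
import Summits.ValiantsHypothesis.ValiantsHypothesis.Theorems.MatrixDescartes.Negative.MatrixDescartesSymmetryFree
import Summits.ValiantsHypothesis.ValiantsHypothesis.Theorems.LacunarySymmetroidMatrixDescartesProductPlusOnePosCoeff
import Summits.ValiantsHypothesis.ValiantsHypothesis.Theorems.LacunarySymmetroidMatrixDescartesProductPlusOneWindowArith
import Summits.ValiantsHypothesis.ValiantsHypothesis.Theorems.LacunarySymmetroidMatrixDescartesProductPlusOneDescartes
import Summits.ValiantsHypothesis.ValiantsHypothesis.Theorems.LacunarySymmetroidMatrixDescartesProductPlusOneLowK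
import Summits.ValiantsHypothesis.ValiantsHypothesis.Theorems.LacunarySymmetroidMatrixDescartesProductPlusOnePowerSector
import Summits.ValiantsHypothesis.ValiantsHypothesis.Theorems.LacunarySymmetroidMatrixDescartesProductPlusOneEulerRolle
import Summits.ValiantsHypothesis.ValiantsHypothesis.Theorems.LacunarySymmetroidMatrixDescartesProductPlusOneRowCalibration
import Summits.ValiantsHypothesis.ValiantsHypothesis.Theorems.LacunarySymmetroidMatrixDescartesProductPlusOneEulerReduction
import Summits.ValiantsHypothesis.ValiantsHypothesis.Theorems.LacunarySymmetroidMatrixDescartesProductPlusOneTameSector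
import Summits.ValiantsHypothesis.ValiantsHypothesis.Theorems.LacunarySymmetroidMatrixDescartesProductPlusOneTameReverse
import Summits.ValiantsHypothesis.ValiantsHypothesis.Theorems.LacunarySymmetroidMatrixDescartesProductPlusOneSharpSector
import Summits.ValiantsHypothesis.ValiantsHypothesis.Theorems.LacunarySymmetroidMatrixDescartesProductPlusOneMixedSector
import Summits.ValiantsHypothesis.ValiantsHypothesis.Theorems.LacunarySymmetroidMatrixDescartesProductPlusOneMixedReverse
import Summits.ValiantsHypothesis.ValiantsHypothesis.Theorems.LacunarySymmetroidMatrixDescartesProductPlusOneEulerSectors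
import Summits.ValiantsHypothesis.ValiantsHypothesis.Theorems.LacunarySymmetroidMatrixDescartesProductPlusOneEulerSectorsTop
import Summits.ValiantsHypothesis.ValiantsHypothesis.Theorems.LacunarySymmetroidMatrixDescartesProductPlusOneTameSigned
import Summits.ValiantsHypothesis.ValiantsHypothesis.Theorems.LacunarySymmetroidMatrixDescartesProductPlusOneEulerSharpK
import Summits.ValiantsHypothesis.ValiantsHypothesis.Theorems.LacunarySymmetroidMatrixDescartesProductPlusOneCoherentSector
import Summits.ValiantsHypothesis.ValiantsHypothesis.Theorems.LacunarySymmetroidMatrixDescartesProductPlusOneSharpKSignAware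
import Summits.ValiantsHypothesis.ValiantsHypothesis.Theorems.LacunarySymmetroidMatrixDescartesProductPlusOneMixedSigned
import Summits.ValiantsHypothesis.ValiantsHypothesis.Theorems.LacunarySymmetroidMatrixDescartesProductPlusOneMixedSignedTop
import Summits.ValiantsHypothesis.ValiantsHypothesis.Theorems.LacunarySymmetroidMatrixDescartesProductPlusOneCoherentK
import Summits.ValiantsHypothesis.ValiantsHypothesis.Theorems.LacunarySymmetroidMatrixDescartesProductPlusOneCoherentKMembers
import Summits.ValiantsHypothesis.ValiantsHypothesis.Theorems.LacunarySymmetroidMatrixDescartesProductPlusOneCoherentKTop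
import Summits.ValiantsHypothesis.ValiantsHypothesis.Theorems.LacunarySymmetroidMatrixDescartesProductPlusOneLowerSigned
import Summits.ValiantsHypothesis.ValiantsHypothesis.Theorems.LacunarySymmetroidMatrixDescartesProductPlusOneLowerSignedMembers
import Summits.ValiantsHypothesis.ValiantsHypothesis.Theorems.LacunarySymmetroidMatrixDescartesProductPlusOneLowerSignedTop
import Summits.ValiantsHypothesis.ValiantsHypothesis.Theorems.LacunarySymmetroidMatrixDescartesProductPlusOneTameK
import Summits.ValiantsHypothesis.ValiantsHypothesis.Theorems.LacunarySymmetroidMatrixDescartesProductPlusOneTameKTop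
import Summits.ValiantsHypothesis.ValiantsHypothesis.Theorems.LacunarySymmetroidMatrixDescartesProductPlusOneTameKMembers
import Summits.ValiantsHypothesis.ValiantsHypothesis.Theorems.LacunarySymmetroidMatrixDescartesProductPlusOneSignedTop
import Summits.ValiantsHypothesis.ValiantsHypothesis.Theorems.LacunarySymmetroidMatrixDescartesProductPlusOneOneRiser
import Summits.ValiantsHypothesis.ValiantsHypothesis.Theorems.LacunarySymmetroidMatrixDescartesProductPlusOneABWindow
import Summits.ValiantsHypothesis.ValiantsHypothesis.Theorems.LacunarySymmetroidMatrixDescartesProductPlusOneABWindowMiddle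
import Summits.ValiantsHypothesis.ValiantsHypothesis.Theorems.LacunarySymmetroidMatrixDescartesProductPlusOneCrossingBudgetLocal
import Summits.ValiantsHypothesis.ValiantsHypothesis.Theorems.LacunarySymmetroidMatrixDescartesProductPlusOneLetterSumsK
import Summits.ValiantsHypothesis.ValiantsHypothesis.Theorems.LacunarySymmetroidMatrixDescartesProductPlusOneABWindowTop
import Summits.ValiantsHypothesis.ValiantsHypothesis.Theorems.LacunarySymmetroidMatrixDescartesProductPlusOneABWindowK
import Summits.ValiantsHypothesis.ValiantsHypothesis.Theorems.LacunarySymmetroidMatrixDescartesProductPlusOneCrossingSign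
import Summits.ValiantsHypothesis.ValiantsHypothesis.Theorems.LacunarySymmetroidMatrixDescartesProductPlusOneOneRiserGeneralPull
import Summits.ValiantsHypothesis.ValiantsHypothesis.Theorems.LacunarySymmetroidMatrixDescartesProductPlusOneCrossingSeparation
import Summits.ValiantsHypothesis.ValiantsHypothesis.Theorems.LacunarySymmetroidMatrixDescartesProductPlusOneLogWronskianSigns
import Summits.ValiantsHypothesis.ValiantsHypothesis.Theorems.LacunarySymmetroidMatrixDescartesProductPlusOneOneRiserLogistic
import Summits.ValiantsHypothesis.ValiantsHypothesis.Theorems.LacunarySymmetroidMatrixDescartesProductPlusOneCloudLine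
import Summits.ValiantsHypothesis.ValiantsHypothesis.Theorems.LacunarySymmetroidMatrixDescartesProductPlusOneLetterVariance
import Summits.ValiantsHypothesis.ValiantsHypothesis.Theorems.LacunarySymmetroidMatrixDescartesProductPlusOneABWindowSignfree
import Summits.ValiantsHypothesis.ValiantsHypothesis.Theorems.LacunarySymmetroidMatrixDescartesProductPlusOneLetterSignsK
import Summits.ValiantsHypothesis.ValiantsHypothesis.Theorems.LacunarySymmetroidMatrixDescartesProductPlusOneCrossingInterlace
import Summits.ValiantsHypothesis.ValiantsHypothesis.Theorems.LacunarySymmetroidMatrixDescartesProductPlusOneChartForms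
import Summits.ValiantsHypothesis.ValiantsHypothesis.Theorems.LacunarySymmetroidMatrixDescartesProductPlusOneWronskianBudget
import Summits.ValiantsHypothesis.ValiantsHypothesis.Theorems.LacunarySymmetroidMatrixDescartesProductPlusOneWronskianRung0
import Summits.ValiantsHypothesis.ValiantsHypothesis.Theorems.LacunarySymmetroidMatrixDescartesProductPlusOneWronskianSharp
import Summits.ValiantsHypothesis.ValiantsHypothesis.Theorems.LacunarySymmetroidMatrixDescartesProductPlusOneSlopeLine
import Summits.ValiantsHypothesis.ValiantsHypothesis.Theorems.LacunarySymmetroidMatrixDescartesProductPlusOneSlopeKneeLine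
import Summits.ValiantsHypothesis.ValiantsHypothesis.Theorems.LacunarySymmetroidMatrixDescartesProductPlusOneSlopeCoherent
import Summits.ValiantsHypothesis.ValiantsHypothesis.Theorems.LacunarySymmetroidMatrixDescartesProductPlusOneSlopeMixedLine
import Summits.ValiantsHypothesis.ValiantsHypothesis.Theorems.LacunarySymmetroidMatrixDescartesProductPlusOneRealRooted
import Summits.ValiantsHypothesis.ValiantsHypothesis.Theorems.LacunarySymmetroidMatrixDescartesProductPlusOneWronskianBudgetThree
import Summits.ValiantsHypothesis.ValiantsHypothesis.Theorems.LacunarySymmetroidMatrixDescartesProductPlusOneSlopePhasesLine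
import Summits.ValiantsHypothesis.ValiantsHypothesis.Theorems.LacunarySymmetroidMatrixDescartesProductPlusOnePoleCloudLine
import Summits.ValiantsHypothesis.ValiantsHypothesis.Theorems.LacunarySymmetroidMatrixDescartesProductPlusOneBackgroundCell
import Summits.ValiantsHypothesis.ValiantsHypothesis.Theorems.LacunarySymmetroidMatrixDescartesProductPlusOneSlowKneeCloudCell
import Summits.ValiantsHypothesis.ValiantsHypothesis.Theorems.LacunarySymmetroidMatrixDescartesProductPlusOneWWIdentity
import Summits.ValiantsHypothesis.ValiantsHypothesis.Theorems.LacunarySymmetroidMatrixDescartesProductPlusOneSlowKneeCellRateFree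
import Summits.ValiantsHypothesis.ValiantsHypothesis.Theorems.LacunarySymmetroidMatrixDescartesProductPlusOneSlowKneeCellRateFreeEuler
import Summits.ValiantsHypothesis.ValiantsHypothesis.Theorems.LacunarySymmetroidMatrixDescartesProductPlusOneOneBumpCount
import Summits.ValiantsHypothesis.ValiantsHypothesis.Theorems.LacunarySymmetroidMatrixDescartesProductPlusOneOuterKnees
import Summits.ValiantsHypothesis.ValiantsHypothesis.Theorems.LacunarySymmetroidMatrixDescartesProductPlusOneForwardPoles
import Summits.ValiantsHypothesis.ValiantsHypothesis.Theorems.LacunarySymmetroidMatrixDescartesProductPlusOneWronskianSharpTwoBump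
import Summits.ValiantsHypothesis.ValiantsHypothesis.Theorems.LacunarySymmetroidMatrixDescartesProductPlusOneBackgroundCellEuler
import Summits.ValiantsHypothesis.ValiantsHypothesis.Theorems.LacunarySymmetroidMatrixDescartesProductPlusOneWronskianSharpThreeBump
import Summits.ValiantsHypothesis.ValiantsHypothesis.Theorems.LacunarySymmetroidMatrixDescartesProductPlusOneGlobalCells
import Summits.ValiantsHypothesis.ValiantsHypothesis.Theorems.LacunarySymmetroidMatrixDescartesProductPlusOneGlobalCellsOneBump
import Summits.ValiantsHypothesis.ValiantsHypothesis.Theorems.LacunarySymmetroidMatrixDescartesProductPlusOneCrossingShell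
import Summits.ValiantsHypothesis.ValiantsHypothesis.Theorems.LacunarySymmetroidMatrixDescartesProductPlusOneTiltCore
import Summits.ValiantsHypothesis.ValiantsHypothesis.Theorems.LacunarySymmetroidMatrixDescartesProductPlusOneFastKneeShell
import Summits.ValiantsHypothesis.ValiantsHypothesis.Theorems.LacunarySymmetroidMatrixDescartesProductPlusOneRowTowerKLine
import Summits.ValiantsHypothesis.ValiantsHypothesis.Theorems.LacunarySymmetroidMatrixDescartesProductPlusOneSlowKneeCellEveryK
import Summits.ValiantsHypothesis.ValiantsHypothesis.Theorems.LacunarySymmetroidMatrixDescartesProductPlusOneRateSeparatedCell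
import Summits.ValiantsHypothesis.ValiantsHypothesis.Theorems.LacunarySymmetroidMatrixDescartesProductPlusOneGlobalCellsRateSeparated
import Summits.ValiantsHypothesis.ValiantsHypothesis.Theorems.LacunarySymmetroidMatrixDescartesProductPlusOneFarKneesMerge
import Summits.ValiantsHypothesis.ValiantsHypothesis.Theorems.LacunarySymmetroidMatrixDescartesProductPlusOneRowTowerKTwoLetter
import Summits.ValiantsHypothesis.ValiantsHypothesis.Theorems.LacunarySymmetroidMatrixDescartesProductPlusOneSixthOrderRowLaws
import Summits.ValiantsHypothesis.ValiantsHypothesis.Theorems.LacunarySymmetroidMatrixDescartesProductPlusOneSharpKSector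
import Summits.ValiantsHypothesis.ValiantsHypothesis.Theorems.LacunarySymmetroidMatrixDescartesProductPlusOneSixthOrderShell
import Summits.ValiantsHypothesis.ValiantsHypothesis.Theorems.LacunarySymmetroidMatrixDescartesProductPlusOneRowLawsK
import Summits.ValiantsHypothesis.ValiantsHypothesis.Theorems.LacunarySymmetroidMatrixDescartesProductPlusOneRowTowerKCumulant
import Summits.ValiantsHypothesis.ValiantsHypothesis.Theorems.LacunarySymmetroidMatrixDescartesProductPlusOneWindowCharges
import Summits.ValiantsHypothesis.ValiantsHypothesis.Theorems.LacunarySymmetroidMatrixDescartesProductPlusOneCurvatureMargin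
import Summits.ValiantsHypothesis.ValiantsHypothesis.Theorems.LacunarySymmetroidMatrixDescartesProductPlusOneSixthOrderTower
import Summits.ValiantsHypothesis.ValiantsHypothesis.Theorems.LacunarySymmetroidMatrixDescartesProductPlusOneRowLawsKThreshold
import Summits.ValiantsHypothesis.ValiantsHypothesis.Theorems.LacunarySymmetroidMatrixDescartesProductPlusOneEighthOrderShell
import Summits.ValiantsHypothesis.ValiantsHypothesis.Theorems.LacunarySymmetroidMatrixDescartesProductPlusOneSlowKneeCellEveryKPairs
import Summits.ValiantsHypothesis.ValiantsHypothesis.Theorems.LacunarySymmetroidMatrixDescartesProductPlusOneRowTowerKPairLaw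
import Summits.ValiantsHypothesis.ValiantsHypothesis.Theorems.LacunarySymmetroidMatrixDescartesProductPlusOneFastKneeShellNeg1
import Summits.ValiantsHypothesis.ValiantsHypothesis.Theorems.LacunarySymmetroidMatrixDescartesProductPlusOneSixthOrderCell
import Summits.ValiantsHypothesis.ValiantsHypothesis.Theorems.LacunarySymmetroidMatrixDescartesProductPlusOneRowTowerKMasterLaw
import Summits.ValiantsHypothesis.ValiantsHypothesis.Theorems.LacunarySymmetroidMatrixDescartesProductPlusOneEqualGapCell
import Summits.ValiantsHypothesis.ValiantsHypothesis.Theorems.LacunarySymmetroidMatrixDescartesProductPlusOneSlowPoleImage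
import Summits.ValiantsHypothesis.ValiantsHypothesis.Theorems.LacunarySymmetroidMatrixDescartesProductPlusOneSlowKneeDefect
import Summits.ValiantsHypothesis.ValiantsHypothesis.Theorems.LacunarySymmetroidMatrixDescartesProductPlusOneDefectShells
import Summits.ValiantsHypothesis.ValiantsHypothesis.Theorems.LacunarySymmetroidMatrixDescartesProductPlusOneWronskianReverse
import Summits.ValiantsHypothesis.ValiantsHypothesis.Theorems.LacunarySymmetroidMatrixDescartesProductPlusOneRingGeometry
import Summits.ValiantsHypothesis.ValiantsHypothesis.Theorems.LacunarySymmetroidMatrixDescartesProductPlusOneLobeCell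
import Summits.ValiantsHypothesis.ValiantsHypothesis.Theorems.LacunarySymmetroidMatrixDescartesProductPlusOneRowTowerKLogConvex
import Summits.ValiantsHypothesis.ValiantsHypothesis.Theorems.LacunarySymmetroidMatrixDescartesProductPlusOneRowTowerKMasterLawSwitched
import Summits.ValiantsHypothesis.ValiantsHypothesis.Theorems.LacunarySymmetroidMatrixDescartesProductPlusOneEighthOrderRowLaws
import Summits.ValiantsHypothesis.ValiantsHypothesis.Theorems.LacunarySymmetroidMatrixDescartesProductPlusOneEighthOrderTower
import Summits.ValiantsHypothesis.ValiantsHypothesis.Theorems.LacunarySymmetroidMatrixDescartesProductPlusOneSixthOrderFullCell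
import Summits.ValiantsHypothesis.ValiantsHypothesis.Theorems.LacunarySymmetroidMatrixDescartesProductPlusOneRingIsoPoles
import Summits.ValiantsHypothesis.ValiantsHypothesis.Theorems.LacunarySymmetroidMatrixDescartesProductPlusOneLensAlgebra
import Summits.ValiantsHypothesis.ValiantsHypothesis.Theorems.LacunarySymmetroidMatrixDescartesProductPlusOneLensCloudProfiles
import Summits.ValiantsHypothesis.ValiantsHypothesis.Theorems.LacunarySymmetroidMatrixDescartesProductPlusOneLensTwoKillProfile
import Summits.ValiantsHypothesis.ValiantsHypothesis.Theorems.LacunarySymmetroidMatrixDescartesProductPlusOneRingIsoCurvature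
import Summits.ValiantsHypothesis.ValiantsHypothesis.Theorems.LacunarySymmetroidMatrixDescartesProductPlusOneLobeMargin
import Summits.ValiantsHypothesis.ValiantsHypothesis.Theorems.LacunarySymmetroidMatrixDescartesProductPlusOneRowTowerKDefs8
import Summits.ValiantsHypothesis.ValiantsHypothesis.Theorems.LacunarySymmetroidMatrixDescartesProductPlusOneCloudSides
import Summits.ValiantsHypothesis.ValiantsHypothesis.Theorems.LacunarySymmetroidMatrixDescartesProductPlusOneLensWronskian

/-!
# LINE `product_plus_one` — crux `MatrixDescartes` (stmt-ValiantsHypothesis-18050), declared R266 (A) 2026-08-28 — rev 40 (THE FLOOR `stub_oneChangeFloorK3` registered per R297 (7), rev 15; rev 40 (val-idea-25 g7) = ARCHIVE-2 move L per R519 / R525 (4) (skeleton header SKELETON/OPEN paragraph + the prose of the rev-38/39 wiring docblocks + card § archives A–K → `Lines/product_plus_one-header-archive-2.md`, written by the custodian critic) + record wires ★ `companyW_eval_root_eq_zero_iff` (✓ p724926, (W0)) and `cloudRow_bottom_side_on_window` (✓ p723223, (C↓)) + two imports; books → the `### Rev 40 wiring` section and the card's rev-40 clause)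

Card: `Cruxes/MatrixDescartes/Lines/product_plus_one.md` (idea `Cruxes/MatrixDescartes/Ideas/product-plus-one.md`, verdict
crit-6 #2 PASS-WITH-PRICE, novelty new-combination; skeleton verdict #8 PASS + re-pin).  HONEST FRAMING: nothing here proves
`MatrixDescartes`, Conjecture B or VP ≠ VNP; the line's target is a RESTRICTED V1 (D-0145 ideation wave).

RESTRICTED TARGET `ProductPlusOneMDR` = `Theses.LacunarySymmetroid.MatrixDescartes` with its quantifier prefix
`∀ c q, 0 < q → ∃ K₀, ∀ K m, K₀ ≤ K → m ≤ 2 ^ ((Nat.log 2 K + c) ^ c) →`, and its conclusion `card ^ q ≤ 2 ^ (K * Nat.log 2 K)`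
VERBATIM, the binder `(S : Fin K → Matrix (Fin m) (Fin m) ℝ), (∀ l, (S l).IsSymm)` being replaced by the parametrisation
`(a : Fin m → Fin K → ℝ) (l₀ : Fin K) (c₀ : ℝ)` of the PRODUCT-PLUS-ONE CLASS: all letters diagonal (`diag (a · l)`) except letter
`l₀ = diag + N_σ` (`N_σ` = superdiagonal `1`s + corner `σ`), whose determinant is `∏_{j<m} f_j + (−1)^{m−1} σ x^{m d_{l₀}}`,
`f_j = Σ_l a j l · x^{d_l}` (`m` `K`-nomials on ONE common support).  ON-PATH (proved here, no sorry):
`productPlusOneMDR_of_matrixDescartes : MatrixDescartes → ProductPlusOneMDR` (via the tree's symmetry-free form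
`matrixDescartesGeneral_of_matrixDescartes` and the determinant identity `pencilDetIdentity_holds`), i.e. the class law is a
NECESSARY sub-case of V1 and a scalar counterexample to it refutes V1.  CONTENT = UNIFORMITY IN `m`: at each fixed `m` the class law
is Descartes-trivial (`ppoLawAt_descartesRow`, `2·C(m+K−1,m) − 1`); for `m ≤ K^{1+o(1)}` that already gives V1's rate
(`productPlusOneMDR_linearWindow`, p646391); the line's content is the window `K^{1+ε} ≤ m ≤ 2^{polylog K}`.
SANDWICH: real-τ (top fan-in 2, common support) ⇒ `PPOPolyLaw` ⇒ `ProductPlusOneMDR` ⇐ `MatrixDescartes` (last arrow kernel); a kill of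
`PPOPolyLaw` refutes real τ, a kill of `ProductPlusOneMDR` refutes V1, a kill of `PPOLinearLaw` / S4′ / S4″ is informative only.

SKELETON / δ-WIRING / OPEN paragraph (rev-39 header ll. 141–173: what is PROVED in this file, what is δ-wired by name, and the four OPEN bullets S4⁗ / S4′–S4″ /
S5-closed-sectors / S5 with their card-archive pointers A, C, E): MOVED VERBATIM at rev 40 to `Lines/product_plus_one-header-archive-2.md` block L.1
(archived verbatim in `Lines/product_plus_one-header-archive-2.md` sha16 49b6cddb7e1dab47; block sha16 5adeedb7ca90dcfc, 5028 bytes; R519 second archive file, written by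
the custodian critic per R525 (4)); every theorem and def named there is byte-identical below.  OPEN after rev 40 (sorry ONLY in these FOUR): S4⁗ `stub_oneChangeFloorK3`
— THE FLOOR (K = 3, bottom coupling, every support, at-most-one-sign-change factors, any company ⇒ `Z₊(R) ≤ C·m + C`; typed successor cut `WronskianBudgetK3`
= def #20, CONJECTURE, via `oneChangeFloorK3_of_wronskianBudgetK3`; open core = companies with trinomial one-change rows = CLOUDS (CL-F1), owner memos §36–§39;
the BINOMIAL sub-class is Theorem B/W on PAPER, val-lit-p3 g20 NOTE rev 11) · S4′ `stub_classRowK3` · S4″ `stub_eulerBoundK3` (optional sufficient rung) ·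
S5 `stub_polyLaw` (THE LINE'S LAW, research); `stub_posCoeffRung` CLOSED BY NAME (rev 2).
Provers land pieces as `Theorems/LacunarySymmetroidMatrixDescartesProductPlusOne<Piece>.lean --supports stmt-ValiantsHypothesis-18050 --as helper`
(def-free: inline the line's defs; announce-before-propose; crit-1 g2 / crit-6 read by name).
-/

set_option linter.dupNamespace false

open Polynomial Finset BigOperators

namespace Summit.ValiantsHypothesis.ValiantsHypothesis.Cruxes.MatrixDescartes.ProductPlusOneLine

/-- A `K`-nomial on the common support `d` with coefficient row `a`. -/
noncomputable def fewnomial {K : ℕ} (d : Fin K → ℕ) (a : Fin K → ℝ) : ℝ[X] :=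
  ∑ l, C (a l) * X ^ (d l)


open Summit.ValiantsHypothesis.ValiantsHypothesis.Theorems.MatrixDescartes.Negative (MatrixDescartesGeneral
  matrixDescartesGeneral_of_matrixDescartes)

/-- The product-plus-monomial family `c·X^(m·d l₀) + ∏_{j<m} f_j`, all `f_j` on the common support `d`
(on `(0,∞)` its zeros are those of `c + ∏_j (f_j / X^(d l₀))`, the printed `f₁⋯f_m + 1` shape). -/
noncomputable def prodPlusMonomial {m K : ℕ} (d : Fin K → ℕ) (a : Fin m → Fin K → ℝ) (l₀ : Fin K) (c : ℝ) : ℝ[X] :=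
  C c * X ^ (m * d l₀) + ∏ j, fewnomial d (a j)

/-- Row predicate of the class at format `(m, K)`: every member has at most `B` distinct real zeros
(crux currency: `roots.toFinset.card`, zero polynomial has none). -/
def PPOLawAt (m K B : ℕ) : Prop :=
  ∀ (d : Fin K → ℕ) (a : Fin m → Fin K → ℝ) (l₀ : Fin K) (c : ℝ),
    (prodPlusMonomial d a l₀ c).roots.toFinset.card ≤ B

/-- **RESTRICTED V1 (the sub-case this card would prove).** `MatrixDescartes`' rate `2^{o(K log K)}` and window
`m ≤ 2^((log₂K+c)^c)`, verbatim, on the product-plus-one class. A CONSEQUENCE of V1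
(`productPlusOneMDR_of_matrixDescartes`, proved below); implied by Koiran's real τ-conjecture at top fan-in 2; open. -/
def ProductPlusOneMDR : Prop :=
  ∀ c q : ℕ, 0 < q → ∃ K₀ : ℕ, ∀ K m : ℕ, K₀ ≤ K → m ≤ 2 ^ ((Nat.log 2 K + c) ^ c) →
    ∀ (d : Fin K → ℕ) (a : Fin m → Fin K → ℝ) (l₀ : Fin K) (c₀ : ℝ),
      (prodPlusMonomial d a l₀ c₀).roots.toFinset.card ^ q ≤ 2 ^ (K * Nat.log 2 K)

/-- **Located sharp form (conjecture PPO-lin of this card, offered for refutation):** a law LINEAR in `m·K`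
(all distinct real zeros; in positive-zeros currency `Z₊ ≤ mK + 1`, the class being closed under `x ↦ −x`).
Rolle forces `Z₊ ≥ m(K−1)` on members; Descartes allows `Z₊ ≤ D(m,K) = C(m+K−1, m) − 1` (the class has the
format's monomial support); first formats where the two are separated: `(2,5)` 11 vs 14, `(3,4)` 13 vs 19. -/
def PPOLinearLaw : Prop := ∀ m K : ℕ, PPOLawAt m K (2 * m * K + 3)

/-- **Polynomial form (conjecture PPO-poly):** what real τ at top fan-in 2 predicts for the class. -/
def PPOPolyLaw : Prop := ∃ C : ℕ, ∀ m K : ℕ, PPOLawAt m K ((m * K + 2) ^ C)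

/-- The cyclic coupling letter `N_σ`: `1` on the superdiagonal, `σ` in the corner `(m−1, 0)`
(for `m = 1` the single entry is `σ`). -/
def cyclicShift (m : ℕ) (σ : ℝ) : Matrix (Fin m) (Fin m) ℝ :=
  Matrix.of fun i j => if (j : ℕ) = (i : ℕ) + 1 then 1 else if (i : ℕ) + 1 = m ∧ (j : ℕ) = 0 then σ else 0

/-- The class as a `K`-letter lacunary pencil (general real coefficients; symmetric after the §B doubling
`matrixDescartesGeneral_of_matrixDescartes`): letter `l` is `diag(a · l)`, and letter `l₀` carries `N_σ` in addition. -/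
noncomputable def classPencil {m K : ℕ} (σ : ℝ) (a : Fin m → Fin K → ℝ) (l₀ : Fin K) :
    Fin K → Matrix (Fin m) (Fin m) ℝ :=
  fun l => Matrix.diagonal (fun j => a j l) + (if l = l₀ then (1 : ℝ) else 0) • cyclicShift m σ

section CycDet
/-! ### (S1) the determinant identity — PROVED
`det (diag f + t·N_σ) = ∏ f_j + (−1)^n σ t^{n+1}` on `Fin (n+1)` over any commutative ring: Laplace along
column 0; the two minors are upper / lower bidiagonal. -/
variable {R : Type*} [CommRing R]

/-- `diag f` + `t` on the superdiagonal + `t σ` in the corner `(n, 0)` (size `n + 1`). -/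
def cycMat (n : ℕ) (f : Fin (n+1) → R) (t σ : R) : Matrix (Fin (n+1)) (Fin (n+1)) R :=
  Matrix.of fun i j => (if i = j then f i else 0) + (if (j : ℕ) = (i : ℕ) + 1 then t else 0)
    + (if (i : ℕ) + 1 = n + 1 ∧ (j : ℕ) = 0 then t * σ else 0)

theorem cycMat_apply (n : ℕ) (f : Fin (n+1) → R) (t σ : R) (i j : Fin (n+1)) :
    cycMat n f t σ i j = (if i = j then f i else 0) + (if (j : ℕ) = (i : ℕ) + 1 then t else 0)
      + (if (i : ℕ) + 1 = n + 1 ∧ (j : ℕ) = 0 then t * σ else 0) := rfl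

theorem cycMat_col_zero (n : ℕ) (f : Fin (n+2) → R) (t σ : R) (i : Fin (n+2)) :
    cycMat (n+1) f t σ i 0 = (if i = 0 then f 0 else 0) + (if i = Fin.last (n+1) then t * σ else 0) := by
  rw [cycMat_apply]
  have h2 : ¬ (((0 : Fin (n+2)) : ℕ) = (i : ℕ) + 1) := by simp
  rw [if_neg h2, add_zero]
  congr 1
  · by_cases h : i = 0
    · subst h; simp
    · simp [h]
  · by_cases h : i = Fin.last (n+1)
    · subst h; simp
    · have : ¬ ((i : ℕ) = n + 1) := by
        intro hh; apply h; ext; simp [Fin.val_last, hh]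
      simp [h, this]

theorem cycMat_minor00_apply (n : ℕ) (f : Fin (n+2) → R) (t σ : R) (i j : Fin (n+1)) :
    cycMat (n+1) f t σ i.succ j.succ = (if i = j then f i.succ else 0) + (if (j : ℕ) = (i : ℕ) + 1 then t else 0) := by
  rw [cycMat_apply]
  have h3 : ¬ (((i.succ : Fin (n+2)) : ℕ) + 1 = n + 1 + 1 ∧ ((j.succ : Fin (n+2)) : ℕ) = 0) := by
    simp [Fin.val_succ]
  rw [if_neg h3, add_zero]
  congr 1
  · by_cases h : i = j
    · subst h; simp
    · have : (i.succ : Fin (n+2)) ≠ j.succ := fun e => h (Fin.succ_injective _ e)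
      simp [h, this]
  · simp [Fin.val_succ]

theorem cycMat_minorLast_apply (n : ℕ) (f : Fin (n+2) → R) (t σ : R) (i j : Fin (n+1)) :
    cycMat (n+1) f t σ (Fin.castSucc i) j.succ
      = (if (i : ℕ) = (j : ℕ) + 1 then f (Fin.castSucc i) else 0) + (if (j : ℕ) = (i : ℕ) then t else 0) := by
  rw [cycMat_apply]
  have h3 : ¬ (((Fin.castSucc i : Fin (n+2)) : ℕ) + 1 = n + 1 + 1 ∧ ((j.succ : Fin (n+2)) : ℕ) = 0) := by
    simp [Fin.val_succ]
  rw [if_neg h3, add_zero]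
  congr 1
  · by_cases h : (i : ℕ) = (j : ℕ) + 1
    · have : (Fin.castSucc i : Fin (n+2)) = j.succ := by ext; simp [Fin.val_succ, h]
      simp [h, this]
    · have : (Fin.castSucc i : Fin (n+2)) ≠ j.succ := by
        intro e; apply h; have := congrArg Fin.val e; simpa [Fin.val_succ] using this
      simp [h, this]
  · simp [Fin.val_succ, eq_comm]

/-- minor at `(0,0)`: upper bidiagonal, determinant `∏_{j ≥ 1} f_j`. -/
theorem det_cycMat_minor00 (n : ℕ) (f : Fin (n+2) → R) (t σ : R) :
    ((cycMat (n+1) f t σ).submatrix Fin.succ Fin.succ).det = ∏ j : Fin (n+1), f j.succ := by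
  have hT : ((cycMat (n+1) f t σ).submatrix Fin.succ Fin.succ).BlockTriangular id := by
    intro i j hij
    have hij' : (j : ℕ) < (i : ℕ) := hij
    rw [Matrix.submatrix_apply, cycMat_minor00_apply]
    have h1 : i ≠ j := by intro h; subst h; exact lt_irrefl _ hij'
    have h2 : ¬ ((j : ℕ) = (i : ℕ) + 1) := by omega
    simp [h1, h2]
  rw [Matrix.det_of_upperTriangular hT]
  refine Finset.prod_congr rfl fun j _ => ?_
  rw [Matrix.submatrix_apply, cycMat_minor00_apply]; simp

/-- minor at `(n+1, 0)`: lower bidiagonal with `t` on the diagonal, determinant `t^{n+1}`. -/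
theorem det_cycMat_minorLast (n : ℕ) (f : Fin (n+2) → R) (t σ : R) :
    ((cycMat (n+1) f t σ).submatrix Fin.castSucc Fin.succ).det = t ^ (n+1) := by
  have hT : ((cycMat (n+1) f t σ).submatrix Fin.castSucc Fin.succ).BlockTriangular OrderDual.toDual := by
    intro i j hij
    have hij' : (i : ℕ) < (j : ℕ) := hij
    rw [Matrix.submatrix_apply, cycMat_minorLast_apply]
    have h1 : ¬ ((i : ℕ) = (j : ℕ) + 1) := by omega
    have h2 : ¬ ((j : ℕ) = (i : ℕ)) := by omega
    simp [h1, h2]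
  rw [Matrix.det_of_lowerTriangular _ hT]
  have : ∀ j : Fin (n+1), cycMat (n+1) f t σ (Fin.castSucc j) j.succ = t := by
    intro j; rw [cycMat_minorLast_apply]; simp
  simp only [Matrix.submatrix_apply, this, Finset.prod_const, Finset.card_univ, Fintype.card_fin]

/-- **(S1, PROVED) determinant of `diag f + t N_σ`:** only `id` and the full `(n+1)`-cycle survive. -/
theorem det_cycMat (n : ℕ) (f : Fin (n+1) → R) (t σ : R) :
    (cycMat n f t σ).det = ∏ j, f j + (-1) ^ n * σ * t ^ (n+1) := by
  cases n with
  | zero =>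
    rw [Matrix.det_fin_one, cycMat_apply]
    simp
    ring
  | succ n =>
    rw [Matrix.det_succ_column_zero, Fin.sum_univ_succ, Finset.sum_eq_single (Fin.last n)]
    · simp only [cycMat_col_zero, Fin.succ_last, Fin.succAbove_zero, Fin.succAbove_last]
      rw [det_cycMat_minor00, det_cycMat_minorLast]
      conv_rhs => rw [Fin.prod_univ_succ]
      have h0 : ¬ ((0 : Fin (n+2)) = Fin.last (n+1)) := by
        simp [Fin.ext_iff]
      have hl0 : ¬ (Fin.last (n+1) = (0 : Fin (n+2))) := fun e => h0 e.symm
      simp only [h0, hl0, if_true, if_false, add_zero, zero_add, Fin.val_zero, pow_zero, one_mul,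
        Fin.val_last, Nat.succ_eq_add_one, pow_succ, pow_zero]
      ring
    · intro b _ hb
      have hb' : (b.succ : Fin (n+2)) ≠ 0 := Fin.succ_ne_zero b
      have hb'' : (b.succ : Fin (n+2)) ≠ Fin.last (n+1) := by
        rw [← Fin.succ_last]; exact fun e => hb (Fin.succ_injective _ e)
      simp [cycMat_col_zero, hb', hb'']
    · intro h; exact absurd (Finset.mem_univ _) h

end CycDet

theorem classPencil_apply {m K : ℕ} (σ : ℝ) (a : Fin m → Fin K → ℝ) (l₀ l : Fin K) (i j : Fin m) :
    classPencil σ a l₀ l i j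
      = (if i = j then a i l else 0) + (if l = l₀ then (1:ℝ) else 0) * cyclicShift m σ i j := rfl

/-- entries of the class pencil's polynomial matrix. -/
theorem pencil_apply {m K : ℕ} (σ : ℝ) (d : Fin K → ℕ) (a : Fin m → Fin K → ℝ) (l₀ : Fin K) (i j : Fin m) :
    (∑ l, ((X : ℝ[X]) ^ d l) • (classPencil σ a l₀ l).map C) i j
      = (if i = j then fewnomial d (a i) else 0) + X ^ d l₀ * C (cyclicShift m σ i j) := by
  rw [Matrix.sum_apply]
  have : ∀ l, (((X : ℝ[X]) ^ d l) • (classPencil σ a l₀ l).map C) i j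
      = (if i = j then C (a i l) * X ^ d l else 0)
        + (if l = l₀ then X ^ d l * C (cyclicShift m σ i j) else 0) := by
    intro l
    rw [Matrix.smul_apply, Matrix.map_apply, classPencil_apply, smul_eq_mul, map_add, map_mul, mul_add]
    congr 1
    · by_cases hij : i = j
      · subst hij; simp only [if_true]; exact mul_comm _ _
      · simp [hij]
    · by_cases hl : l = l₀
      · subst hl; simp
      · simp [hl]
  rw [Finset.sum_congr rfl (fun l _ => this l), Finset.sum_add_distrib, Finset.sum_ite_eq' Finset.univ l₀]
  simp only [Finset.mem_univ, if_true]
  congr 1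
  by_cases hij : i = j
  · simp [hij, fewnomial]
  · simp [hij]

/-- the class pencil's polynomial matrix IS `cycMat` with `t = x^{d l₀}`. -/
theorem pencil_eq_cycMat (n K : ℕ) (σ : ℝ) (d : Fin K → ℕ) (a : Fin (n+1) → Fin K → ℝ) (l₀ : Fin K) :
    (∑ l, ((X : ℝ[X]) ^ d l) • (classPencil σ a l₀ l).map C)
      = cycMat n (fun j => fewnomial d (a j)) (X ^ d l₀) (C σ) := by
  ext i j
  rw [pencil_apply, cycMat_apply, add_assoc]
  congr 1
  simp only [cyclicShift, Matrix.of_apply]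
  by_cases hA : (j : ℕ) = (i : ℕ) + 1
  · have hB : ¬ ((i : ℕ) + 1 = n + 1 ∧ (j : ℕ) = 0) := by omega
    rw [if_pos hA, if_pos hA, if_neg hB]; simp
  · rw [if_neg hA, if_neg hA]
    by_cases hB : ((i : ℕ) + 1 = n + 1 ∧ (j : ℕ) = 0)
    · rw [if_pos hB, if_pos hB]; simp
    · rw [if_neg hB, if_neg hB]; simp

/-- **(S1′) pencil form of the identity:** the class pencil's determinant is the product-plus-monomial family. -/
def PencilDetIdentity : Prop :=
  ∀ (m K : ℕ) (σ : ℝ) (d : Fin K → ℕ) (a : Fin m → Fin K → ℝ) (l₀ : Fin K), 1 ≤ m →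
    Matrix.det (∑ l, ((X : ℝ[X]) ^ d l) • (classPencil σ a l₀ l).map C)
      = prodPlusMonomial d a l₀ ((-1) ^ (m - 1) * σ)

/-- **(S1″) the embedding:** general-form V1 restricted to the class IS `ProductPlusOneMDR`. -/
def Embedding : Prop := MatrixDescartesGeneral → ProductPlusOneMDR

/-- **(S1″, PROVED modulo S1′):** the determinant identity is the only input of the embedding
(`m = 0`: the member is the constant `c₀ + 1`, no roots; `m ≥ 1`: instantiate the general crux at the class
pencil with `σ = (−1)^{m−1} c₀` and rewrite). -/
theorem embedding_of_pencilDetIdentity (hId : PencilDetIdentity) : Embedding := by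
  intro hG c q hq
  obtain ⟨K₀, hK₀⟩ := hG c q hq
  refine ⟨K₀, fun K m hK hm d a l₀ c₀ => ?_⟩
  rcases Nat.eq_zero_or_pos m with rfl | hmpos
  · have h0 : (prodPlusMonomial d a l₀ c₀).roots.toFinset.card = 0 := by
      have : prodPlusMonomial d a l₀ c₀ = C (c₀ + 1) := by
        simp [prodPlusMonomial, map_add]
      rw [this, Polynomial.roots_C]; simp
    rw [h0, zero_pow hq.ne']; exact Nat.zero_le _
  · have h := hK₀ K m hK hm d (classPencil ((-1) ^ (m - 1) * c₀) a l₀)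
    rw [hId m K _ d a l₀ hmpos] at h
    have hc : (-1 : ℝ) ^ (m - 1) * ((-1) ^ (m - 1) * c₀) = c₀ := by
      rw [← mul_assoc, ← pow_add, ← two_mul, pow_mul]; simp
    simpa [hc] using h

/-- **(S1′, PROVED):** the class pencil's determinant is the product-plus-monomial family. -/
theorem pencilDetIdentity_holds : PencilDetIdentity := by
  intro m K σ d a l₀ hm
  obtain ⟨n, rfl⟩ : ∃ n, m = n + 1 := ⟨m - 1, by omega⟩
  rw [pencil_eq_cycMat, det_cycMat, prodPlusMonomial]
  simp only [Nat.add_sub_cancel, map_mul, map_pow, map_neg, map_one, ← pow_mul]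
  rw [Nat.mul_comm (d l₀) (n + 1)]
  ring

/-- **DICTIONARY THEOREM (PROVED): general-form V1 ⇒ the `f₁⋯f_m + c·x^{m d₀}` real-root law in V1's window.** -/
theorem embedding_holds : Embedding := embedding_of_pencilDetIdentity pencilDetIdentity_holds

/-- **(PROVED) V1 `MatrixDescartes` itself ⇒ `ProductPlusOneMDR`** (via the tree's symmetry-free form, §B doubling). -/
theorem productPlusOneMDR_of_matrixDescartes
    (h : Summit.ValiantsHypothesis.ValiantsHypothesis.Theses.LacunarySymmetroid.MatrixDescartes) :
    ProductPlusOneMDR :=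
  embedding_holds (matrixDescartesGeneral_of_matrixDescartes h)

/-- **(S2, Rolle step; proved):** adding a constant costs at most one root beyond the critical points. -/
theorem card_roots_C_add_le (g : ℝ[X]) (c : ℝ) :
    (C c + g).roots.toFinset.card ≤ (derivative g).roots.toFinset.card + 1 := by
  have h := Polynomial.card_roots_toFinset_le_derivative (C c + g)
  simpa [derivative_add, derivative_C] using h

/-- **(S3, positive-coefficient rung; provable now by log-convexity of exponential sums):** if every `f_j` has
nonnegative coefficients then `∏ f_j − c` (`c > 0`) has at most two positive zeros — for EVERY `m` and `K`. -/
def PosCoeffRung : Prop :=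
  ∀ (m K : ℕ) (d : Fin K → ℕ) (a : Fin m → Fin K → ℝ) (c : ℝ), (∀ j l, 0 ≤ a j l) → 0 < c →
    ((∏ j, fewnomial d (a j) - C c).roots.toFinset.filter (fun t => 0 < t)).card ≤ 2

/-- **(S4, the logarithmic-derivative reduction; provable now):** on `(0,∞)` minus the zeros of `g = ∏ f_j`,
critical points of `g` are zeros of `Ψ = Σ_j f_j′/f_j`; so the class count is
`≤ 2 + m(K−1) + #{zeros of Ψ off the zero set of g}`. Typed as the polynomial identity behind it. -/
def LogDerivIdentity : Prop :=
  ∀ (m : ℕ) (f : Fin m → ℝ[X]),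
    derivative (∏ j, f j) = ∑ j, derivative (f j) * ∏ i ∈ Finset.univ.erase j, f i

/-- **(S4, PROVED):** Leibniz rule for finite products (Mathlib `Polynomial.derivative_prod_finset`). -/
theorem logDerivIdentity_holds : LogDerivIdentity := by
  intro m f
  rw [Polynomial.derivative_prod_finset]
  refine Finset.sum_congr rfl fun j _ => ?_
  ring


/-! ### Line-level statements added at registration (R266 (A)) -/

/-- monotonicity of the class rows in the bound. -/
theorem ppoLawAt_mono {m K B B' : ℕ} (hBB' : B ≤ B') (h : PPOLawAt m K B) : PPOLawAt m K B' :=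
  fun d a l₀ c => (h d a l₀ c).trans hBB'

/-- **Window arithmetic (S0, pure arithmetic; PROVED below):** a bound polynomial in `mK` is `2^{o(K log K)}` throughout V1's window. -/
def WindowArith : Prop :=
  ∀ C c q : ℕ, 0 < q → ∃ K₀ : ℕ, ∀ K m : ℕ, K₀ ≤ K → m ≤ 2 ^ ((Nat.log 2 K + c) ^ c) →
    ((m * K + 2) ^ C) ^ q ≤ 2 ^ (K * Nat.log 2 K)

/-- **Class row `K = 3` linear in `m` (stub S4′, engine rung E-PPO-1; crit-6 P2):** trinomial factors on a common support. -/
def ClassRowK3Linear : Prop := ∃ C : ℕ, ∀ m : ℕ, PPOLawAt m 3 (C * m + C)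

/-- the `K = 3` rung is the `K = 3` row of `PPOLinearLaw` (proved). -/
theorem classRowK3_of_linearLaw (h : PPOLinearLaw) : ClassRowK3Linear :=
  ⟨7, fun m => ppoLawAt_mono (by ring_nf; omega) (h m 3)⟩

/-- **HEAD (kernel-closed):** window arithmetic + the class law ⇒ the restricted V1. -/
theorem productPlusOneMDR_of : WindowArith → PPOPolyLaw → ProductPlusOneMDR := by
  intro hW hP c q hq
  obtain ⟨C, hC⟩ := hP
  obtain ⟨K₀, hK₀⟩ := hW C c q hq
  refine ⟨K₀, fun K m hK hm d a l₀ c₀ => ?_⟩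
  exact (Nat.pow_le_pow_left (hC m K d a l₀ c₀) q).trans (hK₀ K m hK hm)

/-! ### (S0) window arithmetic — PROVED -/

/-- polynomials are eventually below `2ⁿ` (folklore; same proof as the tree's `Regev2004.exists_mul_pow_le_two_pow`). -/
theorem exists_mul_pow_le_two_pow (C d : ℕ) : ∃ n₀ : ℕ, ∀ n, n₀ ≤ n → C * n ^ d ≤ 2 ^ n := by
  have h := tendsto_pow_const_div_const_pow_of_one_lt d (show (1 : ℝ) < 2 by norm_num)
  have hev := h.eventually (gt_mem_nhds (show (0 : ℝ) < 1 / (C + 1) by positivity))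
  obtain ⟨n₀, hn₀⟩ := Filter.eventually_atTop.1 hev
  refine ⟨n₀, fun n hn => ?_⟩
  have h1 := hn₀ n hn
  rw [div_lt_div_iff₀ (by positivity) (by positivity), one_mul] at h1
  have h2 : (C : ℝ) * n ^ d ≤ 2 ^ n := by nlinarith [pow_nonneg (Nat.cast_nonneg n : (0 : ℝ) ≤ n) d]
  exact_mod_cast h2

/-- **(S0, PROVED) window arithmetic:** a bound polynomial in `mK` is below `2^(K⌊log₂K⌋)` throughout V1's window. -/
theorem windowArith_holds : WindowArith := by
  intro C c q hq
  obtain ⟨n₀, hn₀⟩ := exists_mul_pow_le_two_pow (2 * C * q * 2 ^ (c + 2)) (c + 1)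
  refine ⟨2 ^ (n₀ + 1), fun K m hK hm => ?_⟩
  set L := Nat.log 2 K with hLdef
  have hK0 : K ≠ 0 := by
    intro h; rw [h] at hK; exact absurd hK (Nat.not_le.mpr (by positivity))
  have hL : n₀ + 1 ≤ L := by
    rw [hLdef]; exact Nat.le_log_of_pow_le (by norm_num) hK
  have hL1 : 1 ≤ L := le_trans (Nat.le_add_left 1 n₀) hL
  have h2L : 2 ^ L ≤ K := by rw [hLdef]; exact Nat.pow_log_le_self 2 hK0
  have hKlt : K < 2 ^ (L + 1) := by rw [hLdef]; exact Nat.lt_pow_succ_log_self (by norm_num) K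
  -- the exponent E
  set E := (L + c) ^ c + L + 2 with hE
  have hmK : m * K + 2 ≤ 2 ^ E := by
    have h1 : m * K ≤ 2 ^ ((L + c) ^ c + L + 1) := by
      rw [show (L + c) ^ c + L + 1 = (L + c) ^ c + (L + 1) by ring, pow_add]
      exact Nat.mul_le_mul hm hKlt.le
    have h2 : 2 ≤ 2 ^ ((L + c) ^ c + L + 1) := by
      calc (2:ℕ) = 2 ^ 1 := by norm_num
        _ ≤ 2 ^ ((L + c) ^ c + L + 1) := Nat.pow_le_pow_right (by norm_num) (by omega)
    calc m * K + 2 ≤ 2 ^ ((L + c) ^ c + L + 1) + 2 ^ ((L + c) ^ c + L + 1) := Nat.add_le_add h1 h2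
      _ = 2 ^ E := by rw [hE, ← two_mul, ← pow_succ']
  have hpow : ((m * K + 2) ^ C) ^ q ≤ 2 ^ (E * C * q) := by
    calc ((m * K + 2) ^ C) ^ q ≤ ((2 ^ E) ^ C) ^ q :=
          Nat.pow_le_pow_left (Nat.pow_le_pow_left hmK C) q
      _ = 2 ^ (E * C * q) := by rw [← pow_mul, ← pow_mul, mul_assoc]
  -- E ≤ 2 n^(c+1), n = L + c + 2
  set n := L + c + 2 with hn
  have hn1 : 1 ≤ n := by omega
  have hEn : E ≤ 2 * n ^ (c + 1) := by
    have h1 : (L + c) ^ c ≤ n ^ (c + 1) := by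
      calc (L + c) ^ c ≤ n ^ c := Nat.pow_le_pow_left (by omega) c
        _ ≤ n ^ (c + 1) := Nat.pow_le_pow_right hn1 (Nat.le_succ c)
    have h2 : L + 2 ≤ n ^ (c + 1) := by
      calc L + 2 ≤ n := by omega
        _ = n ^ 1 := (pow_one n).symm
        _ ≤ n ^ (c + 1) := Nat.pow_le_pow_right hn1 (by omega)
    rw [hE]; omega
  have hn₀n : n₀ ≤ n := by omega
  have hmain := hn₀ n hn₀n   -- 2*C*q*2^(c+2) * n^(c+1) ≤ 2^n
  have h2n : (2:ℕ) ^ n = 2 ^ L * 2 ^ (c + 2) := by rw [hn, ← pow_add, add_assoc]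
  have hECq : E * C * q ≤ K * L := by
    have h3 : (2 * C * q * n ^ (c + 1)) * 2 ^ (c + 2) ≤ 2 ^ L * 2 ^ (c + 2) := by
      calc (2 * C * q * n ^ (c + 1)) * 2 ^ (c + 2) = 2 * C * q * 2 ^ (c + 2) * n ^ (c + 1) := by ring
        _ ≤ 2 ^ n := hmain
        _ = 2 ^ L * 2 ^ (c + 2) := h2n
    have h4 : 2 * C * q * n ^ (c + 1) ≤ 2 ^ L := Nat.le_of_mul_le_mul_right h3 (by positivity)
    calc E * C * q ≤ 2 * n ^ (c + 1) * C * q := by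
          have := hEn; exact Nat.mul_le_mul_right q (Nat.mul_le_mul_right C hEn)
      _ = 2 * C * q * n ^ (c + 1) := by ring
      _ ≤ 2 ^ L := h4
      _ ≤ K := h2L
      _ ≤ K * L := Nat.le_mul_of_pos_right K hL1
  exact hpow.trans (Nat.pow_le_pow_right (by norm_num) hECq)



/-! ### δ-WIRING (rev 2–3, 2026-08-28 val-idea-25 g2): landed kernel pieces BY NAME
Every theorem in this section is a one-line instantiation of a landed `Theorems/LacunarySymmetroidMatrixDescartesProductPlusOne*.lean`
theorem (def-free files; the line's `fewnomial` / `prodPlusMonomial` / `PPOLawAt` / … unfold to their shapes by `rfl`). -/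

section Wiring

open Summit.ValiantsHypothesis.ValiantsHypothesis.Theorems.LacunarySymmetroidMatrixDescartes

/-- pin: the landed twin of S0 (p646294) has the line's `WindowArith` … [→ card archive I.1, rev 36] -/
example : WindowArith := ProductPlusOne.windowArith_holds

/-- **Descartes row of the class** (val-lit-p4 g14, p646391): … [→ card archive I.2, rev 36] -/
theorem ppoLawAt_descartesRow (m K : ℕ) : PPOLawAt m K (2 * Nat.choose (m + K - 1) m - 1) :=
  fun d a l₀ c => ProductPlusOneDescartes.ppoLawAt_descartes m K d a l₀ c

/-- **the restricted V1 in every LINEAR window** (p646391): `m ≤ t·K`, … [→ card archive I.3, rev 36] -/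
theorem productPlusOneMDR_linearWindow (q t : ℕ) :
    ∀ K m : ℕ, 2 ^ (q * (t + 1)) ≤ K → m ≤ t * K →
      ∀ (d : Fin K → ℕ) (a : Fin m → Fin K → ℝ) (l₀ : Fin K) (c₀ : ℝ),
        (prodPlusMonomial d a l₀ c₀).roots.toFinset.card ^ q ≤ 2 ^ (K * Nat.log 2 K) :=
  fun K m hK hm d a l₀ c₀ => ProductPlusOneDescartes.productPlusOneMDR_linearWindow q t K m hK hm d a l₀ c₀

/-- **rows `K ≤ 2` of `PPOLinearLaw`** (val-lit-p5 g13, p646723). … [→ card archive I.4, rev 36] -/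
theorem ppoLinearLaw_le_two (m K : ℕ) (hK : K ≤ 2) : PPOLawAt m K (2 * m * K + 3) :=
  fun d a l₀ c => ProductPlusOneLowK.ppoLinearLaw_of_le_two m K hK d a l₀ c

/-- **POWER SECTOR rung** (card `kpt-power-sector` delivered as a rung; … [→ card archive I.5, rev 36] -/
theorem powerSectorMDR :
    ∀ q : ℕ, 0 < q → ∃ K₀ : ℕ, ∀ K k M : ℕ, K₀ ≤ K → M * k ^ 2 ≤ Nat.sqrt K →
      ∀ (d : Fin K → ℕ) (a : Fin M → Fin K → ℝ) (cf : Fin k → ℝ) (α : Fin k → Fin M → ℕ),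
        (∑ i, C (cf i) * ∏ j, (fewnomial d (a j)) ^ (α i j)).roots.toFinset.card ^ q ≤ 2 ^ (K * Nat.log 2 K) :=
  PowerSector.powerSectorMDR_holds

/-- **THE ROLLE FLOOR** (val-lit-p7 g14, p647699): no class law beats … [→ card archive I.6, rev 36] -/
theorem rolleFloor (m K B : ℕ) (hK : 1 ≤ K) (h : PPOLawAt m K B) : m * (K - 1) ≤ B :=
  ProductPlusOne.le_of_ppoLawAt m K B hK h

/-- **a positive-zero bound is a row bound** (`x ↦ −x` closure of the … [→ card archive I.7, rev 36] -/
theorem ppoLawAt_of_posCount (m K B : ℕ)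
    (h : ∀ (d : Fin K → ℕ) (a : Fin m → Fin K → ℝ) (l₀ : Fin K) (c : ℝ),
      ((prodPlusMonomial d a l₀ c).roots.toFinset.filter (fun t => 0 < t)).card ≤ B) :
    PPOLawAt m K (2 * B + 1) :=
  fun d a l₀ c => ProductPlusOne.ppoLawAt_of_pos_count m K B h d a l₀ c

/-- **the c-FREE EULER NUMERATOR** `R(d, a, l₀) = Σ_j B_j · ∏_{i≠j} f_i`, `B_j = Σ_l a j l (d l − d l₀) x^{d l}` = `(x d/dx − m·d l₀)(∏ f_j)`:
the `(K−1)`-nomials `B_j` miss the coupled letter.  (A `def` of the line, like `prodPlusMonomial`; provers inline it.) -/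
noncomputable def eulerNumerator {m K : ℕ} (d : Fin K → ℕ) (a : Fin m → Fin K → ℝ) (l₀ : Fin K) : ℝ[X] :=
  ∑ j, (∑ l, C (a j l * ((d l : ℝ) - d l₀)) * X ^ (d l)) * ∏ i ∈ Finset.univ.erase j, fewnomial d (a i)

/-- **THE COUPLING-FREE REDUCTION** (val-lit-p7 g14, p647394; Rolle for … [→ card archive I.8, rev 36] -/
theorem card_pos_roots_le_euler {m K : ℕ} (d : Fin K → ℕ) (a : Fin m → Fin K → ℝ) (l₀ : Fin K) (c : ℝ) :
    ((prodPlusMonomial d a l₀ c).roots.toFinset.filter (fun t => 0 < t)).card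
      ≤ ((eulerNumerator d a l₀).roots.toFinset.filter (fun t => 0 < t)).card + 1 :=
  ProductPlusOne.card_pos_roots_class_le_euler d a l₀ c

/-- **S4″ — the c-free EULER BOUND at `K = 3`** (optional SUFFICIENT rung above S4′; crit-6 16:18Z (ii)): `Z₊(R) ≤ C₀·m + C₀` for trinomial
factors on a common support.  STRICTLY STRONGER than `ClassRowK3Linear` (all positive critical points of `x^{−N}∏ f_j`, not one level);
may be FALSE with S4′ true (Morse staircase: `n` bumps at pairwise different heights); decided by E-PPO-1's c-free column. -/
def EulerBoundK3 : Prop :=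
  ∃ C₀ : ℕ, ∀ (m : ℕ) (d : Fin 3 → ℕ) (a : Fin m → Fin 3 → ℝ) (l₀ : Fin 3),
    ((eulerNumerator d a l₀).roots.toFinset.filter (fun t => 0 < t)).card ≤ C₀ * m + C₀

/-- **the c-free POLYNOMIAL Euler bound** (sufficient form of S5): `Z₊(R) ≤ (mK+2)^{C₀}` for every format and support. -/
def EulerBoundPoly : Prop :=
  ∃ C₀ : ℕ, ∀ (m K : ℕ) (d : Fin K → ℕ) (a : Fin m → Fin K → ℝ) (l₀ : Fin K),
    ((eulerNumerator d a l₀).roots.toFinset.filter (fun t => 0 < t)).card ≤ (m * K + 2) ^ C₀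

/-- **kernel joint S4″ ⇒ S4′** (val-lit-p7 g14, p648861; `C = 2C₀ + 3`). … [→ card archive I.9, rev 36] -/
theorem classRowK3_of_eulerBoundK3 (h : EulerBoundK3) : ClassRowK3Linear := by
  obtain ⟨C₀, hC₀⟩ := h
  exact ProductPlusOne.classRowK3_of_eulerBound C₀ hC₀

/-- **kernel joint (c-free poly bound) ⇒ S5** (p648861; exponent `C₀ + 3`). … [→ card archive I.10, rev 36] -/
theorem ppoPolyLaw_of_eulerBoundPoly (h : EulerBoundPoly) : PPOPolyLaw := by
  obtain ⟨C₀, hC₀⟩ := h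
  exact ProductPlusOne.ppoPolyLaw_of_eulerBound C₀ hC₀

/-- **S4⁗ — THE FLOOR of S4′/S4″** (rev 15; R297 (7) director-valiant g16 2026-08-28T21:04Z «LINE (A) research floor = incoherent sectors — ONE registered
stub»).  `K = 3`, BOTTOM coupling `l₀ = 0`, EVERY support `d 0 < d 1 < d 2` (no ratio window), every `m`, ANY company of factors each having AT MOST ONE
sign change (no strict-dip pattern; types T1 `(+,+,+)` / T4 `(+,+,−)` / T5 `(+,−,−)` of val-lit-p7 g15's memo NOTE-p7g15-18050-LINEA-incoherent-cell.md,
degenerate letters allowed): the c-free Euler count is LINEAR in `m`.  Kernel sub-sectors: tame ratio ≤ 4, coherent-all, lower-signed-all (header);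
open core = T5 factors at ratio > 4 (pure: memo §6 `T5CellLinear`; and in company).  The top-coupling twin is the same cell by `x ↦ 1/x`. -/
def OneChangeFloorK3 : Prop :=
  ∃ C : ℕ, ∀ (m : ℕ) (d : Fin 3 → ℕ) (a : Fin m → Fin 3 → ℝ), d 0 < d 1 → d 1 < d 2 →
    (∀ j, ¬ (a j 0 * a j 1 < 0 ∧ a j 1 * a j 2 < 0)) →
    ((eulerNumerator d a 0).roots.toFinset.filter (fun t => 0 < t)).card ≤ C * m + C

/-- **kernel joint S4″ ⇒ S4⁗** (the floor is a cell of the c-free Euler … [→ card archive I.11, rev 36] -/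
theorem oneChangeFloorK3_of_eulerBoundK3 (h : EulerBoundK3) : OneChangeFloorK3 := by
  obtain ⟨C₀, hC₀⟩ := h
  exact ⟨C₀, fun m d a _ _ _ => hC₀ m d a 0⟩

/-- **kernel joint S4⁗ ⇒ its MEMBER cell** (S4′ currency, via … [→ card archive I.12, rev 36] -/
theorem oneChangeFloorK3_members (h : OneChangeFloorK3) :
    ∃ C : ℕ, ∀ (m : ℕ) (d : Fin 3 → ℕ) (a : Fin m → Fin 3 → ℝ), d 0 < d 1 → d 1 < d 2 →
      (∀ j, ¬ (a j 0 * a j 1 < 0 ∧ a j 1 * a j 2 < 0)) → ∀ c : ℝ,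
      ((prodPlusMonomial d a 0 c).roots.toFinset.filter (fun t => 0 < t)).card ≤ C * m + (C + 1) := by
  obtain ⟨C, hC⟩ := h
  refine ⟨C, fun m d a h01 h12 hone c => ?_⟩
  have h1 := card_pos_roots_le_euler d a 0 c
  have h2 := hC m d a h01 h12 hone
  omega

/-- **EB2-W — THE COUPLING-FREE, WINDOW-FREE SUCCESSOR CUT OF THE FLOOR** (owner memo §14; typed per crit-6 g3 #48 w1–w5, crit-1 g4 #160;
rev 24).  CONJECTURE/TEXT, UNPROVED: a one-change `K = 3` company has `Z₊(W(∏ j, fewnomial d (a j))) ≤ C·m + C`, where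
`W(P) = P·θ²P − (θP)² = Σ_j W(f_j)·∏_{i≠j} f_i²` (✓ `company_logWronskian_prod`) and each `W(f_j)` is a three-term fewnomial with ONE sign
change for an incoherent row, none for a one-signed row, a monomial for a binomial row.  NOT a stub (R297 (7): the floor is ONE stub,
`stub_oneChangeFloorK3`); it implies `OneChangeFloorK3` with constant `C + 3` (`oneChangeFloorK3_of_wronskianBudgetK3`, via val-lit-p5 g15's
N2 + N3) and nothing implies it back.  Same currency as the floor: `∃ C : ℕ`, the class binders and hypotheses of `OneChangeFloorK3` verbatim.
LOSSY for sharp constants (crit-1 #160 (γ): on the binomial-puller family `eulerNumerator` has ≤ 3 zeros for every level while `W(P)` has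
≥ 2m − 2) — a FLOOR device only.  Located: C ≥ 3 FORCED — val-v1x-eng-11 g3 window family (d = (0,1,31), T5 slow tails + P3 slow bumps,
m = 2x+1) has `Z₊(W(∏ fewnomial)) = 3m − 3` EXACT at m = 5/7/9 (kit j322715; crit-1 g4 #172 and crit-6 g3 #51 independent exact lower-bound
reproductions), so C = 2 is refuted from m = 7 and the E(n)/wz160c «2 per row» family (C ≥ 2, crit-1 `wz160c_cert.json`) is not extremal;
heuristic sup 3 (eng-11 knee/window bookkeeping W-CB); `∃ C` itself consistent at C = 3; stress families m ≤ 52: `Z₊(W)/m ≤ 0.88`;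
lower mechanism along the poles (crit-6 #48 (iii)). -/
def WronskianBudgetK3 : Prop :=
  ∃ C : ℕ, ∀ (m : ℕ) (d : Fin 3 → ℕ) (a : Fin m → Fin 3 → ℝ), d 0 < d 1 → d 1 < d 2 →
    (∀ j, ¬ (a j 0 * a j 1 < 0 ∧ a j 1 * a j 2 < 0)) →
    (((∏ j, fewnomial d (a j)) * (X * derivative (X * derivative (∏ j, fewnomial d (a j))))
        - (X * derivative (∏ j, fewnomial d (a j))) ^ 2).roots.toFinset.filter (fun t => 0 < t)).card ≤ C * m + C

/-- **JOINT: EB2-W ⇒ THE FLOOR** (sorry-free; rev 24): … [→ card archive I.13, rev 36] -/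
theorem oneChangeFloorK3_of_wronskianBudgetK3 (h : WronskianBudgetK3) : OneChangeFloorK3 := by
  obtain ⟨C, hC⟩ := h
  refine ⟨C + 3, fun m d a h01 h12 hone => ?_⟩
  have h1 : ((eulerNumerator d a 0).roots.toFinset.filter (fun t => 0 < t)).card
      ≤ (((∏ j, fewnomial d (a j)) * (X * derivative (X * derivative (∏ j, fewnomial d (a j))))
            - (X * derivative (∏ j, fewnomial d (a j))) ^ 2).roots.toFinset.filter (fun t => 0 < t)).card + 2 * m + 1 :=
    ProductPlusOne.card_posRoots_eulerNumerator_le_wronskian_add_of_oneChange d h01 h12 a hone 0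
  have h2 := hC m d a h01 h12 hone
  have h4 : (C + 3) * m + (C + 3) = C * m + C + (3 * m + 3) := by ring
  rw [h4]
  omega

/-- **`x ↦ 1/x` closure of the class** (val-lit-p7 g14, p650886): reversing … [→ card archive I.14, rev 36] -/
theorem card_pos_roots_reverse {m K : ℕ} (d : Fin K → ℕ) (D : ℕ) (hD : ∀ l, d l ≤ D) (a : Fin m → Fin K → ℝ)
    (l₀ : Fin K) (c : ℝ) :
    ((prodPlusMonomial (fun l => D - d l) a l₀ c).roots.toFinset.filter (fun t => 0 < t)).card
      = ((prodPlusMonomial d a l₀ c).roots.toFinset.filter (fun t => 0 < t)).card :=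
  ProductPlusOne.card_pos_roots_class_reverse d D hD a l₀ c

/-- **SECTOR 1 of S4′ CLOSED — no-dip factors, bottom coupling** … [→ card archive I.15, rev 36] -/
theorem classRowK3_tameBottom {m : ℕ} (d : Fin 3 → ℕ) (h01 : d 0 < d 1) (h12 : d 1 < d 2)
    (h4 : d 2 - d 0 ≤ 4 * (d 1 - d 0)) (a : Fin m → Fin 3 → ℝ) (hac : ∀ j, a j 0 * a j 2 < 0) (c : ℝ) :
    ((prodPlusMonomial d a 0 c).roots.toFinset.filter (fun t => 0 < t)).card ≤ 2 * m + 2 :=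
  ProductPlusOne.tame_sector_class d h01 h12 h4 a hac c

/-- sector 1 in the row currency (all real zeros), even extreme exponents … [→ card archive I.16, rev 36] -/
theorem classRowK3_tameBottom_real {m : ℕ} (d : Fin 3 → ℕ) (h01 : d 0 < d 1) (h12 : d 1 < d 2)
    (h4 : d 2 - d 0 ≤ 4 * (d 1 - d 0)) (hev : Even (d 0 + d 2)) (a : Fin m → Fin 3 → ℝ)
    (hac : ∀ j, a j 0 * a j 2 < 0) (c : ℝ) :
    (prodPlusMonomial d a 0 c).roots.toFinset.card ≤ 2 * (2 * m + 2) + 1 :=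
  ProductPlusOne.tame_sector_class_real d h01 h12 h4 hev a hac c

/-- **SECTOR 1′ of S4′ CLOSED — no-dip factors, TOP coupling** (val-lit-p7 … [→ card archive I.17, rev 36] -/
theorem classRowK3_tameTop {m : ℕ} (d : Fin 3 → ℕ) (h01 : d 0 < d 1) (h12 : d 1 < d 2)
    (h4 : d 2 - d 0 ≤ 4 * (d 2 - d 1)) (a : Fin m → Fin 3 → ℝ) (hac : ∀ j, a j 0 * a j 2 < 0) (c : ℝ) :
    ((prodPlusMonomial d a 2 c).roots.toFinset.filter (fun t => 0 < t)).card ≤ 2 * m + 2 :=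
  ProductPlusOne.tame_sector_class_top d h01 h12 h4 a hac c

/-- the lacunary instance of record (crit-1 #82 (iii)): support … [→ card archive I.18, rev 36] -/
example {m : ℕ} (a : Fin m → Fin 3 → ℝ) (hac : ∀ j, a j 0 * a j 2 < 0) (c : ℝ) :
    ((prodPlusMonomial (![0, 1000, 3999] : Fin 3 → ℕ) a 0 c).roots.toFinset.filter (fun t => 0 < t)).card ≤ 2 * m + 2 :=
  classRowK3_tameBottom _ (by decide) (by decide) (by decide) a hac c

/-- **SECTOR 1 of S4′, SIGN-AWARE SHARPENING `2m+2 → m+2`** (val-lit-p5 g13 … [→ card archive I.19, rev 36] -/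
theorem classRowK3_tameBottom_signed {m : ℕ} (d : Fin 3 → ℕ) (h01 : d 0 < d 1) (h12 : d 1 < d 2)
    (h4 : d 2 - d 0 ≤ 4 * (d 1 - d 0)) (a : Fin m → Fin 3 → ℝ) (hac : ∀ j, a j 0 * a j 2 < 0) (c : ℝ) :
    ((prodPlusMonomial d a 0 c).roots.toFinset.filter (fun t => 0 < t)).card ≤ m + 2 :=
  ProductPlusOne.tame_sector_class_signed d h01 h12 h4 a hac c

/-- sector 1′ (TOP coupling), sign-aware sharpening `≤ m + 2` (p661021, rev … [→ card archive I.20, rev 36] -/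
theorem classRowK3_tameTop_signed {m : ℕ} (d : Fin 3 → ℕ) (h01 : d 0 < d 1) (h12 : d 1 < d 2)
    (h4 : d 2 - d 0 ≤ 4 * (d 2 - d 1)) (a : Fin m → Fin 3 → ℝ) (hac : ∀ j, a j 0 * a j 2 < 0) (c : ℝ) :
    ((prodPlusMonomial d a 2 c).roots.toFinset.filter (fun t => 0 < t)).card ≤ m + 2 :=
  ProductPlusOne.tame_sector_class_signed_top d h01 h12 h4 a hac c

/-- the lacunary instance of record, sharpened: support `(0, 1000, 3999)`, … [→ card archive I.21, rev 36] -/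
example {m : ℕ} (a : Fin m → Fin 3 → ℝ) (hac : ∀ j, a j 0 * a j 2 < 0) (c : ℝ) :
    ((prodPlusMonomial (![0, 1000, 3999] : Fin 3 → ℕ) a 0 c).roots.toFinset.filter (fun t => 0 < t)).card ≤ m + 2 :=
  classRowK3_tameBottom_signed _ (by decide) (by decide) (by decide) a hac c

/-- **SECTOR 2 of S4′ CLOSED — SHARP two-zero dips, EVERY support, EVERY** … [→ card archive I.22, rev 36] -/
theorem classRowK3_sharp {m : ℕ} (d : Fin 3 → ℕ) (h01 : d 0 < d 1) (h12 : d 1 < d 2) (l₀ : Fin 3)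
    (a : Fin m → Fin 3 → ℝ) (hpos : ∀ j, 0 < a j 0 ∧ 0 < a j 2)
    (hwit : ∀ j, ∃ x₀ : ℝ, 0 < x₀ ∧ a j 0 * x₀ ^ (d 0) + a j 1 * x₀ ^ (d 1) + a j 2 * x₀ ^ (d 2) < 0) (c : ℝ) :
    ((prodPlusMonomial d a l₀ c).roots.toFinset.filter (fun t => 0 < t)).card ≤ 4 * m + 2 :=
  ProductPlusOne.sharp_sector_class d h01 h12 l₀ a hpos hwit c

/-- **SECTOR 3 of S4′ CLOSED — MIXED company in ONE chart** (val-lit-p7 … [→ card archive I.23, rev 36] -/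
theorem classRowK3_mixed {m : ℕ} (d : Fin 3 → ℕ) (h01 : d 0 < d 1) (h12 : d 1 < d 2)
    (h2 : 2 * (d 1 - d 0) ≤ d 2 - d 0) (h4 : d 2 - d 0 ≤ 4 * (d 1 - d 0)) (a : Fin m → Fin 3 → ℝ)
    (hfac : ∀ j, a j 0 * a j 2 < 0 ∨
      (0 < a j 0 ∧ 0 < a j 2 ∧ ∃ x₀ : ℝ, 0 < x₀ ∧ a j 0 * x₀ ^ (d 0) + a j 1 * x₀ ^ (d 1) + a j 2 * x₀ ^ (d 2) < 0)) (c : ℝ) :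
    ((prodPlusMonomial d a 0 c).roots.toFinset.filter (fun t => 0 < t)).card ≤ 4 * m + 2 :=
  ProductPlusOne.mixed_sector_class d h01 h12 h2 h4 a hfac c

/-- **SECTOR 3′ of S4′ CLOSED — MIXED company, TOP coupling** (val-lit-p7 … [→ card archive I.24, rev 36] -/
theorem classRowK3_mixedTop {m : ℕ} (d : Fin 3 → ℕ) (h01 : d 0 < d 1) (h12 : d 1 < d 2)
    (h2 : 2 * (d 2 - d 1) ≤ d 2 - d 0) (h4 : d 2 - d 0 ≤ 4 * (d 2 - d 1)) (a : Fin m → Fin 3 → ℝ)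
    (hfac : ∀ j, a j 0 * a j 2 < 0 ∨
      (0 < a j 0 ∧ 0 < a j 2 ∧ ∃ x₀ : ℝ, 0 < x₀ ∧ a j 0 * x₀ ^ (d 0) + a j 1 * x₀ ^ (d 1) + a j 2 * x₀ ^ (d 2) < 0)) (c : ℝ) :
    ((prodPlusMonomial d a 2 c).roots.toFinset.filter (fun t => 0 < t)).card ≤ 4 * m + 2 :=
  ProductPlusOne.mixed_sector_class_top d h01 h12 h2 h4 a hfac c

/-! #### S4″ sectors (c-free Euler count `Z₊(R)`, `R = eulerNumerator d a l₀`; … [prose → card archive I.25, rev 36] -/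

/-- **S4″, NO-DIP sector, bottom coupling:** `a j 0 · a j 2 < 0`, ratio … [→ card archive I.26, rev 36] -/
theorem eulerBoundK3_tameBottom {m : ℕ} (d : Fin 3 → ℕ) (h01 : d 0 < d 1) (h12 : d 1 < d 2) (h4 : d 2 - d 0 ≤ 4 * (d 1 - d 0))
    (a : Fin m → Fin 3 → ℝ) (hac : ∀ j, a j 0 * a j 2 < 0) :
    ((eulerNumerator d a 0).roots.toFinset.filter (fun t => 0 < t)).card ≤ 2 * m + 2 :=
  ProductPlusOne.eulerBound_tame d h01 h12 h4 a hac

/-- **S4″, SHARP sector, every support and coupling:** witnessed two-zero … [→ card archive I.27, rev 36] -/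
theorem eulerBoundK3_sharp {m : ℕ} (d : Fin 3 → ℕ) (h01 : d 0 < d 1) (h12 : d 1 < d 2) (l₀ : Fin 3)
    (a : Fin m → Fin 3 → ℝ) (hpos : ∀ j, 0 < a j 0 ∧ 0 < a j 2)
    (hwit : ∀ j, ∃ x₀ : ℝ, 0 < x₀ ∧ a j 0 * x₀ ^ (d 0) + a j 1 * x₀ ^ (d 1) + a j 2 * x₀ ^ (d 2) < 0) :
    ((eulerNumerator d a l₀).roots.toFinset.filter (fun t => 0 < t)).card ≤ 4 * m + 1 :=
  ProductPlusOne.eulerBound_sharp d h01 h12 l₀ a hpos hwit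

/-- **S4″, MIXED sector, bottom coupling:** no-dip or witnessed sharp dip … [→ card archive I.28, rev 36] -/
theorem eulerBoundK3_mixed {m : ℕ} (d : Fin 3 → ℕ) (h01 : d 0 < d 1) (h12 : d 1 < d 2)
    (h2 : 2 * (d 1 - d 0) ≤ d 2 - d 0) (h4 : d 2 - d 0 ≤ 4 * (d 1 - d 0)) (a : Fin m → Fin 3 → ℝ)
    (hfac : ∀ j, a j 0 * a j 2 < 0 ∨
      (0 < a j 0 ∧ 0 < a j 2 ∧ ∃ x₀ : ℝ, 0 < x₀ ∧ a j 0 * x₀ ^ (d 0) + a j 1 * x₀ ^ (d 1) + a j 2 * x₀ ^ (d 2) < 0)) :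
    ((eulerNumerator d a 0).roots.toFinset.filter (fun t => 0 < t)).card ≤ 4 * m + 1 :=
  ProductPlusOne.eulerBound_mixed d h01 h12 h2 h4 a hfac

/-- **S4″, NO-DIP sector, TOP coupling** (val-lit-p5 g13 p659180 … [→ card archive I.29, rev 36] -/
theorem eulerBoundK3_tameTop {m : ℕ} (d : Fin 3 → ℕ) (h01 : d 0 < d 1) (h12 : d 1 < d 2) (h4 : d 2 - d 0 ≤ 4 * (d 2 - d 1))
    (a : Fin m → Fin 3 → ℝ) (hac : ∀ j, a j 0 * a j 2 < 0) :
    ((eulerNumerator d a 2).roots.toFinset.filter (fun t => 0 < t)).card ≤ 2 * m + 2 :=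
  ProductPlusOne.eulerBound_tameTop d h01 h12 h4 a hac

/-- **S4″, MIXED sector, TOP coupling** (p659180, rev 7 wiring): ratio … [→ card archive I.30, rev 36] -/
theorem eulerBoundK3_mixedTop {m : ℕ} (d : Fin 3 → ℕ) (h01 : d 0 < d 1) (h12 : d 1 < d 2)
    (h2 : 2 * (d 2 - d 1) ≤ d 2 - d 0) (h4 : d 2 - d 0 ≤ 4 * (d 2 - d 1)) (a : Fin m → Fin 3 → ℝ)
    (hfac : ∀ j, a j 0 * a j 2 < 0 ∨
      (0 < a j 0 ∧ 0 < a j 2 ∧ ∃ x₀ : ℝ, 0 < x₀ ∧ a j 0 * x₀ ^ (d 0) + a j 1 * x₀ ^ (d 1) + a j 2 * x₀ ^ (d 2) < 0)) :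
    ((eulerNumerator d a 2).roots.toFinset.filter (fun t => 0 < t)).card ≤ 4 * m + 1 :=
  ProductPlusOne.eulerBound_mixedTop d h01 h12 h2 h4 a hfac

/-! #### COHERENT one-zero factors, ANY support ratio … [prose → card § «Skeleton header archive E» block E3.1, rev 32] -/

/-- **S4″, COHERENT sector, bottom coupling, ANY ratio:** `Z₊(R) ≤ 2m + 2`. … [→ card archive I.31, rev 36] -/
theorem eulerBoundK3_coherentBottom {m : ℕ} (d : Fin 3 → ℕ) (h01 : d 0 < d 1) (h12 : d 1 < d 2)
    (a : Fin m → Fin 3 → ℝ) (hac : ∀ j, a j 0 * a j 2 < 0) (hab : ∀ j, 0 ≤ a j 0 * a j 1) :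
    ((eulerNumerator d a 0).roots.toFinset.filter (fun t => 0 < t)).card ≤ 2 * m + 2 :=
  ProductPlusOne.eulerBound_coherent d h01 h12 a hac hab

/-- **S4″, COHERENT sector, top coupling, ANY ratio:** `Z₊(R) ≤ 2m + 2`. … [→ card archive I.32, rev 36] -/
theorem eulerBoundK3_coherentTop {m : ℕ} (d : Fin 3 → ℕ) (h01 : d 0 < d 1) (h12 : d 1 < d 2)
    (a : Fin m → Fin 3 → ℝ) (hac : ∀ j, a j 0 * a j 2 < 0) (hcb : ∀ j, 0 ≤ a j 2 * a j 1) :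
    ((eulerNumerator d a 2).roots.toFinset.filter (fun t => 0 < t)).card ≤ 2 * m + 2 :=
  ProductPlusOne.eulerBound_coherentTop d h01 h12 a hac hcb

/-- **S4′, COHERENT sector, bottom coupling, ANY ratio:** `Z₊ ≤ 2m + 3`. … [→ card archive I.33, rev 36] -/
theorem classRowK3_coherentBottom {m : ℕ} (d : Fin 3 → ℕ) (h01 : d 0 < d 1) (h12 : d 1 < d 2)
    (a : Fin m → Fin 3 → ℝ) (hac : ∀ j, a j 0 * a j 2 < 0) (hab : ∀ j, 0 ≤ a j 0 * a j 1) (c : ℝ) :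
    ((prodPlusMonomial d a 0 c).roots.toFinset.filter (fun t => 0 < t)).card ≤ 2 * m + 3 :=
  ProductPlusOne.coherent_sector_class d h01 h12 a hac hab c

/-- **S4′, COHERENT sector, top coupling, ANY ratio:** `Z₊ ≤ 2m + 3`. … [→ card archive I.34, rev 36] -/
theorem classRowK3_coherentTop {m : ℕ} (d : Fin 3 → ℕ) (h01 : d 0 < d 1) (h12 : d 1 < d 2)
    (a : Fin m → Fin 3 → ℝ) (hac : ∀ j, a j 0 * a j 2 < 0) (hcb : ∀ j, 0 ≤ a j 2 * a j 1) (c : ℝ) :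
    ((prodPlusMonomial d a 2 c).roots.toFinset.filter (fun t => 0 < t)).card ≤ 2 * m + 3 :=
  ProductPlusOne.coherent_sector_class_top d h01 h12 a hac hcb c

/-- the super-lacunary corner of record (val-idea-25 harvest ask): support … [→ card archive I.35, rev 36] -/
example {m : ℕ} (hm : 0 < m) (a : Fin m → Fin 3 → ℝ) (hac : ∀ j, a j 0 * a j 2 < 0) (hab : ∀ j, 0 ≤ a j 0 * a j 1) (c : ℝ) :
    ((prodPlusMonomial (![0, 1, 8 * m] : Fin 3 → ℕ) a 0 c).roots.toFinset.filter (fun t => 0 < t)).card ≤ 2 * m + 3 :=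
  classRowK3_coherentBottom _ (by simp) (by simp; omega) a hac hab c

/-! #### S5 sector: ALL-SHARP members, EVERY format `(m, K)` (val-lit-p7 g14 p659670 … [prose → card archive I.36, rev 36] -/

/-- **FIRST SECTOR OF S5 — Descartes-sharp factors, every `K ≥ 2`, every** … [→ card archive I.37, rev 36] -/
theorem polyLaw_sharpK {m K : ℕ} (hK : 2 ≤ K) (d : Fin K → ℕ) (hd : StrictMono d) (l₀ : Fin K)
    (a : Fin m → Fin K → ℝ) (ha : ∀ j l, a j l ≠ 0)
    (hsharp : ∀ j, K - 1 ≤ ((∑ l, C (a j l) * X ^ (d l) : ℝ[X]).roots.toFinset.filter (fun t => 0 < t)).card) (c : ℝ) :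
    ((prodPlusMonomial d a l₀ c).roots.toFinset.filter (fun t => 0 < t)).card ≤ 2 * ((K - 1) * m + 1) :=
  ProductPlusOne.sharpK_sector_class hK d hd l₀ a ha hsharp c

/-- **S5, c-free side (`EulerBoundPoly`), ALL-SHARP sector, every `K ≥ 2`,** … [→ card archive I.38, rev 36] -/
theorem eulerBoundPoly_sharpK {m K : ℕ} (hK : 2 ≤ K) (d : Fin K → ℕ) (hd : StrictMono d) (l₀ : Fin K)
    (a : Fin m → Fin K → ℝ) (ha : ∀ j l, a j l ≠ 0)
    (hsharp : ∀ j, K - 1 ≤ ((∑ l, C (a j l) * X ^ (d l) : ℝ[X]).roots.toFinset.filter (fun t => 0 < t)).card) :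
    ((eulerNumerator d a l₀).roots.toFinset.filter (fun t => 0 < t)).card ≤ 2 * ((K - 1) * m) + 1 :=
  ProductPlusOne.eulerBound_sharpK hK d hd l₀ a ha hsharp

/-- **S5 ALL-SHARP sector, SIGN-AWARE constant** (val-lit-p7 g14 p663839 … [→ card archive I.39, rev 36] -/
theorem polyLaw_sharpK_signed {m K : ℕ} (hK : 2 ≤ K) (d : Fin K → ℕ) (hd : StrictMono d) (l₀ : Fin K)
    (a : Fin m → Fin K → ℝ) (ha : ∀ j l, a j l ≠ 0)
    (hsharp : ∀ j, K - 1 ≤ ((∑ l, C (a j l) * X ^ (d l) : ℝ[X]).roots.toFinset.filter (fun t => 0 < t)).card) (c : ℝ) :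
    ((prodPlusMonomial d a l₀ c).roots.toFinset.filter (fun t => 0 < t)).card ≤ (K - 1) * m + 2 :=
  ProductPlusOne.sharpK_sector_class_signed hK d hd l₀ a ha hsharp c

/-- **S4′ MIXED sector (bottom coupling, ratio window [2,4]), SIGN-AWARE** … [→ card archive I.40, rev 36] -/
theorem classRowK3_mixed_signed {m : ℕ} (d : Fin 3 → ℕ) (h01 : d 0 < d 1) (h12 : d 1 < d 2)
    (h2 : 2 * (d 1 - d 0) ≤ d 2 - d 0) (h4 : d 2 - d 0 ≤ 4 * (d 1 - d 0)) (a : Fin m → Fin 3 → ℝ)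
    (hfac : ∀ j, a j 0 * a j 2 < 0 ∨
      (0 < a j 0 ∧ 0 < a j 2 ∧ ∃ x₀ : ℝ, 0 < x₀ ∧ a j 0 * x₀ ^ (d 0) + a j 1 * x₀ ^ (d 1) + a j 2 * x₀ ^ (d 2) < 0)) (c : ℝ) :
    ((prodPlusMonomial d a 0 c).roots.toFinset.filter (fun t => 0 < t)).card ≤ 2 * m + 2 :=
  ProductPlusOne.mixed_sector_class_signed d h01 h12 h2 h4 a hfac c

/-- **S4′ MIXED sector, TOP coupling (window [2,4] from the top),** … [→ card archive I.41, rev 36] -/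
theorem classRowK3_mixedTop_signed {m : ℕ} (d : Fin 3 → ℕ) (h01 : d 0 < d 1) (h12 : d 1 < d 2)
    (h2 : 2 * (d 2 - d 1) ≤ d 2 - d 0) (h4 : d 2 - d 0 ≤ 4 * (d 2 - d 1)) (a : Fin m → Fin 3 → ℝ)
    (hfac : ∀ j, a j 0 * a j 2 < 0 ∨
      (0 < a j 0 ∧ 0 < a j 2 ∧ ∃ x₀ : ℝ, 0 < x₀ ∧ a j 0 * x₀ ^ (d 0) + a j 1 * x₀ ^ (d 1) + a j 2 * x₀ ^ (d 2) < 0)) (c : ℝ) :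
    ((prodPlusMonomial d a 2 c).roots.toFinset.filter (fun t => 0 < t)).card ≤ 2 * m + 2 :=
  ProductPlusOne.mixed_sector_class_signed_top d h01 h12 h2 h4 a hfac c

/-- **S4′ SHARP sector (K = 3), SIGN-AWARE constant** (p664901, rev 12 … [→ card archive I.42, rev 36] -/
theorem classRowK3_sharp_signed {m : ℕ} (d : Fin 3 → ℕ) (hd : StrictMono d) (l₀ : Fin 3) (a : Fin m → Fin 3 → ℝ)
    (hpos : ∀ j, 0 < a j 0 ∧ 0 < a j 2)
    (hwit : ∀ j, ∃ x₀ : ℝ, 0 < x₀ ∧ a j 0 * x₀ ^ (d 0) + a j 1 * x₀ ^ (d 1) + a j 2 * x₀ ^ (d 2) < 0) (c : ℝ) :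
    ((prodPlusMonomial d a l₀ c).roots.toFinset.filter (fun t => 0 < t)).card ≤ 2 * m + 2 :=
  ProductPlusOne.sharp_sector_class_signed d hd l₀ a hpos hwit c

/-- **S5, c-free side, COHERENT one-zero sector, EVERY `K ≥ 3`, every** … [→ card archive I.43, rev 36] -/
theorem eulerBoundPoly_coherentK {m K : ℕ} (hK : 3 ≤ K) (d : Fin K → ℕ) (hd : StrictMono d) (a : Fin m → Fin K → ℝ)
    (hcoh : ∀ j (l : Fin K), (l : ℕ) < K - 1 → 0 < a j ⟨0, by omega⟩ * a j l)
    (htop : ∀ j, a j ⟨0, by omega⟩ * a j ⟨K - 1, by omega⟩ < 0) :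
    ((eulerNumerator d a ⟨0, by omega⟩).roots.toFinset.filter (fun t => 0 < t)).card ≤ 2 * m + 1 :=
  ProductPlusOne.eulerBound_coherentK hK d hd a hcoh htop

/-- **S5, member currency, COHERENT one-zero sector, EVERY `K ≥ 3`,** … [→ card archive I.44, rev 36] -/
theorem polyLaw_coherentK_signed {m K : ℕ} (hK : 3 ≤ K) (d : Fin K → ℕ) (hd : StrictMono d) (a : Fin m → Fin K → ℝ)
    (hcoh : ∀ j (l : Fin K), (l : ℕ) < K - 1 → 0 < a j ⟨0, by omega⟩ * a j l)
    (htop : ∀ j, a j ⟨0, by omega⟩ * a j ⟨K - 1, by omega⟩ < 0) (c : ℝ) :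
    ((prodPlusMonomial d a ⟨0, by omega⟩ c).roots.toFinset.filter (fun t => 0 < t)).card ≤ m + 2 :=
  ProductPlusOne.coherent_sector_classK_signed hK d hd a hcoh htop c

/-- **S5, c-free side, COHERENT one-zero sector, TOP coupling, EVERY** … [→ card archive I.45, rev 36] -/
theorem eulerBoundPoly_coherentK_top {m K : ℕ} (hK : 3 ≤ K) (d : Fin K → ℕ) (hd : StrictMono d) (a : Fin m → Fin K → ℝ)
    (hcoh : ∀ j (l : Fin K), 0 < (l : ℕ) → 0 < a j ⟨K - 1, by omega⟩ * a j l)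
    (hbot : ∀ j, a j ⟨K - 1, by omega⟩ * a j ⟨0, by omega⟩ < 0) :
    ((eulerNumerator d a ⟨K - 1, by omega⟩).roots.toFinset.filter (fun t => 0 < t)).card ≤ 2 * m + 1 :=
  ProductPlusOne.eulerBound_coherentK_top hK d hd a hcoh hbot

/-- **S5, member currency, COHERENT one-zero sector, TOP coupling, EVERY** … [→ card archive I.46, rev 36] -/
theorem polyLaw_coherentK_top {m K : ℕ} (hK : 3 ≤ K) (d : Fin K → ℕ) (hd : StrictMono d) (a : Fin m → Fin K → ℝ)
    (hcoh : ∀ j (l : Fin K), 0 < (l : ℕ) → 0 < a j ⟨K - 1, by omega⟩ * a j l)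
    (hbot : ∀ j, a j ⟨K - 1, by omega⟩ * a j ⟨0, by omega⟩ < 0) (c : ℝ) :
    ((prodPlusMonomial d a ⟨K - 1, by omega⟩ c).roots.toFinset.filter (fun t => 0 < t)).card ≤ 2 * m + 2 :=
  ProductPlusOne.coherentK_sector_class_top hK d hd a hcoh hbot c

/-! #### S5 sector: LOWER-SIGNED factors at the bottom coupling / UPPER-SIGNED factors at the top coupling, EVERY format `(m, K)` … [prose → card § «Skeleton header archive E» block E3.2, rev 32] -/

/-- **S5, c-free side, LOWER-SIGNED sector, bottom coupling, EVERY `K ≥ 2`,** … [→ card archive I.47, rev 36] -/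
theorem eulerBoundPoly_lowerSignedK {m K : ℕ} (hK : 2 ≤ K) (d : Fin K → ℕ) (hd : StrictMono d) (a : Fin m → Fin K → ℝ)
    (hls : ∀ j, (∀ l : Fin K, (l : ℕ) < K - 1 → 0 ≤ a j l) ∨ (∀ l : Fin K, (l : ℕ) < K - 1 → a j l ≤ 0)) :
    ((eulerNumerator d a ⟨0, by omega⟩).roots.toFinset.filter (fun t => 0 < t)).card ≤ 2 * m + 1 :=
  ProductPlusOne.eulerBound_lowerSignedK hK d hd a hls

/-- **S5, member currency, LOWER-SIGNED sector, bottom coupling, EVERY** … [→ card archive I.48, rev 36] -/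
theorem polyLaw_lowerSignedK {m K : ℕ} (hK : 2 ≤ K) (d : Fin K → ℕ) (hd : StrictMono d) (a : Fin m → Fin K → ℝ)
    (hls : ∀ j, (∀ l : Fin K, (l : ℕ) < K - 1 → 0 ≤ a j l) ∨ (∀ l : Fin K, (l : ℕ) < K - 1 → a j l ≤ 0)) (c : ℝ) :
    ((prodPlusMonomial d a ⟨0, by omega⟩ c).roots.toFinset.filter (fun t => 0 < t)).card ≤ 2 * m + 2 :=
  ProductPlusOne.lowerSigned_sector_classK hK d hd a hls c

/-- **S5, member currency, LOWER-SIGNED sector, SIGN-AWARE constant:** … [→ card archive I.49, rev 36] -/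
theorem polyLaw_lowerSignedK_signed {m K : ℕ} (hK : 2 ≤ K) (d : Fin K → ℕ) (hd : StrictMono d) (a : Fin m → Fin K → ℝ)
    (hls : ∀ j, (∀ l : Fin K, (l : ℕ) < K - 1 → 0 ≤ a j l) ∨ (∀ l : Fin K, (l : ℕ) < K - 1 → a j l ≤ 0)) (c : ℝ) :
    ((prodPlusMonomial d a ⟨0, by omega⟩ c).roots.toFinset.filter (fun t => 0 < t)).card
      ≤ (Finset.univ.filter (fun j => ∃ l : Fin K, (l : ℕ) < K - 1 ∧ a j l * a j ⟨K - 1, by omega⟩ < 0)).card + 2 :=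
  ProductPlusOne.lowerSigned_sector_classK_signed hK d hd a hls c

/-- **S5, c-free side, UPPER-SIGNED sector, TOP coupling, EVERY `K ≥ 2`,** … [→ card archive I.50, rev 36] -/
theorem eulerBoundPoly_upperSignedK {m K : ℕ} (hK : 2 ≤ K) (d : Fin K → ℕ) (hd : StrictMono d) (a : Fin m → Fin K → ℝ)
    (hus : ∀ j, (∀ l : Fin K, 0 < (l : ℕ) → 0 ≤ a j l) ∨ (∀ l : Fin K, 0 < (l : ℕ) → a j l ≤ 0)) :
    ((eulerNumerator d a ⟨K - 1, by omega⟩).roots.toFinset.filter (fun t => 0 < t)).card ≤ 2 * m + 1 :=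
  ProductPlusOne.eulerBound_upperSignedK hK d hd a hus

/-- **S5, member currency, UPPER-SIGNED sector, TOP coupling, EVERY** … [→ card archive I.51, rev 36] -/
theorem polyLaw_upperSignedK {m K : ℕ} (hK : 2 ≤ K) (d : Fin K → ℕ) (hd : StrictMono d) (a : Fin m → Fin K → ℝ)
    (hus : ∀ j, (∀ l : Fin K, 0 < (l : ℕ) → 0 ≤ a j l) ∨ (∀ l : Fin K, 0 < (l : ℕ) → a j l ≤ 0)) (c : ℝ) :
    ((prodPlusMonomial d a ⟨K - 1, by omega⟩ c).roots.toFinset.filter (fun t => 0 < t)).card ≤ 2 * m + 2 :=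
  ProductPlusOne.upperSigned_sector_classK hK d hd a hus c

/-- **S4″, LOWER-SIGNED rows (`K = 3`, bottom coupling, ANY ratio, any** … [→ card archive I.52, rev 36] -/
theorem eulerBoundK3_lowerSigned {m : ℕ} (d : Fin 3 → ℕ) (h01 : d 0 < d 1) (h12 : d 1 < d 2)
    (a : Fin m → Fin 3 → ℝ) (hls : ∀ j, (0 ≤ a j 0 ∧ 0 ≤ a j 1) ∨ (a j 0 ≤ 0 ∧ a j 1 ≤ 0)) :
    ((eulerNumerator d a 0).roots.toFinset.filter (fun t => 0 < t)).card ≤ 2 * m + 1 :=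
  ProductPlusOne.eulerBoundK3_lowerSigned d h01 h12 a hls

/-- **S4′, LOWER-SIGNED rows (`K = 3`, bottom coupling, ANY ratio):** … [→ card archive I.53, rev 36] -/
theorem classRowK3_lowerSigned {m : ℕ} (d : Fin 3 → ℕ) (h01 : d 0 < d 1) (h12 : d 1 < d 2)
    (a : Fin m → Fin 3 → ℝ) (hls : ∀ j, (0 ≤ a j 0 ∧ 0 ≤ a j 1) ∨ (a j 0 ≤ 0 ∧ a j 1 ≤ 0)) (c : ℝ) :
    ((prodPlusMonomial d a 0 c).roots.toFinset.filter (fun t => 0 < t)).card ≤ 2 * m + 2 :=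
  ProductPlusOne.classRowK3_lowerSigned d h01 h12 a hls c

/-- **S4′, LOWER-SIGNED rows, SIGN-AWARE:** … [→ card archive I.54, rev 36] -/
theorem classRowK3_lowerSigned_signed {m : ℕ} (d : Fin 3 → ℕ) (h01 : d 0 < d 1) (h12 : d 1 < d 2)
    (a : Fin m → Fin 3 → ℝ) (hls : ∀ j, (0 ≤ a j 0 ∧ 0 ≤ a j 1) ∨ (a j 0 ≤ 0 ∧ a j 1 ≤ 0)) (c : ℝ) :
    ((prodPlusMonomial d a 0 c).roots.toFinset.filter (fun t => 0 < t)).card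
      ≤ (Finset.univ.filter (fun j => a j 0 * a j 2 < 0 ∨ a j 1 * a j 2 < 0)).card + 2 :=
  ProductPlusOne.classRowK3_lowerSigned_signed d h01 h12 a hls c

/-- **S4″, UPPER-SIGNED rows (`K = 3`, TOP coupling, ANY ratio):** … [→ card archive I.55, rev 36] -/
theorem eulerBoundK3_upperSigned {m : ℕ} (d : Fin 3 → ℕ) (h01 : d 0 < d 1) (h12 : d 1 < d 2)
    (a : Fin m → Fin 3 → ℝ) (hus : ∀ j, (0 ≤ a j 1 ∧ 0 ≤ a j 2) ∨ (a j 1 ≤ 0 ∧ a j 2 ≤ 0)) :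
    ((eulerNumerator d a 2).roots.toFinset.filter (fun t => 0 < t)).card ≤ 2 * m + 1 :=
  ProductPlusOne.eulerBoundK3_upperSigned d h01 h12 a hus

/-- **S4′, UPPER-SIGNED rows (`K = 3`, TOP coupling, ANY ratio):** … [→ card archive I.56, rev 36] -/
theorem classRowK3_upperSigned {m : ℕ} (d : Fin 3 → ℕ) (h01 : d 0 < d 1) (h12 : d 1 < d 2)
    (a : Fin m → Fin 3 → ℝ) (hus : ∀ j, (0 ≤ a j 1 ∧ 0 ≤ a j 2) ∨ (a j 1 ≤ 0 ∧ a j 2 ≤ 0)) (c : ℝ) :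
    ((prodPlusMonomial d a 2 c).roots.toFinset.filter (fun t => 0 < t)).card ≤ 2 * m + 2 :=
  ProductPlusOne.classRowK3_upperSigned d h01 h12 a hus c

/-- lower-signed rows are FLOOR rows (the factorwise hypothesis of … [→ card archive I.57, rev 36] -/
example {m : ℕ} (a : Fin m → Fin 3 → ℝ) (hls : ∀ j, (0 ≤ a j 0 ∧ 0 ≤ a j 1) ∨ (a j 0 ≤ 0 ∧ a j 1 ≤ 0)) :
    ∀ j, ¬ (a j 0 * a j 1 < 0 ∧ a j 1 * a j 2 < 0) := by
  intro j hj
  rcases hls j with ⟨h0, h1⟩ | ⟨h0, h1⟩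
  · nlinarith [mul_nonneg h0 h1, hj.1]
  · nlinarith [mul_nonneg (neg_nonneg.mpr h0) (neg_nonneg.mpr h1), hj.1]

/-- … and the floor's constant on them is `C = 2` (Euler … [→ card archive I.58, rev 36] -/
example {m : ℕ} (d : Fin 3 → ℕ) (h01 : d 0 < d 1) (h12 : d 1 < d 2)
    (a : Fin m → Fin 3 → ℝ) (hls : ∀ j, (0 ≤ a j 0 ∧ 0 ≤ a j 1) ∨ (a j 0 ≤ 0 ∧ a j 1 ≤ 0)) :
    ((eulerNumerator d a 0).roots.toFinset.filter (fun t => 0 < t)).card ≤ 2 * m + 2 :=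
  (eulerBoundK3_lowerSigned d h01 h12 a hls).trans (by omega)

/-! #### S5 sector: TAME factors, EVERY format `(m, K)`, `K ≥ 2`, support window «whole support within 4× the first gap» … [prose → card § «Skeleton header archive E» block E3.3, rev 32] -/

/-- **S5, c-free side, TAME sector every `K ≥ 2`, bottom coupling, window** … [→ card archive I.59, rev 36] -/
theorem eulerBoundPoly_tameK {m K : ℕ} (hK : 2 ≤ K) (d : Fin K → ℕ) (hd : StrictMono d)
    (hwin : d ⟨K - 1, by omega⟩ - d ⟨0, by omega⟩ ≤ 4 * (d ⟨1, by omega⟩ - d ⟨0, by omega⟩)) (a : Fin m → Fin K → ℝ)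
    (ht : ∀ j, (0 < a j ⟨0, by omega⟩ ∧ ∀ l : Fin K, 2 ≤ (l : ℕ) → a j l ≤ 0) ∨
      (a j ⟨0, by omega⟩ < 0 ∧ ∀ l : Fin K, 2 ≤ (l : ℕ) → 0 ≤ a j l)) :
    ((eulerNumerator d a ⟨0, by omega⟩).roots.toFinset.filter (fun t => 0 < t)).card ≤ 2 * m + 1 :=
  ProductPlusOne.eulerBound_tameK hK d hd hwin a ht

/-- **S5, member currency, TAME sector every `K ≥ 2`, bottom coupling:** … [→ card archive I.60, rev 36] -/
theorem polyLaw_tameK {m K : ℕ} (hK : 2 ≤ K) (d : Fin K → ℕ) (hd : StrictMono d)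
    (hwin : d ⟨K - 1, by omega⟩ - d ⟨0, by omega⟩ ≤ 4 * (d ⟨1, by omega⟩ - d ⟨0, by omega⟩)) (a : Fin m → Fin K → ℝ)
    (ht : ∀ j, (0 < a j ⟨0, by omega⟩ ∧ ∀ l : Fin K, 2 ≤ (l : ℕ) → a j l ≤ 0) ∨
      (a j ⟨0, by omega⟩ < 0 ∧ ∀ l : Fin K, 2 ≤ (l : ℕ) → 0 ≤ a j l)) (c : ℝ) :
    ((prodPlusMonomial d a ⟨0, by omega⟩ c).roots.toFinset.filter (fun t => 0 < t)).card ≤ 2 * m + 2 :=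
  ProductPlusOne.tameK_sector_classK hK d hd hwin a ht c

/-- **S5, c-free side, TAME sector every `K ≥ 2`, TOP coupling, window** … [→ card archive I.61, rev 36] -/
theorem eulerBoundPoly_tameK_top {m K : ℕ} (hK : 2 ≤ K) (d : Fin K → ℕ) (hd : StrictMono d)
    (hwin : d ⟨K - 1, by omega⟩ - d ⟨0, by omega⟩ ≤ 4 * (d ⟨K - 1, by omega⟩ - d ⟨K - 2, by omega⟩)) (a : Fin m → Fin K → ℝ)
    (ht : ∀ j, (0 < a j ⟨K - 1, by omega⟩ ∧ ∀ l : Fin K, (l : ℕ) + 3 ≤ K → a j l ≤ 0) ∨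
      (a j ⟨K - 1, by omega⟩ < 0 ∧ ∀ l : Fin K, (l : ℕ) + 3 ≤ K → 0 ≤ a j l)) :
    ((eulerNumerator d a ⟨K - 1, by omega⟩).roots.toFinset.filter (fun t => 0 < t)).card ≤ 2 * m + 1 :=
  ProductPlusOne.eulerBound_tameK_top hK d hd hwin a ht

/-- **S5, member currency, TAME sector every `K ≥ 2`, TOP coupling:** … [→ card archive I.62, rev 36] -/
theorem polyLaw_tameK_top {m K : ℕ} (hK : 2 ≤ K) (d : Fin K → ℕ) (hd : StrictMono d)
    (hwin : d ⟨K - 1, by omega⟩ - d ⟨0, by omega⟩ ≤ 4 * (d ⟨K - 1, by omega⟩ - d ⟨K - 2, by omega⟩)) (a : Fin m → Fin K → ℝ)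
    (ht : ∀ j, (0 < a j ⟨K - 1, by omega⟩ ∧ ∀ l : Fin K, (l : ℕ) + 3 ≤ K → a j l ≤ 0) ∨
      (a j ⟨K - 1, by omega⟩ < 0 ∧ ∀ l : Fin K, (l : ℕ) + 3 ≤ K → 0 ≤ a j l)) (c : ℝ) :
    ((prodPlusMonomial d a ⟨K - 1, by omega⟩ c).roots.toFinset.filter (fun t => 0 < t)).card ≤ 2 * m + 2 :=
  ProductPlusOne.tameK_sector_classK_top hK d hd hwin a ht c

/-- **S4″, TAME WEAK rows, bottom coupling (`K = 3`, ratio ≤ 4, bottom** … [→ card archive I.63, rev 36] -/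
theorem eulerBoundK3_tameWeak {m : ℕ} (d : Fin 3 → ℕ) (h01 : d 0 < d 1) (h12 : d 1 < d 2) (hwin : d 2 - d 0 ≤ 4 * (d 1 - d 0))
    (a : Fin m → Fin 3 → ℝ) (ht : ∀ j, (0 < a j 0 ∧ a j 2 ≤ 0) ∨ (a j 0 < 0 ∧ 0 ≤ a j 2)) :
    ((eulerNumerator d a 0).roots.toFinset.filter (fun t => 0 < t)).card ≤ 2 * m + 1 :=
  ProductPlusOne.eulerBoundK3_tameWeak d h01 h12 hwin a ht

/-- **S4′, TAME WEAK rows, bottom coupling: `Z₊ ≤ 2m + 2`** (p672890). … [→ card archive I.64, rev 36] -/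
theorem classRowK3_tameWeak {m : ℕ} (d : Fin 3 → ℕ) (h01 : d 0 < d 1) (h12 : d 1 < d 2) (hwin : d 2 - d 0 ≤ 4 * (d 1 - d 0))
    (a : Fin m → Fin 3 → ℝ) (ht : ∀ j, (0 < a j 0 ∧ a j 2 ≤ 0) ∨ (a j 0 < 0 ∧ 0 ≤ a j 2)) (c : ℝ) :
    ((prodPlusMonomial d a 0 c).roots.toFinset.filter (fun t => 0 < t)).card ≤ 2 * m + 2 :=
  ProductPlusOne.classRowK3_tameWeak d h01 h12 hwin a ht c

/-- **S4″, TAME WEAK rows, TOP coupling (`K = 3`, ratio ≤ 4 from the top,** … [→ card archive I.65, rev 36] -/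
theorem eulerBoundK3_tameWeakTop {m : ℕ} (d : Fin 3 → ℕ) (h01 : d 0 < d 1) (h12 : d 1 < d 2) (hwin : d 2 - d 0 ≤ 4 * (d 2 - d 1))
    (a : Fin m → Fin 3 → ℝ) (ht : ∀ j, (0 < a j 2 ∧ a j 0 ≤ 0) ∨ (a j 2 < 0 ∧ 0 ≤ a j 0)) :
    ((eulerNumerator d a 2).roots.toFinset.filter (fun t => 0 < t)).card ≤ 2 * m + 1 :=
  ProductPlusOne.eulerBoundK3_tameWeakTop d h01 h12 hwin a ht

/-- **S4′, TAME WEAK rows, TOP coupling: `Z₊ ≤ 2m + 2`** (p673163). … [→ card archive I.66, rev 36] -/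
theorem classRowK3_tameWeakTop {m : ℕ} (d : Fin 3 → ℕ) (h01 : d 0 < d 1) (h12 : d 1 < d 2) (hwin : d 2 - d 0 ≤ 4 * (d 2 - d 1))
    (a : Fin m → Fin 3 → ℝ) (ht : ∀ j, (0 < a j 2 ∧ a j 0 ≤ 0) ∨ (a j 2 < 0 ∧ 0 ≤ a j 0)) (c : ℝ) :
    ((prodPlusMonomial d a 2 c).roots.toFinset.filter (fun t => 0 < t)).card ≤ 2 * m + 2 :=
  ProductPlusOne.classRowK3_tameWeakTop d h01 h12 hwin a ht c

/-! #### SIGN-AWARE member constants, every wired sector, BOTH couplings … [prose → card § «Skeleton header archive E» block E3.4, rev 32] -/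

/-- **S5, member currency, UPPER-SIGNED sector every `K ≥ 2`, TOP coupling,** … [→ card archive I.67, rev 36] -/
theorem polyLaw_upperSignedK_signed {m K : ℕ} (hK : 2 ≤ K) (d : Fin K → ℕ) (hd : StrictMono d) (a : Fin m → Fin K → ℝ)
    (hus : ∀ j, (∀ l : Fin K, 0 < (l : ℕ) → 0 ≤ a j l) ∨ (∀ l : Fin K, 0 < (l : ℕ) → a j l ≤ 0)) (c : ℝ) :
    ((prodPlusMonomial d a ⟨K - 1, by omega⟩ c).roots.toFinset.filter (fun t => 0 < t)).card
      ≤ (Finset.univ.filter (fun j => ∃ l : Fin K, 0 < (l : ℕ) ∧ a j l * a j ⟨0, by omega⟩ < 0)).card + 2 :=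
  ProductPlusOne.upperSigned_sector_classK_signed hK d hd a hus c

/-- **S5, member currency, COHERENT-AT-THE-TOP factors every `K ≥ 3`, TOP** … [→ card archive I.68, rev 36] -/
theorem polyLaw_coherentK_top_signed {m K : ℕ} (hK : 3 ≤ K) (d : Fin K → ℕ) (hd : StrictMono d) (a : Fin m → Fin K → ℝ)
    (hcoh : ∀ j (l : Fin K), 0 < (l : ℕ) → 0 < a j ⟨K - 1, by omega⟩ * a j l) (c : ℝ) :
    ((prodPlusMonomial d a ⟨K - 1, by omega⟩ c).roots.toFinset.filter (fun t => 0 < t)).card ≤ m + 2 :=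
  ProductPlusOne.coherent_sector_classK_top_signed hK d hd a hcoh c

/-- **S5, member currency, TAME sector every `K ≥ 2`, bottom coupling,** … [→ card archive I.69, rev 36] -/
theorem polyLaw_tameK_signed {m K : ℕ} (hK : 2 ≤ K) (d : Fin K → ℕ) (hd : StrictMono d)
    (hwin : d ⟨K - 1, by omega⟩ - d ⟨0, by omega⟩ ≤ 4 * (d ⟨1, by omega⟩ - d ⟨0, by omega⟩)) (a : Fin m → Fin K → ℝ)
    (ht : ∀ j, (0 < a j ⟨0, by omega⟩ ∧ ∀ l : Fin K, 2 ≤ (l : ℕ) → a j l ≤ 0) ∨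
      (a j ⟨0, by omega⟩ < 0 ∧ ∀ l : Fin K, 2 ≤ (l : ℕ) → 0 ≤ a j l)) (c : ℝ) :
    ((prodPlusMonomial d a ⟨0, by omega⟩ c).roots.toFinset.filter (fun t => 0 < t)).card
      ≤ (Finset.univ.filter (fun j => ∃ l : Fin K, 1 ≤ (l : ℕ) ∧ a j ⟨0, by omega⟩ * a j l < 0)).card + 2 :=
  ProductPlusOne.tameK_sector_classK_signed hK d hd hwin a ht c

/-- **S4′ row, UPPER-SIGNED factors, TOP coupling, sign-aware (`K = 3`, any** … [→ card archive I.70, rev 36] -/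
theorem classRowK3_upperSigned_signed {m : ℕ} (d : Fin 3 → ℕ) (h01 : d 0 < d 1) (h12 : d 1 < d 2)
    (a : Fin m → Fin 3 → ℝ) (hus : ∀ j, (0 ≤ a j 1 ∧ 0 ≤ a j 2) ∨ (a j 1 ≤ 0 ∧ a j 2 ≤ 0)) (c : ℝ) :
    ((prodPlusMonomial d a 2 c).roots.toFinset.filter (fun t => 0 < t)).card
      ≤ (Finset.univ.filter (fun j => a j 1 * a j 0 < 0 ∨ a j 2 * a j 0 < 0)).card + 2 :=
  ProductPlusOne.classRowK3_upperSigned_signed d h01 h12 a hus c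

/-- **S4′ row, COHERENT-type factors (`a_{j0}a_{j2} < 0`,** … [→ card archive I.71, rev 36] -/
theorem classRowK3_coherentTop_signed {m : ℕ} (d : Fin 3 → ℕ) (h01 : d 0 < d 1) (h12 : d 1 < d 2)
    (a : Fin m → Fin 3 → ℝ) (hac : ∀ j, a j 0 * a j 2 < 0) (hcb : ∀ j, 0 ≤ a j 2 * a j 1) (c : ℝ) :
    ((prodPlusMonomial d a 2 c).roots.toFinset.filter (fun t => 0 < t)).card ≤ m + 2 :=
  ProductPlusOne.classRowK3_coherentTop_signed d h01 h12 a hac hcb c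

/-- **S4′ row, COHERENT-type factors (`a_{j0}a_{j2} < 0`,** … [→ card archive I.72, rev 36] -/
theorem classRowK3_coherentBottom_signed {m : ℕ} (d : Fin 3 → ℕ) (h01 : d 0 < d 1) (h12 : d 1 < d 2)
    (a : Fin m → Fin 3 → ℝ) (hac : ∀ j, a j 0 * a j 2 < 0) (hab : ∀ j, 0 ≤ a j 0 * a j 1) (c : ℝ) :
    ((prodPlusMonomial d a 0 c).roots.toFinset.filter (fun t => 0 < t)).card ≤ m + 2 :=
  ProductPlusOne.classRowK3_coherentBottom_signed d h01 h12 a hac hab c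

/-- **S4′ row, TAME WEAK factors, bottom coupling, ratio ≤ 4, sign-aware:** … [→ card archive I.73, rev 36] -/
theorem classRowK3_tameWeak_signed {m : ℕ} (d : Fin 3 → ℕ) (h01 : d 0 < d 1) (h12 : d 1 < d 2) (hwin : d 2 - d 0 ≤ 4 * (d 1 - d 0))
    (a : Fin m → Fin 3 → ℝ) (ht : ∀ j, (0 < a j 0 ∧ a j 2 ≤ 0) ∨ (a j 0 < 0 ∧ 0 ≤ a j 2)) (c : ℝ) :
    ((prodPlusMonomial d a 0 c).roots.toFinset.filter (fun t => 0 < t)).card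
      ≤ (Finset.univ.filter (fun j => a j 0 * a j 1 < 0 ∨ a j 0 * a j 2 < 0)).card + 2 :=
  ProductPlusOne.classRowK3_tameWeak_signed d h01 h12 hwin a ht c

/-! #### FIRST INTERACTION COUNT on the floor's open core … [prose → card § «Skeleton header archive E» block E3.5, rev 32] -/

/-- **FIRST INTERACTION COUNT, landed spelling** (binders verbatim from ✓ … [→ card archive I.74, rev 36] -/
theorem oneRiser_no_four_zeros {m : ℕ} (d : Fin 3 → ℕ) (h01 : d 0 < d 1) (h12 : d 1 < d 2)
    (a : Fin m → Fin 3 → ℝ) (j₀ : Fin m) (hr1 : a j₀ 1 < 0) (hr2 : a j₀ 2 < 0)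
    (hpul : ∀ j, j ≠ j₀ → 0 < a j 0 ∧ a j 1 < 0 ∧ a j 2 = 0)
    {x₁ x₂ x₃ x₄ : ℝ} (h0 : 0 < x₁) (h12' : x₁ < x₂) (h23 : x₂ < x₃) (h34 : x₃ < x₄)
    (hsw : ∀ x ∈ Set.Icc x₁ x₄, (∑ l, C (a j₀ l) * X ^ (d l) : ℝ[X]).eval x < 0)
    (hun : ∀ j, j ≠ j₀ → 0 < (∑ l, C (a j l) * X ^ (d l) : ℝ[X]).eval x₄)
    (hzero : ∀ x ∈ ({x₁, x₂, x₃, x₄} : Set ℝ),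
      (∑ j, (∑ l, C (a j l * ((d l : ℝ) - d 0)) * X ^ (d l)) * ∏ i ∈ Finset.univ.erase j, (∑ l, C (a i l) * X ^ (d l))
        : ℝ[X]).eval x = 0) : False :=
  ProductPlusOne.oneRiser_eulerNumerator_no_four_zeros d h01 h12 a j₀ hr1 hr2 hpul h0 h12' h23 h34 hsw hun hzero

/-- **FIRST INTERACTION COUNT, LINE spelling** — the same statement with … [→ card archive I.75, rev 36] -/
theorem oneRiser_eulerNumerator_no_four_zeros {m : ℕ} (d : Fin 3 → ℕ) (h01 : d 0 < d 1) (h12 : d 1 < d 2)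
    (a : Fin m → Fin 3 → ℝ) (j₀ : Fin m) (hr1 : a j₀ 1 < 0) (hr2 : a j₀ 2 < 0)
    (hpul : ∀ j, j ≠ j₀ → 0 < a j 0 ∧ a j 1 < 0 ∧ a j 2 = 0)
    {x₁ x₂ x₃ x₄ : ℝ} (h0 : 0 < x₁) (h12' : x₁ < x₂) (h23 : x₂ < x₃) (h34 : x₃ < x₄)
    (hsw : ∀ x ∈ Set.Icc x₁ x₄, (fewnomial d (a j₀)).eval x < 0)
    (hun : ∀ j, j ≠ j₀ → 0 < (fewnomial d (a j)).eval x₄)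
    (hzero : ∀ x ∈ ({x₁, x₂, x₃, x₄} : Set ℝ), (eulerNumerator d a 0).eval x = 0) : False :=
  ProductPlusOne.oneRiser_eulerNumerator_no_four_zeros d h01 h12 a j₀ hr1 hr2 hpul h0 h12' h23 h34 hsw hun hzero

/-! #### AB-REDUCTION of the floor's UPPER-SIGNED sub-cell, kernel … [prose → card § «Skeleton header archive E» block E3.6, rev 32] -/

/-- **(AB1) letter-partial sums antitone** (✓ p678363 `ProductPlusOne.antitoneOn_letterSum`, binders verbatim): … [docstring → card § «Skeleton header archive F» block F.1, rev 33] -/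
theorem letterSum_antitoneOn {m : ℕ} (p q : ℕ) (a : Fin m → Fin 3 → ℝ) (hus : ∀ j, 0 ≤ a j 1 * a j 2) {u v : ℝ} (hu : 0 < u)
    (hg : ∀ x ∈ Set.Icc u v, ∀ j, a j 0 + a j 1 * x ^ p + a j 2 * x ^ q ≠ 0) :
    AntitoneOn (fun y => ∑ j, a j 1 / (a j 0 + a j 1 * y ^ p + a j 2 * y ^ q)) (Set.Icc u v) ∧
    AntitoneOn (fun y => ∑ j, a j 2 / (a j 0 + a j 1 * y ^ p + a j 2 * y ^ q)) (Set.Icc u v) :=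
  ProductPlusOne.antitoneOn_letterSum p q a hus hu hg

/-- **(AB2) zeros are confined to the window `{A₁·A₂ < 0}`** (✓ p678363 … [docstring → card § «Skeleton header archive F» block F.2, rev 33] -/
theorem letterSums_opposite_of_euler_zero {m : ℕ} (d0 p q : ℕ) (a : Fin m → Fin 3 → ℝ) {x : ℝ} (hx : 0 < x)
    (hg : ∀ j, a j 0 + a j 1 * x ^ p + a j 2 * x ^ q ≠ 0)
    (hR : (eulerNumerator (![d0, d0 + p, d0 + q]) a 0).eval x = 0) (hp : 0 < p) (hq : 0 < q) :
    (∑ j, a j 1 / (a j 0 + a j 1 * x ^ p + a j 2 * x ^ q)) * (∑ j, a j 2 / (a j 0 + a j 1 * x ^ p + a j 2 * x ^ q)) < 0 ∨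
    ((∑ j, a j 1 / (a j 0 + a j 1 * x ^ p + a j 2 * x ^ q)) = 0 ∧ (∑ j, a j 2 / (a j 0 + a j 1 * x ^ p + a j 2 * x ^ q)) = 0) :=
  ProductPlusOne.letterSums_opposite_of_euler_zero d0 p q a hx hg hR hp hq

/-- ★ **(AB3, letter-1 sum positive) LOCAL COUNT ≤ 1** (✓ p678363 … [docstring → card § «Skeleton header archive F» block F.3, rev 33] -/
theorem euler_roots_Icc_le_one_of_letterSum_one_pos {m : ℕ} (d0 p q : ℕ) (hp : 0 < p) (hpq : p < q)
    (a : Fin m → Fin 3 → ℝ) (hus : ∀ j, 0 ≤ a j 1 * a j 2) {u v : ℝ} (hu : 0 < u)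
    (hg : ∀ x ∈ Set.Icc u v, ∀ j, a j 0 + a j 1 * x ^ p + a j 2 * x ^ q ≠ 0)
    (hA : ∀ x ∈ Set.Icc u v, 0 < ∑ j, a j 1 / (a j 0 + a j 1 * x ^ p + a j 2 * x ^ q)) :
    ((eulerNumerator (![d0, d0 + p, d0 + q]) a 0).roots.toFinset.filter (fun t => u ≤ t ∧ t ≤ v)).card ≤ 1 :=
  ProductPlusOne.eulerNumerator_roots_Icc_le_one_of_letterSum_one_pos d0 p q hp hpq a hus hu hg hA

/-- ★ **(AB3, letter-2 sum negative — the «type β» windows) LOCAL COUNT ≤ 1** (✓ p678363 … [docstring → card § «Skeleton header archive F» block F.4, rev 33] -/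
theorem euler_roots_Icc_le_one_of_letterSum_two_neg {m : ℕ} (d0 p q : ℕ) (hp : 0 < p) (hpq : p < q)
    (a : Fin m → Fin 3 → ℝ) (hus : ∀ j, 0 ≤ a j 1 * a j 2) {u v : ℝ} (hu : 0 < u)
    (hg : ∀ x ∈ Set.Icc u v, ∀ j, a j 0 + a j 1 * x ^ p + a j 2 * x ^ q ≠ 0)
    (hA : ∀ x ∈ Set.Icc u v, ∑ j, a j 2 / (a j 0 + a j 1 * x ^ p + a j 2 * x ^ q) < 0) :
    ((eulerNumerator (![d0, d0 + p, d0 + q]) a 0).roots.toFinset.filter (fun t => u ≤ t ∧ t ≤ v)).card ≤ 1 :=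
  ProductPlusOne.eulerNumerator_roots_Icc_le_one_of_letterSum_two_neg d0 p q hp hpq a hus hu hg hA

/-! #### Rev 20 wiring — MIDDLE-coupling twin of AB3, the CHART-FREE LOCAL CROSSING BUDGET, and AB0 for every K … [prose → card § «Skeleton header archive E» block E3.7, rev 32] -/

/-- ★ **(M3, middle coupling, top-letter sum negative) LOCAL COUNT ≤ 1** (✓ p678975 … [docstring → card § «Skeleton header archive F» block F.5, rev 33] -/
theorem eulerMiddle_roots_Icc_le_one_of_letterSumTwo_neg {m : ℕ} (d0 p s : ℕ) (hp : 0 < p) (hs : 0 < s)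
    (a : Fin m → Fin 3 → ℝ) (hnd : ∀ j, a j 0 * a j 2 ≤ 0) {u v : ℝ} (hu : 0 < u)
    (hg : ∀ x ∈ Set.Icc u v, ∀ j, a j 0 + a j 1 * x ^ p + a j 2 * x ^ (p + s) ≠ 0)
    (hA : ∀ x ∈ Set.Icc u v, ∑ j, a j 2 * x ^ p / (a j 0 + a j 1 * x ^ p + a j 2 * x ^ (p + s)) < 0) :
    ((eulerNumerator (![d0, d0 + p, d0 + p + s]) a 1).roots.toFinset.filter (fun t => u ≤ t ∧ t ≤ v)).card ≤ 1 :=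
  ProductPlusOne.eulerNumeratorMiddle_roots_Icc_le_one_of_letterSumTwo_neg d0 p s hp hs a hnd hu hg hA

/-- ★ **(M3, middle coupling, bottom-letter sum negative) LOCAL COUNT ≤ 1** (✓ p678975 … [docstring → card § «Skeleton header archive F» block F.6, rev 33] -/
theorem eulerMiddle_roots_Icc_le_one_of_letterSumZero_neg {m : ℕ} (d0 p s : ℕ) (hp : 0 < p) (hs : 0 < s)
    (a : Fin m → Fin 3 → ℝ) (hnd : ∀ j, a j 0 * a j 2 ≤ 0) {u v : ℝ} (hu : 0 < u)
    (hg : ∀ x ∈ Set.Icc u v, ∀ j, a j 0 + a j 1 * x ^ p + a j 2 * x ^ (p + s) ≠ 0)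
    (hA : ∀ x ∈ Set.Icc u v, ∑ j, a j 0 * x ^ p / (a j 0 + a j 1 * x ^ p + a j 2 * x ^ (p + s)) < 0) :
    ((eulerNumerator (![d0, d0 + p, d0 + p + s]) a 1).roots.toFinset.filter (fun t => u ≤ t ∧ t ≤ v)).card ≤ 1 :=
  ProductPlusOne.eulerNumeratorMiddle_roots_Icc_le_one_of_letterSumZero_neg d0 p s hp hs a hnd hu hg hA

/-- ★★ **THE LOCAL CROSSING BUDGET in LINE currency** (✓ p678985 `ProductPlusOne.eulerNumerator_roots_Icc_le_budget`; … [docstring → card § «Skeleton header archive F» block F.7, rev 33] -/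
theorem euler_roots_Icc_le_crossingBudget {m K : ℕ} (d : Fin K → ℕ) (a : Fin m → Fin K → ℝ) (l₀ : Fin K) {u v : ℝ}
    (hP : ∀ t ∈ Set.Icc u v, (∏ j, fewnomial d (a j)).eval t ≠ 0) :
    ((eulerNumerator d a l₀).roots.toFinset.filter (fun t => u ≤ t ∧ t ≤ v)).card
      ≤ 2 * (((eulerNumerator d a l₀).roots.toFinset.filter
          (fun t => (u ≤ t ∧ t ≤ v) ∧ 0 ≤ (derivative (eulerNumerator d a l₀)).eval t * (∏ j, fewnomial d (a j)).eval t)).card) + 1 :=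
  ProductPlusOne.eulerNumerator_roots_Icc_le_budget d a l₀ hP

/-- **AB0 for EVERY K and every coupling** (✓ p679500 `ProductPlusOne.eulerNumerator_eq_letterSums`, val-lit-p7 g15; LINE … [docstring → card § «Skeleton header archive F» block F.8, rev 33] -/
theorem eulerNumerator_letterSums {m K : ℕ} (d : Fin K → ℕ) (a : Fin m → Fin K → ℝ) (l₀ : Fin K) :
    eulerNumerator d a l₀
      = ∑ l, C ((d l : ℝ) - d l₀) * X ^ (d l) * ∑ j, C (a j l) * ∏ i ∈ Finset.univ.erase j, fewnomial d (a i) :=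
  ProductPlusOne.eulerNumerator_eq_letterSums d a l₀

/-- **Every K, bottom coupling: no zero where all stripped letter sums are one-signed** (✓ p679500 … [docstring → card § «Skeleton header archive F» block F.9, rev 33] -/
theorem eulerNumerator_eval_ne_zero_of_letterSumsK {m K : ℕ} (d : Fin K → ℕ) (i₀ : Fin K) (hd : ∀ l, l ≠ i₀ → d i₀ < d l)
    (hK : ∃ l : Fin K, l ≠ i₀) (a : Fin m → Fin K → ℝ) {x : ℝ} (hx : 0 < x)
    (hf : ∀ j, (fewnomial d (a j)).eval x ≠ 0)
    (hsign : (∀ l, l ≠ i₀ → 0 < ∑ j, a j l / ∑ l', a j l' * x ^ (d l' - d i₀)) ∨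
             (∀ l, l ≠ i₀ → ∑ j, a j l / ∑ l', a j l' * x ^ (d l' - d i₀) < 0)) :
    (eulerNumerator d a i₀).eval x ≠ 0 :=
  ProductPlusOne.eulerNumerator_eval_ne_zero_of_letterSumsK d i₀ hd hK a hx hf hsign

/-! #### Rev 21 wiring — TOP-coupling twin of AB3, EVERY-K type-β windows, the LOG-WRONSKIAN identities … [prose → card § «Skeleton header archive E» block E3.8, rev 32] -/

/-- ★ **(T3, top coupling, letter-1 sum positive) LOCAL COUNT ≤ 1** (✓ p680537 … [docstring → card § «Skeleton header archive F» block F.10, rev 33] -/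
theorem eulerTop_roots_Icc_le_one_of_letterSumOne_pos {m : ℕ} (d0 p q : ℕ) (hp : 0 < p) (hpq : p < q)
    (a : Fin m → Fin 3 → ℝ) (hls : ∀ j, 0 ≤ a j 0 * a j 1) {u v : ℝ} (hu : 0 < u)
    (hg : ∀ x ∈ Set.Icc u v, ∀ j, a j 0 + a j 1 * x ^ p + a j 2 * x ^ q ≠ 0)
    (hB : ∀ x ∈ Set.Icc u v, 0 < ∑ j, a j 1 * x ^ q / (a j 0 + a j 1 * x ^ p + a j 2 * x ^ q)) :
    ((eulerNumerator (![d0, d0 + p, d0 + q]) a 2).roots.toFinset.filter (fun t => u ≤ t ∧ t ≤ v)).card ≤ 1 :=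
  ProductPlusOne.eulerNumeratorTop_roots_Icc_le_one_of_letterSumOne_pos d0 p q hp hpq a hls hu hg hB

/-- ★ **(T3, top coupling, letter-0 sum negative) LOCAL COUNT ≤ 1** (✓ p680537 … [docstring → card § «Skeleton header archive F» block F.11, rev 33] -/
theorem eulerTop_roots_Icc_le_one_of_letterSumZero_neg {m : ℕ} (d0 p q : ℕ) (hp : 0 < p) (hpq : p < q)
    (a : Fin m → Fin 3 → ℝ) (hls : ∀ j, 0 ≤ a j 0 * a j 1) {u v : ℝ} (hu : 0 < u)
    (hg : ∀ x ∈ Set.Icc u v, ∀ j, a j 0 + a j 1 * x ^ p + a j 2 * x ^ q ≠ 0)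
    (hB : ∀ x ∈ Set.Icc u v, ∑ j, a j 0 * x ^ q / (a j 0 + a j 1 * x ^ p + a j 2 * x ^ q) < 0) :
    ((eulerNumerator (![d0, d0 + p, d0 + q]) a 2).roots.toFinset.filter (fun t => u ≤ t ∧ t ≤ v)).card ≤ 1 :=
  ProductPlusOne.eulerNumeratorTop_roots_Icc_le_one_of_letterSumZero_neg d0 p q hp hpq a hls hu hg hB

/-- ★ **(K3, EVERY `K ≥ 3`, bottom coupling, middle letter sums positive) LOCAL COUNT ≤ 1** (✓ p680771 … [docstring → card § «Skeleton header archive F» block F.12, rev 33] -/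
theorem eulerK_roots_Icc_le_one_of_letterSums_pos {m K : ℕ} (hK : 3 ≤ K) (d : Fin K → ℕ) (hd : StrictMono d)
    (a : Fin m → Fin K → ℝ) (hus : ∀ j (l l' : Fin K), 0 < (l : ℕ) → 0 < (l' : ℕ) → 0 ≤ a j l * a j l')
    {u v : ℝ} (hu : 0 < u) (hG : ∀ x ∈ Set.Icc u v, ∀ j, (∑ l', a j l' * x ^ (d l' - d ⟨0, by omega⟩)) ≠ 0)
    (hA : ∀ x ∈ Set.Icc u v, ∀ l : Fin K, 0 < (l : ℕ) → (l : ℕ) < K - 1 →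
      0 < ∑ j, a j l / ∑ l', a j l' * x ^ (d l' - d ⟨0, by omega⟩)) :
    ((eulerNumerator d a ⟨0, by omega⟩).roots.toFinset.filter (fun t => u ≤ t ∧ t ≤ v)).card ≤ 1 :=
  ProductPlusOne.eulerNumeratorK_roots_Icc_le_one_of_letterSums_pos hK d hd a hus hu hG hA

/-- ★ **(K3, EVERY `K ≥ 3`, bottom coupling, letter sums above letter 1 negative) LOCAL COUNT ≤ 1** (✓ p680771 … [docstring → card § «Skeleton header archive F» block F.13, rev 33] -/
theorem eulerK_roots_Icc_le_one_of_letterSums_neg {m K : ℕ} (hK : 3 ≤ K) (d : Fin K → ℕ) (hd : StrictMono d)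
    (a : Fin m → Fin K → ℝ) (hus : ∀ j (l l' : Fin K), 0 < (l : ℕ) → 0 < (l' : ℕ) → 0 ≤ a j l * a j l')
    {u v : ℝ} (hu : 0 < u) (hG : ∀ x ∈ Set.Icc u v, ∀ j, (∑ l', a j l' * x ^ (d l' - d ⟨0, by omega⟩)) ≠ 0)
    (hA : ∀ x ∈ Set.Icc u v, ∀ l : Fin K, 2 ≤ (l : ℕ) → ∑ j, a j l / ∑ l', a j l' * x ^ (d l' - d ⟨0, by omega⟩) < 0) :
    ((eulerNumerator d a ⟨0, by omega⟩).roots.toFinset.filter (fun t => u ≤ t ∧ t ≤ v)).card ≤ 1 :=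
  ProductPlusOne.eulerNumeratorK_roots_Icc_le_one_of_letterSums_neg hK d hd a hus hu hG hA

/-- **AB5-0 in the kernel — THE COMPANY LOG-WRONSKIAN IS THE SUM OF THE ROW LOG-WRONSKIANS WEIGHTED BY SQUARES** (✓ … [docstring → card § «Skeleton header archive F» block F.14, rev 33] -/
theorem company_logWronskian_prod {m K : ℕ} (d : Fin K → ℕ) (a : Fin m → Fin K → ℝ) :
    (∏ j, fewnomial d (a j)) * (X * derivative (X * derivative (∏ j, fewnomial d (a j)))) - (X * derivative (∏ j, fewnomial d (a j))) ^ 2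
      = ∑ j, (fewnomial d (a j) * (X * derivative (X * derivative (fewnomial d (a j)))) - (X * derivative (fewnomial d (a j))) ^ 2)
          * ∏ i ∈ Finset.univ.erase j, (fewnomial d (a i)) ^ 2 :=
  ProductPlusOne.theta_wronskian_prod (fun j => fewnomial d (a j))

/-- **AB5-0, row form — THE ROW LOG-WRONSKIAN IS A FEWNOMIAL ON THE SUMSET WITH COEFFICIENT SIGNS `a_l a_{l′}`** (✓ … [docstring → card § «Skeleton header archive F» block F.15, rev 33] -/
theorem row_logWronskian {K : ℕ} (d : Fin K → ℕ) (b : Fin K → ℝ) :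
    fewnomial d b * (X * derivative (X * derivative (fewnomial d b))) - (X * derivative (fewnomial d b)) ^ 2
      = ∑ l, ∑ l', C (((d l : ℝ) - d l') ^ 2 / 2 * (b l * b l')) * X ^ (d l + d l') :=
  ProductPlusOne.logWronskian_fewnomial d b

/-- ★ **ONE RISER AGAINST A GENERAL PULL — four zeros force three zeros of the discriminant** (✓ p679765 … [docstring → card § «Skeleton header archive F» block F.16, rev 33] -/
theorem oneRiser_no_four_zeros_of_pull (e₁ e₂ : ℕ) {a b c : ℝ} (hb : 0 < b) (hc : 0 < c) (Pl Pl' : ℝ → ℝ)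
    {x₁ x₂ x₃ x₄ : ℝ} (h0 : 0 < x₁) (h12 : x₁ < x₂) (h23 : x₂ < x₃) (h34 : x₃ < x₄)
    (hsw : ∀ x ∈ Set.Icc x₁ x₄, a < b * x ^ (e₁ + 1) + c * x ^ (e₁ + e₂ + 2))
    (hPlpos : ∀ x ∈ Set.Icc x₁ x₄, 0 < Pl x) (hPlder : ∀ x ∈ Set.Icc x₁ x₄, HasDerivAt Pl (Pl' x) x)
    (hD : ∀ y₁ y₂ y₃ : ℝ, x₁ < y₁ → y₁ < y₂ → y₂ < y₃ → y₃ < x₄ →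
      Pl y₁ + y₁ * Pl' y₁ / Pl y₁ - ((e₁ : ℝ) + 1) - ((e₂ : ℝ) + 1) * ((((e₁ : ℝ) + e₂ + 2) * c * y₁ ^ (e₁ + e₂ + 2))
          / (((e₁ : ℝ) + 1) * b * y₁ ^ (e₁ + 1) + ((e₁ : ℝ) + e₂ + 2) * c * y₁ ^ (e₁ + e₂ + 2))) = 0 →
      Pl y₂ + y₂ * Pl' y₂ / Pl y₂ - ((e₁ : ℝ) + 1) - ((e₂ : ℝ) + 1) * ((((e₁ : ℝ) + e₂ + 2) * c * y₂ ^ (e₁ + e₂ + 2))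
          / (((e₁ : ℝ) + 1) * b * y₂ ^ (e₁ + 1) + ((e₁ : ℝ) + e₂ + 2) * c * y₂ ^ (e₁ + e₂ + 2))) = 0 →
      Pl y₃ + y₃ * Pl' y₃ / Pl y₃ - ((e₁ : ℝ) + 1) - ((e₂ : ℝ) + 1) * ((((e₁ : ℝ) + e₂ + 2) * c * y₃ ^ (e₁ + e₂ + 2))
          / (((e₁ : ℝ) + 1) * b * y₃ ^ (e₁ + 1) + ((e₁ : ℝ) + e₂ + 2) * c * y₃ ^ (e₁ + e₂ + 2))) = 0 → False)
    (hzero : ∀ x ∈ ({x₁, x₂, x₃, x₄} : Set ℝ),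
      (((e₁ : ℝ) + 1) * b * x ^ (e₁ + 1) + ((e₁ : ℝ) + e₂ + 2) * c * x ^ (e₁ + e₂ + 2))
          / (b * x ^ (e₁ + 1) + c * x ^ (e₁ + e₂ + 2) - a) - Pl x = 0) : False :=
  ProductPlusOne.oneRiser_no_four_zeros_of_pull e₁ e₂ hb hc Pl Pl' h0 h12 h23 h34 hsw hPlpos hPlder hD hzero

/-! #### Rev 22 wiring — AB5-0′ (the company log-Wronskian at a pole), AB5-1 … [prose → card § «Skeleton header archive E» block E3.9, rev 32] -/

/-- **BRIDGE — the c-free Euler numerator is `θP − m·d_{l₀}·P`** (✓ `ProductPlusOne.eulerNumerator_eq_general`, LINE … [docstring → card § «Skeleton header archive F» block F.17, rev 33] -/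
theorem eulerNumerator_eq_thetaP_sub {m K : ℕ} (d : Fin K → ℕ) (a : Fin m → Fin K → ℝ) (l₀ : Fin K) :
    eulerNumerator d a l₀ = X * derivative (∏ j, fewnomial d (a j)) - C ((m : ℝ) * (d l₀ : ℝ)) * ∏ j, fewnomial d (a j) :=
  ProductPlusOne.eulerNumerator_eq_general d a l₀

/-- **AB5-0′ — THE COMPANY LOG-WRONSKIAN AT A POLE** (✓ p681202 `ProductPlusOne.theta_wronskian_eval_at_root`, val-lit-p5 … [docstring → card § «Skeleton header archive F» block F.18, rev 33] -/
theorem company_logWronskian_eval_at_root {m K : ℕ} (d : Fin K → ℕ) (a : Fin m → Fin K → ℝ) (i : Fin m) {t : ℝ}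
    (hfi : (fewnomial d (a i)).eval t = 0) :
    ((∏ j, fewnomial d (a j)) * (X * derivative (X * derivative (∏ j, fewnomial d (a j)))) - (X * derivative (∏ j, fewnomial d (a j))) ^ 2).eval t
      = -((X * derivative (fewnomial d (a i))).eval t) ^ 2 * ∏ k ∈ Finset.univ.erase i, ((fewnomial d (a k)).eval t) ^ 2 :=
  ProductPlusOne.theta_wronskian_eval_at_root (fun j => fewnomial d (a j)) i hfi

/-- **AB5-0′, corollary — `W(P) ≤ 0` AT EVERY POLE** (✓ p681202 `ProductPlusOne.theta_wronskian_nonpos_at_root`, LINE … [docstring → card § «Skeleton header archive F» block F.19, rev 33] -/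
theorem company_logWronskian_nonpos_at_root {m K : ℕ} (d : Fin K → ℕ) (a : Fin m → Fin K → ℝ) (i : Fin m) {t : ℝ}
    (hfi : (fewnomial d (a i)).eval t = 0) :
    ((∏ j, fewnomial d (a j)) * (X * derivative (X * derivative (∏ j, fewnomial d (a j)))) - (X * derivative (∏ j, fewnomial d (a j))) ^ 2).eval t ≤ 0 :=
  ProductPlusOne.theta_wronskian_nonpos_at_root (fun j => fewnomial d (a j)) i hfi

/-- ★ **AB5-1 — TWO ZEROS IN A WINDOW ARE SEPARATED BY A POINT WITH `W(P) < 0`** (✓ p681205 … [docstring → card § «Skeleton header archive F» block F.20, rev 33] -/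
theorem exists_companyWronskian_neg_between_zeros {m K : ℕ} (d : Fin K → ℕ) (a : Fin m → Fin K → ℝ) (ν : ℝ)
    (hE : (X * derivative (∏ j, fewnomial d (a j)) - C ν * ∏ j, fewnomial d (a j) : ℝ[X]) ≠ 0) {z z' : ℝ}
    (hz : 0 < z) (hzz' : z < z') (hP : ∀ t ∈ Set.Icc z z', (∏ j, fewnomial d (a j)).eval t ≠ 0)
    (hEz : (X * derivative (∏ j, fewnomial d (a j)) - C ν * ∏ j, fewnomial d (a j) : ℝ[X]).eval z = 0)
    (hEz' : (X * derivative (∏ j, fewnomial d (a j)) - C ν * ∏ j, fewnomial d (a j) : ℝ[X]).eval z' = 0) :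
    ∃ w ∈ Set.Ioo z z', ((∏ j, fewnomial d (a j)) * (X * derivative (X * derivative (∏ j, fewnomial d (a j)))) - (X * derivative (∏ j, fewnomial d (a j))) ^ 2).eval w < 0 :=
  ProductPlusOne.exists_wronskian_neg_between_zeros (∏ j, fewnomial d (a j)) ν hE hz hzz' hP hEz hEz'

/-- ★ **AB5-1 — … AND BY A POINT WITH `W(P) > 0`** (✓ p681205 `ProductPlusOne.exists_wronskian_pos_between_zeros`, LINE … [docstring → card § «Skeleton header archive F» block F.21, rev 33] -/
theorem exists_companyWronskian_pos_between_zeros {m K : ℕ} (d : Fin K → ℕ) (a : Fin m → Fin K → ℝ) (ν : ℝ)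
    (hE : (X * derivative (∏ j, fewnomial d (a j)) - C ν * ∏ j, fewnomial d (a j) : ℝ[X]) ≠ 0) {z z' : ℝ}
    (hz : 0 < z) (hzz' : z < z') (hP : ∀ t ∈ Set.Icc z z', (∏ j, fewnomial d (a j)).eval t ≠ 0)
    (hEz : (X * derivative (∏ j, fewnomial d (a j)) - C ν * ∏ j, fewnomial d (a j) : ℝ[X]).eval z = 0)
    (hEz' : (X * derivative (∏ j, fewnomial d (a j)) - C ν * ∏ j, fewnomial d (a j) : ℝ[X]).eval z' = 0) :
    ∃ w ∈ Set.Ioo z z', 0 < ((∏ j, fewnomial d (a j)) * (X * derivative (X * derivative (∏ j, fewnomial d (a j)))) - (X * derivative (∏ j, fewnomial d (a j))) ^ 2).eval w :=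
  ProductPlusOne.exists_wronskian_pos_between_zeros (∏ j, fewnomial d (a j)) ν hE hz hzz' hP hEz hEz'

/-- ★ **ONE-SIGNED ROWS NEVER CUT** (✓ p681934 `ProductPlusOne.logWronskian_eval_nonneg_of_pairwise`, val-lit-p5 g14, … [docstring → card § «Skeleton header archive F» block F.22, rev 33] -/
theorem row_logWronskian_nonneg_of_pairwise {K : ℕ} (d : Fin K → ℕ) (b : Fin K → ℝ) (hs : ∀ l l', 0 ≤ b l * b l') {x : ℝ} (hx : 0 ≤ x) :
    0 ≤ (fewnomial d b * (X * derivative (X * derivative (fewnomial d b))) - (X * derivative (fewnomial d b)) ^ 2).eval x :=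
  ProductPlusOne.logWronskian_eval_nonneg_of_pairwise d b hs hx

/-- ★★ **ONE RISER AGAINST ANY PULL WITH MONOTONE `Λ` AND STRICTLY INCREASING `Z` ⇒ AT MOST THREE ZEROS** (✓ p680981 … [docstring → card § «Skeleton header archive F» block F.23, rev 33] -/
theorem oneRiser_no_four_zeros_of_strictMonoZ (e₁ e₂ : ℕ) {a b c : ℝ} (hb : 0 < b) (hc : 0 < c) (Pl Pl' Λ' : ℝ → ℝ)
    {x₁ x₂ x₃ x₄ : ℝ} (h0 : 0 < x₁) (h12 : x₁ < x₂) (h23 : x₂ < x₃) (h34 : x₃ < x₄)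
    (hsw : ∀ x ∈ Set.Icc x₁ x₄, a < b * x ^ (e₁ + 1) + c * x ^ (e₁ + e₂ + 2))
    (hPlpos : ∀ x ∈ Set.Icc x₁ x₄, 0 < Pl x) (hPlder : ∀ x ∈ Set.Icc x₁ x₄, HasDerivAt Pl (Pl' x) x)
    (hΛpos : ∀ x ∈ Set.Icc x₁ x₄, 0 < Pl x + x * Pl' x / Pl x - ((e₁ : ℝ) + 1))
    (hΛder : ∀ x ∈ Set.Icc x₁ x₄, HasDerivAt (fun y => Pl y + y * Pl' y / Pl y - ((e₁ : ℝ) + 1)) (Λ' x) x)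
    (hΛmono : MonotoneOn (fun y => Pl y + y * Pl' y / Pl y - ((e₁ : ℝ) + 1)) (Set.Icc x₁ x₄))
    (hZ : StrictMonoOn (fun y => (Pl y + y * Pl' y / Pl y - ((e₁ : ℝ) + 1))
        + y * Λ' y / (Pl y + y * Pl' y / Pl y - ((e₁ : ℝ) + 1))) (Set.Icc x₁ x₄))
    (hzero : ∀ x ∈ ({x₁, x₂, x₃, x₄} : Set ℝ),
      (((e₁ : ℝ) + 1) * b * x ^ (e₁ + 1) + ((e₁ : ℝ) + e₂ + 2) * c * x ^ (e₁ + e₂ + 2))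
          / (b * x ^ (e₁ + 1) + c * x ^ (e₁ + e₂ + 2) - a) - Pl x = 0) : False :=
  ProductPlusOne.oneRiser_no_four_zeros_of_strictMonoZ e₁ e₂ hb hc Pl Pl' Λ' h0 h12 h23 h34 hsw hPlpos hPlder hΛpos hΛder hΛmono hZ hzero

/-- ★★ **THE TRINOMIAL-CLOUD ONE-RISER THEOREM — THE `ρ_I = 1` CELL OF THE FLOOR, LINE CURRENCY** (✓ p683866 … [docstring → card § «Skeleton header archive F» block F.24, rev 33] -/
theorem oneRiser_trinomialCloud_euler_no_four_zeros {m : ℕ} (d : Fin 3 → ℕ) (h01 : d 0 < d 1) (h12 : d 1 < d 2)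
    (a : Fin m → Fin 3 → ℝ) (j₀ : Fin m) (hr1 : a j₀ 1 < 0) (hr2 : a j₀ 2 < 0)
    (hpul : ∀ j, j ≠ j₀ → 0 < a j 0 ∧ a j 1 ≤ 0 ∧ a j 2 ≤ 0 ∧ a j 1 + a j 2 < 0)
    {x₁ x₂ x₃ x₄ : ℝ} (h0 : 0 < x₁) (h12' : x₁ < x₂) (h23 : x₂ < x₃) (h34 : x₃ < x₄)
    (hsw : ∀ x ∈ Set.Icc x₁ x₄, (fewnomial d (a j₀)).eval x < 0)
    (hun : ∀ j, j ≠ j₀ → 0 < (fewnomial d (a j)).eval x₄)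
    (hzero : ∀ x ∈ ({x₁, x₂, x₃, x₄} : Set ℝ), (eulerNumerator d a 0).eval x = 0) : False :=
  ProductPlusOne.oneRiser_trinomialCloud_eulerNumerator_no_four_zeros d h01 h12 a j₀ hr1 hr2 hpul h0 h12' h23 h34 hsw hun hzero

/-- ★★ **ONE ALL-NEGATIVE (ONE-SIGNED) ROW AGAINST AN INCOHERENT TRINOMIAL CLOUD ⇒ NO FOUR ZEROS** (✓ p683866 … [docstring → card § «Skeleton header archive F» block F.25, rev 33] -/
theorem oneSigned_trinomialCloud_euler_no_four_zeros {m : ℕ} (d : Fin 3 → ℕ) (h01 : d 0 < d 1) (h12 : d 1 < d 2)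
    (a : Fin m → Fin 3 → ℝ) (j₀ : Fin m) (hr0 : a j₀ 0 < 0) (hr1 : a j₀ 1 < 0) (hr2 : a j₀ 2 < 0)
    (hpul : ∀ j, j ≠ j₀ → 0 < a j 0 ∧ a j 1 ≤ 0 ∧ a j 2 ≤ 0 ∧ a j 1 + a j 2 < 0)
    {x₁ x₂ x₃ x₄ : ℝ} (h0 : 0 < x₁) (h12' : x₁ < x₂) (h23 : x₂ < x₃) (h34 : x₃ < x₄)
    (hun : ∀ j, j ≠ j₀ → 0 < (fewnomial d (a j)).eval x₄)
    (hzero : ∀ x ∈ ({x₁, x₂, x₃, x₄} : Set ℝ), (eulerNumerator d a 0).eval x = 0) : False :=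
  ProductPlusOne.oneSigned_trinomialCloud_eulerNumerator_no_four_zeros d h01 h12 a j₀ hr0 hr1 hr2 hpul h0 h12' h23 h34 hun hzero

/-- ★ **AB6 — THE LETTER-VARIANCE IDENTITY** (✓ p683786 `ProductPlusOne.letterVariance_identity`, val-lit-p5 g15, LINE … [docstring → card § «Skeleton header archive F» block F.26, rev 33] -/
theorem company_letterVariance_identity {m K : ℕ} (d : Fin K → ℕ) (a : Fin m → Fin K → ℝ) (c x : ℝ)
    (hf : ∀ j, (fewnomial d (a j)).eval x ≠ 0) :
    ∑ j, ((fewnomial d (a j) * (X * derivative (X * derivative (fewnomial d (a j))))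
            - (X * derivative (fewnomial d (a j))) ^ 2).eval x / ((fewnomial d (a j)).eval x) ^ 2)
      = ∑ l, ((d l : ℝ) - c) ^ 2 * x ^ (d l) * ∑ j, a j l / (fewnomial d (a j)).eval x
        - ∑ j, ((X * derivative (fewnomial d (a j))).eval x / (fewnomial d (a j)).eval x - c) ^ 2 :=
  ProductPlusOne.letterVariance_identity d a c x hf

/-- ★ **AB6 — `z·R′(z)·P(z)` AT A ZERO OF THE EULER NUMERATOR IS A REDUCED LETTER MOMENT MINUS A SUM OF SQUARES** (✓ … [docstring → card § «Skeleton header archive F» block F.27, rev 33] -/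
theorem eulerNumerator_deriv_mul_prod_eq_reducedMoment_at_root {m K : ℕ} (d : Fin K → ℕ) (a : Fin m → Fin K → ℝ) (l₀ : Fin K)
    (κ z : ℝ) (hf : ∀ j, (fewnomial d (a j)).eval z ≠ 0) (hRz : (eulerNumerator d a l₀).eval z = 0) :
    z * (derivative (eulerNumerator d a l₀)).eval z * (∏ j, fewnomial d (a j)).eval z
      = (∑ l, ((d l : ℝ) - d l₀) * (((d l : ℝ) - d l₀) - κ) * z ^ (d l) * ∑ j, a j l / (fewnomial d (a j)).eval z
          - ∑ j, ((X * derivative (fewnomial d (a j))).eval z / (fewnomial d (a j)).eval z - d l₀) ^ 2)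
        * ((∏ j, fewnomial d (a j)).eval z) ^ 2 :=
  ProductPlusOne.eulerNumerator_deriv_mul_prod_eq_reducedMoment_at_root d a l₀ κ z hf hRz

/-- ★★ **AB6 — THE SIGN-FREE WINDOW COUNT** (✓ p683786 … [docstring → card § «Skeleton header archive F» block F.28, rev 33] -/
theorem euler_roots_Icc_le_one_of_reducedMoment_neg {m K : ℕ} (d : Fin K → ℕ) (a : Fin m → Fin K → ℝ) (l₀ : Fin K)
    {u v : ℝ} (hu : 0 < u) (hf : ∀ t ∈ Set.Icc u v, ∀ j, (fewnomial d (a j)).eval t ≠ 0)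
    (hneg : ∀ t ∈ Set.Icc u v, (eulerNumerator d a l₀).eval t = 0 →
      ∃ κ : ℝ, ∑ l, ((d l : ℝ) - d l₀) * (((d l : ℝ) - d l₀) - κ) * t ^ (d l) * ∑ j, a j l / (fewnomial d (a j)).eval t < 0) :
    ((eulerNumerator d a l₀).roots.toFinset.filter (fun t => u ≤ t ∧ t ≤ v)).card ≤ 1 :=
  ProductPlusOne.eulerNumerator_roots_Icc_le_one_of_reducedMoment_neg d a l₀ hu hf hneg

/-! #### Rev 23 wiring — the EIGHT SIGN-FREE type-β window counts … [prose → card § «Skeleton header archive E» block E3.10, rev 32] -/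

/-- ★ **SIGN-FREE twin** of `euler_roots_Icc_le_one_of_letterSum_one_pos` (✓ p684542, val-lit-p5 g15): same window, same … [docstring → card § «Skeleton header archive F» block F.29, rev 33] -/
theorem euler_roots_Icc_le_one_of_letterSum_one_pos_signfree {m : ℕ} (d0 p q : ℕ) (hp : 0 < p) (hpq : p < q)
    (a : Fin m → Fin 3 → ℝ) {u v : ℝ} (hu : 0 < u)
    (hg : ∀ x ∈ Set.Icc u v, ∀ j, a j 0 + a j 1 * x ^ p + a j 2 * x ^ q ≠ 0)
    (hA : ∀ x ∈ Set.Icc u v, 0 < ∑ j, a j 1 / (a j 0 + a j 1 * x ^ p + a j 2 * x ^ q)) :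
    ((eulerNumerator (![d0, d0 + p, d0 + q]) a 0).roots.toFinset.filter (fun t => u ≤ t ∧ t ≤ v)).card ≤ 1 :=
  ProductPlusOne.eulerNumerator_roots_Icc_le_one_of_letterSum_one_pos_signfree d0 p q hp hpq a hu hg hA

/-- ★ **SIGN-FREE twin** of `euler_roots_Icc_le_one_of_letterSum_two_neg` (✓ p684542, val-lit-p5 g15): same window, same … [docstring → card § «Skeleton header archive F» block F.30, rev 33] -/
theorem euler_roots_Icc_le_one_of_letterSum_two_neg_signfree {m : ℕ} (d0 p q : ℕ) (hp : 0 < p) (hpq : p < q)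
    (a : Fin m → Fin 3 → ℝ) {u v : ℝ} (hu : 0 < u)
    (hg : ∀ x ∈ Set.Icc u v, ∀ j, a j 0 + a j 1 * x ^ p + a j 2 * x ^ q ≠ 0)
    (hA : ∀ x ∈ Set.Icc u v, ∑ j, a j 2 / (a j 0 + a j 1 * x ^ p + a j 2 * x ^ q) < 0) :
    ((eulerNumerator (![d0, d0 + p, d0 + q]) a 0).roots.toFinset.filter (fun t => u ≤ t ∧ t ≤ v)).card ≤ 1 :=
  ProductPlusOne.eulerNumerator_roots_Icc_le_one_of_letterSum_two_neg_signfree d0 p q hp hpq a hu hg hA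

/-- ★ **SIGN-FREE twin** of `eulerMiddle_roots_Icc_le_one_of_letterSumTwo_neg` (✓ p684542, val-lit-p5 g15): same window, … [docstring → card § «Skeleton header archive F» block F.31, rev 33] -/
theorem eulerMiddle_roots_Icc_le_one_of_letterSumTwo_neg_signfree {m : ℕ} (d0 p s : ℕ) (hp : 0 < p) (hs : 0 < s)
    (a : Fin m → Fin 3 → ℝ) {u v : ℝ} (hu : 0 < u)
    (hg : ∀ x ∈ Set.Icc u v, ∀ j, a j 0 + a j 1 * x ^ p + a j 2 * x ^ (p + s) ≠ 0)
    (hA : ∀ x ∈ Set.Icc u v, ∑ j, a j 2 * x ^ p / (a j 0 + a j 1 * x ^ p + a j 2 * x ^ (p + s)) < 0) :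
    ((eulerNumerator (![d0, d0 + p, d0 + p + s]) a 1).roots.toFinset.filter (fun t => u ≤ t ∧ t ≤ v)).card ≤ 1 :=
  ProductPlusOne.eulerNumeratorMiddle_roots_Icc_le_one_of_letterSumTwo_neg_signfree d0 p s hp hs a hu hg hA

/-- ★ **SIGN-FREE twin** of `eulerMiddle_roots_Icc_le_one_of_letterSumZero_neg` (✓ p684542, val-lit-p5 g15): same window, … [docstring → card § «Skeleton header archive F» block F.32, rev 33] -/
theorem eulerMiddle_roots_Icc_le_one_of_letterSumZero_neg_signfree {m : ℕ} (d0 p s : ℕ) (hp : 0 < p) (hs : 0 < s)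
    (a : Fin m → Fin 3 → ℝ) {u v : ℝ} (hu : 0 < u)
    (hg : ∀ x ∈ Set.Icc u v, ∀ j, a j 0 + a j 1 * x ^ p + a j 2 * x ^ (p + s) ≠ 0)
    (hA : ∀ x ∈ Set.Icc u v, ∑ j, a j 0 * x ^ p / (a j 0 + a j 1 * x ^ p + a j 2 * x ^ (p + s)) < 0) :
    ((eulerNumerator (![d0, d0 + p, d0 + p + s]) a 1).roots.toFinset.filter (fun t => u ≤ t ∧ t ≤ v)).card ≤ 1 :=
  ProductPlusOne.eulerNumeratorMiddle_roots_Icc_le_one_of_letterSumZero_neg_signfree d0 p s hp hs a hu hg hA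

/-- ★ **SIGN-FREE twin** of `eulerTop_roots_Icc_le_one_of_letterSumOne_pos` (✓ p684542, val-lit-p5 g15): same window, … [docstring → card § «Skeleton header archive F» block F.33, rev 33] -/
theorem eulerTop_roots_Icc_le_one_of_letterSumOne_pos_signfree {m : ℕ} (d0 p q : ℕ) (hp : 0 < p) (hpq : p < q)
    (a : Fin m → Fin 3 → ℝ) {u v : ℝ} (hu : 0 < u)
    (hg : ∀ x ∈ Set.Icc u v, ∀ j, a j 0 + a j 1 * x ^ p + a j 2 * x ^ q ≠ 0)
    (hB : ∀ x ∈ Set.Icc u v, 0 < ∑ j, a j 1 * x ^ q / (a j 0 + a j 1 * x ^ p + a j 2 * x ^ q)) :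
    ((eulerNumerator (![d0, d0 + p, d0 + q]) a 2).roots.toFinset.filter (fun t => u ≤ t ∧ t ≤ v)).card ≤ 1 :=
  ProductPlusOne.eulerNumeratorTop_roots_Icc_le_one_of_letterSumOne_pos_signfree d0 p q hp hpq a hu hg hB

/-- ★ **SIGN-FREE twin** of `eulerTop_roots_Icc_le_one_of_letterSumZero_neg` (✓ p684542, val-lit-p5 g15): same window, … [docstring → card § «Skeleton header archive F» block F.34, rev 33] -/
theorem eulerTop_roots_Icc_le_one_of_letterSumZero_neg_signfree {m : ℕ} (d0 p q : ℕ) (hp : 0 < p) (hpq : p < q)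
    (a : Fin m → Fin 3 → ℝ) {u v : ℝ} (hu : 0 < u)
    (hg : ∀ x ∈ Set.Icc u v, ∀ j, a j 0 + a j 1 * x ^ p + a j 2 * x ^ q ≠ 0)
    (hB : ∀ x ∈ Set.Icc u v, ∑ j, a j 0 * x ^ q / (a j 0 + a j 1 * x ^ p + a j 2 * x ^ q) < 0) :
    ((eulerNumerator (![d0, d0 + p, d0 + q]) a 2).roots.toFinset.filter (fun t => u ≤ t ∧ t ≤ v)).card ≤ 1 :=
  ProductPlusOne.eulerNumeratorTop_roots_Icc_le_one_of_letterSumZero_neg_signfree d0 p q hp hpq a hu hg hB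

/-- ★ **SIGN-FREE twin** of `eulerK_roots_Icc_le_one_of_letterSums_pos` (✓ p684542, val-lit-p5 g15): same window, same … [docstring → card § «Skeleton header archive F» block F.35, rev 33] -/
theorem eulerK_roots_Icc_le_one_of_letterSums_pos_signfree {m K : ℕ} (hK : 3 ≤ K) (d : Fin K → ℕ) (hd : StrictMono d)
    (a : Fin m → Fin K → ℝ)
    {u v : ℝ} (hu : 0 < u) (hG : ∀ x ∈ Set.Icc u v, ∀ j, (∑ l', a j l' * x ^ (d l' - d ⟨0, by omega⟩)) ≠ 0)
    (hA : ∀ x ∈ Set.Icc u v, ∀ l : Fin K, 0 < (l : ℕ) → (l : ℕ) < K - 1 →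
      0 < ∑ j, a j l / ∑ l', a j l' * x ^ (d l' - d ⟨0, by omega⟩)) :
    ((eulerNumerator d a ⟨0, by omega⟩).roots.toFinset.filter (fun t => u ≤ t ∧ t ≤ v)).card ≤ 1 :=
  ProductPlusOne.eulerNumeratorK_roots_Icc_le_one_of_letterSums_pos_signfree hK d hd a hu hG hA

/-- ★ **SIGN-FREE twin** of `eulerK_roots_Icc_le_one_of_letterSums_neg` (✓ p684542, val-lit-p5 g15): same window, same … [docstring → card § «Skeleton header archive F» block F.36, rev 33] -/
theorem eulerK_roots_Icc_le_one_of_letterSums_neg_signfree {m K : ℕ} (hK : 3 ≤ K) (d : Fin K → ℕ) (hd : StrictMono d)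
    (a : Fin m → Fin K → ℝ)
    {u v : ℝ} (hu : 0 < u) (hG : ∀ x ∈ Set.Icc u v, ∀ j, (∑ l', a j l' * x ^ (d l' - d ⟨0, by omega⟩)) ≠ 0)
    (hA : ∀ x ∈ Set.Icc u v, ∀ l : Fin K, 2 ≤ (l : ℕ) → ∑ j, a j l / ∑ l', a j l' * x ^ (d l' - d ⟨0, by omega⟩) < 0) :
    ((eulerNumerator d a ⟨0, by omega⟩).roots.toFinset.filter (fun t => u ≤ t ∧ t ≤ v)).card ≤ 1 :=
  ProductPlusOne.eulerNumeratorK_roots_Icc_le_one_of_letterSums_neg_signfree hK d hd a hu hG hA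

/-- ★★ **SIGN-FREE WINDOW COUNT FROM A LETTER-SIGN PATTERN — EVERY K, EVERY COUPLING `l₀`, EVERY PIVOT `l₁`** (✓ p685556 … [docstring → card § «Skeleton header archive F» block F.37, rev 33] -/
theorem euler_roots_Icc_le_one_of_letterSigns {m K : ℕ} (d : Fin K → ℕ) (hd : StrictMono d) (a : Fin m → Fin K → ℝ)
    (l₀ l₁ : Fin K) {u v : ℝ} (hu : 0 < u) (hf : ∀ t ∈ Set.Icc u v, ∀ j, (fewnomial d (a j)).eval t ≠ 0)
    (hin : ∀ t ∈ Set.Icc u v, ∀ l, (l₀ < l ∧ l < l₁) ∨ (l₁ < l ∧ l < l₀) → 0 ≤ ∑ j, a j l / (fewnomial d (a j)).eval t)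
    (hout : ∀ t ∈ Set.Icc u v, ∀ l, (l < l₀ ∧ l < l₁) ∨ (l₀ < l ∧ l₁ < l) → ∑ j, a j l / (fewnomial d (a j)).eval t ≤ 0)
    (hstrict : ∃ l, (((l₀ < l ∧ l < l₁) ∨ (l₁ < l ∧ l < l₀)) ∧ ∀ t ∈ Set.Icc u v, 0 < ∑ j, a j l / (fewnomial d (a j)).eval t) ∨
      (((l < l₀ ∧ l < l₁) ∨ (l₀ < l ∧ l₁ < l)) ∧ ∀ t ∈ Set.Icc u v, ∑ j, a j l / (fewnomial d (a j)).eval t < 0)) :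
    ((eulerNumerator d a l₀).roots.toFinset.filter (fun t => u ≤ t ∧ t ≤ v)).card ≤ 1 :=
  ProductPlusOne.eulerNumerator_roots_Icc_le_one_of_letterSigns d hd a l₀ l₁ hu hf hin hout hstrict

/-- ★ **ADJACENT PIVOT** (✓ p685556 `ProductPlusOne.eulerNumerator_roots_Icc_le_one_of_letterSigns_adjacent`, LINE … [docstring → card § «Skeleton header archive F» block F.38, rev 33] -/
theorem euler_roots_Icc_le_one_of_letterSigns_adjacent {m K : ℕ} (d : Fin K → ℕ) (hd : StrictMono d)
    (a : Fin m → Fin K → ℝ) (l₀ l₁ : Fin K) (hadj : ∀ l, ¬ ((l₀ < l ∧ l < l₁) ∨ (l₁ < l ∧ l < l₀)))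
    {u v : ℝ} (hu : 0 < u) (hf : ∀ t ∈ Set.Icc u v, ∀ j, (fewnomial d (a j)).eval t ≠ 0)
    (hout : ∀ t ∈ Set.Icc u v, ∀ l, l ≠ l₀ → l ≠ l₁ → ∑ j, a j l / (fewnomial d (a j)).eval t ≤ 0)
    (hstrict : ∃ l, l ≠ l₀ ∧ l ≠ l₁ ∧ ∀ t ∈ Set.Icc u v, ∑ j, a j l / (fewnomial d (a j)).eval t < 0) :
    ((eulerNumerator d a l₀).roots.toFinset.filter (fun t => u ≤ t ∧ t ≤ v)).card ≤ 1 :=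
  ProductPlusOne.eulerNumerator_roots_Icc_le_one_of_letterSigns_adjacent d hd a l₀ l₁ hadj hu hf hout hstrict

/-- ★ **TOP COUPLING, EVERY `K ≥ 3`, SIGN-FREE: all middle letter sums `≥ 0`, one `> 0` ⇒ ≤ 1 zero of … [docstring → card § «Skeleton header archive F» block F.39, rev 33] -/
theorem eulerTopK_roots_Icc_le_one_of_middle_letterSums_nonneg {m K : ℕ} (hK : 3 ≤ K) (d : Fin K → ℕ) (hd : StrictMono d)
    (a : Fin m → Fin K → ℝ) {u v : ℝ} (hu : 0 < u)
    (hf : ∀ t ∈ Set.Icc u v, ∀ j, (fewnomial d (a j)).eval t ≠ 0)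
    (hmid : ∀ t ∈ Set.Icc u v, ∀ l : Fin K, 0 < (l : ℕ) → (l : ℕ) < K - 1 → 0 ≤ ∑ j, a j l / (fewnomial d (a j)).eval t)
    (hstrict : ∃ l : Fin K, 0 < (l : ℕ) ∧ (l : ℕ) < K - 1 ∧ ∀ t ∈ Set.Icc u v, 0 < ∑ j, a j l / (fewnomial d (a j)).eval t) :
    ((eulerNumerator d a ⟨K - 1, by omega⟩).roots.toFinset.filter (fun t => u ≤ t ∧ t ≤ v)).card ≤ 1 :=
  ProductPlusOne.eulerNumeratorTopK_roots_Icc_le_one_of_middle_letterSums_nonneg hK d hd a hu hf hmid hstrict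

/-- ★ **VARIANCE WINDOWS — AB6-1 AS A COUNT, EVERY COUPLING AT ONCE** (✓ p685556 … [docstring → card § «Skeleton header archive F» block F.40, rev 33] -/
theorem euler_roots_Icc_le_one_of_centredMoment_neg {m K : ℕ} (d : Fin K → ℕ) (a : Fin m → Fin K → ℝ) (l₀ : Fin K)
    {u v : ℝ} (hu : 0 < u) (hf : ∀ t ∈ Set.Icc u v, ∀ j, (fewnomial d (a j)).eval t ≠ 0)
    (hvar : ∀ t ∈ Set.Icc u v, (eulerNumerator d a l₀).eval t = 0 →
      ∃ c : ℝ, ∑ l, ((d l : ℝ) - c) ^ 2 * t ^ (d l) * ∑ j, a j l / (fewnomial d (a j)).eval t < 0) :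
    ((eulerNumerator d a l₀).roots.toFinset.filter (fun t => u ≤ t ∧ t ≤ v)).card ≤ 1 :=
  ProductPlusOne.eulerNumerator_roots_Icc_le_one_of_centredMoment_neg d a l₀ hu hf hvar

/-- ★★ **AB5-1 AS A COUNT — ZEROS OF THE EULER NUMERATOR IN A POLE-FREE WINDOW ≤ ZEROS OF THE COMPANY LOG-WRONSKIAN THERE … [docstring → card § «Skeleton header archive F» block F.41, rev 33] -/
theorem euler_roots_Icc_le_companyWronskian_roots_add_one {m K : ℕ} (d : Fin K → ℕ) (a : Fin m → Fin K → ℝ) (l₀ : Fin K)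
    {u v : ℝ} (hu : 0 < u) (hP : ∀ t ∈ Set.Icc u v, (∏ j, fewnomial d (a j)).eval t ≠ 0) :
    ((eulerNumerator d a l₀).roots.toFinset.filter (fun t => u ≤ t ∧ t ≤ v)).card
      ≤ (((∏ j, fewnomial d (a j)) * (X * derivative (X * derivative (∏ j, fewnomial d (a j))))
            - (X * derivative (∏ j, fewnomial d (a j))) ^ 2).roots.toFinset.filter (fun w => u < w ∧ w < v)).card + 1 :=
  ProductPlusOne.eulerNumerator_roots_Icc_le_wronskian_roots_add_one d a l₀ hu hP

/-- ★ **… AND AT EVERY LEVEL `ν`** (✓ p685233 `ProductPlusOne.euler_roots_Icc_le_wronskian_roots_add_one`, LINE spelling, … [docstring → card § «Skeleton header archive F» block F.42, rev 33] -/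
theorem thetaP_sub_roots_Icc_le_companyWronskian_roots_add_one {m K : ℕ} (d : Fin K → ℕ) (a : Fin m → Fin K → ℝ) (ν : ℝ)
    {u v : ℝ} (hu : 0 < u) (hP : ∀ t ∈ Set.Icc u v, (∏ j, fewnomial d (a j)).eval t ≠ 0) :
    ((X * derivative (∏ j, fewnomial d (a j)) - C ν * ∏ j, fewnomial d (a j) : ℝ[X]).roots.toFinset.filter (fun t => u ≤ t ∧ t ≤ v)).card
      ≤ (((∏ j, fewnomial d (a j)) * (X * derivative (X * derivative (∏ j, fewnomial d (a j))))
            - (X * derivative (∏ j, fewnomial d (a j))) ^ 2).roots.toFinset.filter (fun w => u < w ∧ w < v)).card + 1 :=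
  ProductPlusOne.euler_roots_Icc_le_wronskian_roots_add_one (∏ j, fewnomial d (a j)) ν hu hP

/-! #### Rev 24 wiring (A): ROW-WISE CHART FORMS … [prose → card § «Skeleton header archive E» block E3.11, rev 32] -/

/-- ★ ROW-WISE CHART COUNT ≤ 1 zero (p686380, rev 24) … [prose → card § «Skeleton header archive K» block K.7, rev 39]; closes NO stub. -/
theorem euler_roots_Icc_le_one_of_rowForms {m K : ℕ} (d : Fin K → ℕ) (a : Fin m → Fin K → ℝ) (l₀ : Fin K)
    {u v : ℝ} (hu : 0 < u) (hf : ∀ t ∈ Set.Icc u v, ∀ j, (fewnomial d (a j)).eval t ≠ 0)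
    (hrow : ∀ t ∈ Set.Icc u v, (eulerNumerator d a l₀).eval t = 0 →
        ∃ lam : ℝ,
          (∀ j, (∑ l, a j l * t ^ (d l)) * (∑ l, ((d l : ℝ) - d l₀) * (((d l : ℝ) - d l₀) - lam) * (a j l * t ^ (d l)))
              ≤ (∑ l, ((d l : ℝ) - d l₀) * (a j l * t ^ (d l))) ^ 2) ∧
          (∃ j, (∑ l, a j l * t ^ (d l)) * (∑ l, ((d l : ℝ) - d l₀) * (((d l : ℝ) - d l₀) - lam) * (a j l * t ^ (d l)))
              < (∑ l, ((d l : ℝ) - d l₀) * (a j l * t ^ (d l))) ^ 2)) :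
    ((eulerNumerator d a l₀).roots.toFinset.filter (fun t => u ≤ t ∧ t ≤ v)).card ≤ 1 :=
  ProductPlusOne.eulerNumerator_roots_Icc_le_one_of_rowForms d a l₀ hu hf hrow

/-- ★ TOP-CHART WINDOW ≤ 1 zero (p686380, rev 24) … [prose → card § «Skeleton header archive K» block K.2, rev 39]; closes NO stub. -/
theorem euler_roots_Icc_le_one_of_topChart {m : ℕ} (d : Fin 3 → ℕ) (h01 : d 0 < d 1) (h12 : d 1 < d 2)
    (a : Fin m → Fin 3 → ℝ) {u v : ℝ} (hu : 0 < u)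
    (hf : ∀ t ∈ Set.Icc u v, ∀ j, (fewnomial d (a j)).eval t ≠ 0)
    (hrows : ∀ t ∈ Set.Icc u v, ∀ j, 0 ≤ a j 0 * a j 1 ∨ 0 ≤ a j 1 * (fewnomial d (a j)).eval t)
    (hnd : ∃ j, a j 1 ≠ 0 ∨ a j 2 ≠ 0) :
    ((eulerNumerator d a 0).roots.toFinset.filter (fun t => u ≤ t ∧ t ≤ v)).card ≤ 1 :=
  ProductPlusOne.eulerNumerator_roots_Icc_le_one_of_topChart d h01 h12 a hu hf hrows hnd

/-- ★ BOTTOM-CHART WINDOW ≤ 1 zero (p686380, rev 24) … [prose → card § «Skeleton header archive K» block K.1, rev 39]; closes NO stub. -/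
theorem euler_roots_Icc_le_one_of_bottomChart {m : ℕ} (d : Fin 3 → ℕ) (h01 : d 0 < d 1) (h12 : d 1 < d 2)
    (a : Fin m → Fin 3 → ℝ) {u v : ℝ} (hu : 0 < u)
    (hf : ∀ t ∈ Set.Icc u v, ∀ j, (fewnomial d (a j)).eval t ≠ 0)
    (hrows : ∀ t ∈ Set.Icc u v, ∀ j, a j 2 * (fewnomial d (a j)).eval t ≤ 0
      ∨ (d 2 - d 0 ≤ 4 * (d 1 - d 0) ∧ a j 0 * a j 2 ≤ 0))
    (hnd : ∃ j, (a j 1 ≠ 0 ∨ a j 2 ≠ 0) ∧ ∀ t ∈ Set.Icc u v, a j 2 * (fewnomial d (a j)).eval t ≤ 0) :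
    ((eulerNumerator d a 0).roots.toFinset.filter (fun t => u ≤ t ∧ t ≤ v)).card ≤ 1 :=
  ProductPlusOne.eulerNumerator_roots_Icc_le_one_of_bottomChart d h01 h12 a hu hf hrows hnd

/-! #### Rev 24 wiring (B): THE FLOOR AS A BUDGET ON ONE POLYNOMIAL … [prose → card § «Skeleton header archive E» block E3.12, rev 32] -/

/-- ★ N1 `Z₊(θP − νP) ≤ Z₊(W(P)) + 2Z₊(P) + 1` (p687193, rev 24) … [prose → card § «Skeleton header archive K» block K.10, rev 39]; closes NO stub. -/
theorem thetaP_sub_posRoots_le_wronskian_add (P : ℝ[X]) (ν : ℝ) :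
    ((X * derivative P - C ν * P).roots.toFinset.filter (fun t => 0 < t)).card
      ≤ ((P * (X * derivative (X * derivative P)) - (X * derivative P) ^ 2).roots.toFinset.filter (fun t => 0 < t)).card
        + 2 * (P.roots.toFinset.filter (fun t => 0 < t)).card + 1 :=
  ProductPlusOne.card_posRoots_thetaSub_le_wronskian_add P ν

/-- ★ N2 Euler budget `≤ Z₊(W(P)) + 2Z₊(P) + 1` (p687193, rev 24) … [prose → card § «Skeleton header archive K» block K.12, rev 39]; closes NO stub. -/
theorem euler_posRoots_le_companyWronskian_add {m K : ℕ} (d : Fin K → ℕ) (a : Fin m → Fin K → ℝ) (l₀ : Fin K) :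
    ((eulerNumerator d a l₀).roots.toFinset.filter (fun t => 0 < t)).card
      ≤ (((∏ j, fewnomial d (a j)) * (X * derivative (X * derivative (∏ j, fewnomial d (a j))))
            - (X * derivative (∏ j, fewnomial d (a j))) ^ 2).roots.toFinset.filter (fun t => 0 < t)).card
        + 2 * ((∏ j, fewnomial d (a j)).roots.toFinset.filter (fun t => 0 < t)).card + 1 :=
  ProductPlusOne.card_posRoots_eulerNumerator_le_wronskian_add d a l₀

/-- ★ N3 one-change K = 3 company: ≤ m positive roots (p687193, rev 24) … [prose → card § «Skeleton header archive K» block K.11, rev 39]; closes NO stub. -/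
theorem company_posRoots_le_of_oneChange {m : ℕ} (d : Fin 3 → ℕ) (h01 : d 0 < d 1) (h12 : d 1 < d 2) (a : Fin m → Fin 3 → ℝ)
    (hone : ∀ j, ¬ (a j 0 * a j 1 < 0 ∧ a j 1 * a j 2 < 0)) :
    ((∏ j, fewnomial d (a j)).roots.toFinset.filter (fun t => 0 < t)).card ≤ m :=
  ProductPlusOne.card_posRoots_prod_le_of_oneChange d h01 h12 a hone

/-- ★★ N2+N3 the floor as a budget on `Z₊(W(∏ fewnomial))` (p687193, rev 24) … [prose → card § «Skeleton header archive K» block K.6, rev 39]; closes NO stub. -/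
theorem euler_posRoots_le_companyWronskian_add_of_oneChange {m : ℕ} (d : Fin 3 → ℕ) (h01 : d 0 < d 1) (h12 : d 1 < d 2)
    (a : Fin m → Fin 3 → ℝ) (hone : ∀ j, ¬ (a j 0 * a j 1 < 0 ∧ a j 1 * a j 2 < 0)) (l₀ : Fin 3) :
    ((eulerNumerator d a l₀).roots.toFinset.filter (fun t => 0 < t)).card
      ≤ (((∏ j, fewnomial d (a j)) * (X * derivative (X * derivative (∏ j, fewnomial d (a j))))
            - (X * derivative (∏ j, fewnomial d (a j))) ^ 2).roots.toFinset.filter (fun t => 0 < t)).card + 2 * m + 1 :=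
  ProductPlusOne.card_posRoots_eulerNumerator_le_wronskian_add_of_oneChange d h01 h12 a hone l₀

/-! ### Rev 25 wiring — EB2-W's first rungs (W-currency, next to def #20 `WronskianBudgetK3`) -/

/-- ★ **EB2-W RUNG 0, EVERY K, EVERY SUPPORT** (val-lit-p5 g15 p689769 … [docstring → card § «Skeleton header archive G» block G.1, rev 34] -/
theorem wronskian_prod_posRoots_eq_zero_of_sameSign {m K : ℕ} (d : Fin K → ℕ) (a : Fin m → Fin K → ℝ)
    (hsame : ∀ j (l l' : Fin K), 0 ≤ a j l * a j l') :
    (((∏ j, fewnomial d (a j)) * (X * derivative (X * derivative (∏ j, fewnomial d (a j))))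
        - (X * derivative (∏ j, fewnomial d (a j))) ^ 2).roots.toFinset.filter (fun t => 0 < t)).card = 0 :=
  ProductPlusOne.card_posRoots_wronskian_prod_eq_zero_of_sameSign d a hsame

/-- ★ **EB2-W SHARPNESS: 2 PER ZERO-CHANGE ROW IS ATTAINED** (val-lit-p5 g15 p689843 … [docstring → card § «Skeleton header archive G» block G.2, rev 34] -/
theorem wronskianSharp_six_zeros_K3 :
    ∃ x₁ x₂ x₃ x₄ x₅ x₆ : ℝ, 1 / 1000 < x₁ ∧ x₁ < x₂ ∧ x₂ < x₃ ∧ x₃ < x₄ ∧ x₄ < x₅ ∧ x₅ < x₆ ∧ x₆ < 50000 ∧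
      ∀ x ∈ ({x₁, x₂, x₃, x₄, x₅, x₆} : Set ℝ),
        ((∏ j, fewnomial (![0, 1, 6] : Fin 3 → ℕ) ((![![(1 : ℝ), 0, 1], ![1, 0, 1 / 10 ^ 12], ![1, 0, 1 / 10 ^ 24], ![1, -1 / 10 ^ 5, 0]] : Fin 4 → Fin 3 → ℝ) j))
            * (X * derivative (X * derivative (∏ j, fewnomial (![0, 1, 6] : Fin 3 → ℕ)
                ((![![(1 : ℝ), 0, 1], ![1, 0, 1 / 10 ^ 12], ![1, 0, 1 / 10 ^ 24], ![1, -1 / 10 ^ 5, 0]] : Fin 4 → Fin 3 → ℝ) j))))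
          - (X * derivative (∏ j, fewnomial (![0, 1, 6] : Fin 3 → ℕ)
                ((![![(1 : ℝ), 0, 1], ![1, 0, 1 / 10 ^ 12], ![1, 0, 1 / 10 ^ 24], ![1, -1 / 10 ^ 5, 0]] : Fin 4 → Fin 3 → ℝ) j))) ^ 2).eval x = 0 :=
  ProductPlusOne.wronskianSharp_six_zeros

/-! ### Rev 26 wiring — the W-currency ρ_I = 1 cell in LINE currency (val-lit-p7 g16 p691125 `…SlopeLine`) -/

/-- ★ **W-CURRENCY ρ_I = 1 CELL** (val-lit-p7 g16 p691125 … [docstring → card § «Skeleton header archive G» block G.3, rev 34] -/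
theorem oneRiser_cloud_wronskian_roots_le_two {m : ℕ} (d : Fin 3 → ℕ) (h01 : d 0 < d 1) (h12 : d 1 < d 2)
    (a : Fin m → Fin 3 → ℝ) (j₀ : Fin m) (hr0 : 0 ≤ a j₀ 0) (hr1 : a j₀ 1 < 0) (hr2 : a j₀ 2 < 0)
    (hpul : ∀ j, j ≠ j₀ → 0 < a j 0 ∧ a j 1 ≤ 0 ∧ a j 2 ≤ 0 ∧ a j 1 + a j 2 < 0)
    {u v : ℝ} (hu : 0 < u)
    (hsw : ∀ x ∈ Set.Icc u v, (fewnomial d (a j₀)).eval x < 0)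
    (hun : ∀ j, j ≠ j₀ → 0 < (fewnomial d (a j)).eval v) :
    (((∏ j, fewnomial d (a j)) * (X * derivative (X * derivative (∏ j, fewnomial d (a j))))
        - (X * derivative (∏ j, fewnomial d (a j))) ^ 2).roots.toFinset.filter (fun w => u < w ∧ w < v)).card ≤ 2 :=
  ProductPlusOne.oneRiser_trinomialCloud_wronskian_roots_le_two d h01 h12 a j₀ hr0 hr1 hr2 hpul hu hsw hun

/-- ★★ **THE SAME CELL IN EULER CURRENCY, EVERY COUPLING** (val-lit-p7 g16 p691125 `…SlopeLine`, rev 26 wiring): under … [docstring → card § «Skeleton header archive G» block G.4, rev 34] -/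
theorem oneRiser_cloud_euler_roots_le_three {m : ℕ} (d : Fin 3 → ℕ) (h01 : d 0 < d 1) (h12 : d 1 < d 2)
    (a : Fin m → Fin 3 → ℝ) (j₀ : Fin m) (hr0 : 0 ≤ a j₀ 0) (hr1 : a j₀ 1 < 0) (hr2 : a j₀ 2 < 0)
    (hpul : ∀ j, j ≠ j₀ → 0 < a j 0 ∧ a j 1 ≤ 0 ∧ a j 2 ≤ 0 ∧ a j 1 + a j 2 < 0)
    (l₀ : Fin 3) {u v : ℝ} (hu : 0 < u)
    (hsw : ∀ x ∈ Set.Icc u v, (fewnomial d (a j₀)).eval x < 0)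
    (hun : ∀ j, j ≠ j₀ → 0 < (fewnomial d (a j)).eval v) :
    ((eulerNumerator d a l₀).roots.toFinset.filter (fun t => u ≤ t ∧ t ≤ v)).card ≤ 3 :=
  ProductPlusOne.oneRiser_trinomialCloud_eulerNumerator_roots_le_three d h01 h12 a j₀ hr0 hr1 hr2 hpul l₀ hu hsw hun

/-! ### Rev 27 wiring — KNEE and COHERENT-RISING W-cells in LINE currency (p7 g16 `…SlopeKneeLine` / `…SlopeCoherent`) -/

/-- ★ **W-CURRENCY KNEE CELL** (p7 g16 ✓ p692721 `…SlopeKneeLine`, engine ✓ p691373 `oneKnee_slope_no_three_zeros`; rev … [docstring → card § «Skeleton header archive G» block G.5, rev 34] -/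
theorem oneKnee_cloud_wronskian_roots_le_two {m : ℕ} (d : Fin 3 → ℕ) (e₁ e₂ : ℕ)
    (he₁ : d 1 = d 0 + e₁ + 1) (he₂ : d 2 = d 1 + e₂ + 1)
    (a : Fin m → Fin 3 → ℝ) (j₀ : Fin m) (hk1 : a j₀ 1 = 0) (hk02 : 0 < a j₀ 0 * a j₀ 2)
    (hpul : ∀ j, j ≠ j₀ → 0 < a j 0 ∧ a j 1 ≤ 0 ∧ a j 2 ≤ 0 ∧ a j 1 + a j 2 < 0)
    {u v : ℝ} (hu : 0 < u)
    (hun : ∀ j, j ≠ j₀ → 0 < (fewnomial d (a j)).eval v) :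
    (((∏ j, fewnomial d (a j)) * (X * derivative (X * derivative (∏ j, fewnomial d (a j))))
        - (X * derivative (∏ j, fewnomial d (a j))) ^ 2).roots.toFinset.filter (fun w => u < w ∧ w < v)).card ≤ 2 :=
  ProductPlusOne.oneKnee_trinomialCloud_wronskian_roots_le_two d e₁ e₂ he₁ he₂ a j₀ hk1 hk02 hpul hu hun

/-- ★★ **KNEE CELL, EULER CURRENCY, EVERY COUPLING** (✓ p692721, rev 27 wire): same hypotheses ⇒ `eulerNumerator d a l₀` … [docstring → card § «Skeleton header archive G» block G.6, rev 34] -/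
theorem oneKnee_cloud_euler_roots_le_three {m : ℕ} (d : Fin 3 → ℕ) (e₁ e₂ : ℕ)
    (he₁ : d 1 = d 0 + e₁ + 1) (he₂ : d 2 = d 1 + e₂ + 1)
    (a : Fin m → Fin 3 → ℝ) (j₀ : Fin m) (hk1 : a j₀ 1 = 0) (hk02 : 0 < a j₀ 0 * a j₀ 2)
    (hpul : ∀ j, j ≠ j₀ → 0 < a j 0 ∧ a j 1 ≤ 0 ∧ a j 2 ≤ 0 ∧ a j 1 + a j 2 < 0)
    (l₀ : Fin 3) {u v : ℝ} (hu : 0 < u) (huv : u ≤ v)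
    (hun : ∀ j, j ≠ j₀ → 0 < (fewnomial d (a j)).eval v) :
    ((eulerNumerator d a l₀).roots.toFinset.filter (fun t => u ≤ t ∧ t ≤ v)).card ≤ 3 :=
  ProductPlusOne.oneKnee_trinomialCloud_eulerNumerator_roots_le_three d e₁ e₂ he₁ he₂ a j₀ hk1 hk02 hpul l₀ hu huv hun

/-- ★ **W-CURRENCY COHERENT-RISING CELL** (p7 g16 ✓ p692676 `…SlopeCoherent`, engine ✓ p691373 … [docstring → card § «Skeleton header archive G» block G.7, rev 34] -/
theorem oneCoherent_cloud_wronskian_roots_le_two {m : ℕ} (d : Fin 3 → ℕ) (e₁ e₂ : ℕ)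
    (he₁ : d 1 = d 0 + e₁ + 1) (he₂ : d 2 = d 1 + e₂ + 1)
    (a : Fin m → Fin 3 → ℝ) (j₀ : Fin m) (hr0 : 0 < a j₀ 0) (hr1 : 0 < a j₀ 1) (hr2 : a j₀ 2 < 0)
    (hpul : ∀ j, j ≠ j₀ → 0 < a j 0 ∧ a j 1 ≤ 0 ∧ a j 2 ≤ 0 ∧ a j 1 + a j 2 < 0)
    {u v : ℝ} (hu : 0 < u)
    (hun : ∀ j, 0 < (fewnomial d (a j)).eval v)
    (hrise : ProductPlusOne.rowPsi1 e₁ e₂ (a j₀ 0) (-(a j₀ 1)) (-(a j₀ 2)) v < 0) :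
    (((∏ j, fewnomial d (a j)) * (X * derivative (X * derivative (∏ j, fewnomial d (a j))))
        - (X * derivative (∏ j, fewnomial d (a j))) ^ 2).roots.toFinset.filter (fun w => u < w ∧ w < v)).card ≤ 2 :=
  ProductPlusOne.oneCoherent_trinomialCloud_wronskian_roots_le_two d e₁ e₂ he₁ he₂ a j₀ hr0 hr1 hr2 hpul hu hun hrise

/-- ★★ **COHERENT-RISING CELL, EULER CURRENCY, EVERY COUPLING** (✓ p692676, rev 27 wire): same hypotheses ⇒ … [docstring → card § «Skeleton header archive G» block G.8, rev 34] -/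
theorem oneCoherent_cloud_euler_roots_le_three {m : ℕ} (d : Fin 3 → ℕ) (e₁ e₂ : ℕ)
    (he₁ : d 1 = d 0 + e₁ + 1) (he₂ : d 2 = d 1 + e₂ + 1)
    (a : Fin m → Fin 3 → ℝ) (j₀ : Fin m) (hr0 : 0 < a j₀ 0) (hr1 : 0 < a j₀ 1) (hr2 : a j₀ 2 < 0)
    (hpul : ∀ j, j ≠ j₀ → 0 < a j 0 ∧ a j 1 ≤ 0 ∧ a j 2 ≤ 0 ∧ a j 1 + a j 2 < 0)
    (l₀ : Fin 3) {u v : ℝ} (hu : 0 < u) (huv : u ≤ v)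
    (hun : ∀ j, 0 < (fewnomial d (a j)).eval v)
    (hrise : ProductPlusOne.rowPsi1 e₁ e₂ (a j₀ 0) (-(a j₀ 1)) (-(a j₀ 2)) v < 0) :
    ((eulerNumerator d a l₀).roots.toFinset.filter (fun t => u ≤ t ∧ t ≤ v)).card ≤ 3 :=
  ProductPlusOne.oneCoherent_trinomialCloud_eulerNumerator_roots_le_three d e₁ e₂ he₁ he₂ a j₀ hr0 hr1 hr2 hpul l₀ hu huv hun hrise

/-! ### Rev 28 wiring — the MIXED-COMPANY riser cell in LINE currency (val-lit-p7 g16 ✓ p695855 `…SlopeMixedLine`) -/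

/-- ★ **W-CURRENCY MIXED-COMPANY RISER CELL** (val-lit-p7 g16 … [docstring → card § «Skeleton header archive G» block G.9, rev 34] -/
theorem oneRiser_mixed_wronskian_roots_le_two {m : ℕ} (d : Fin 3 → ℕ) (e₁ e₂ : ℕ)
    (he₁ : d 1 = d 0 + e₁ + 1) (he₂ : d 2 = d 1 + e₂ + 1)
    (a : Fin m → Fin 3 → ℝ) (j₀ : Fin m) (hr0 : 0 ≤ a j₀ 0) (hr1 : a j₀ 1 < 0) (hr2 : a j₀ 2 < 0)
    {u v : ℝ} (hu : 0 < u)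
    (hcls : ∀ j, j ≠ j₀ →
      (0 < a j 0 ∧ a j 1 ≤ 0 ∧ a j 2 ≤ 0 ∧ a j 1 + a j 2 < 0 ∧ 0 < (fewnomial d (a j)).eval v) ∨
      (0 < a j 0 ∧ 0 < a j 1 ∧ a j 2 < 0 ∧ (fewnomial d (a j)).eval u < 0))
    (hsw : ∀ x ∈ Set.Icc u v, (fewnomial d (a j₀)).eval x < 0) :
    (((∏ j, fewnomial d (a j)) * (X * derivative (X * derivative (∏ j, fewnomial d (a j))))
        - (X * derivative (∏ j, fewnomial d (a j))) ^ 2).roots.toFinset.filter (fun w => u < w ∧ w < v)).card ≤ 2 :=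
  ProductPlusOne.oneRiser_mixedCompany_wronskian_roots_le_two d e₁ e₂ he₁ he₂ a j₀ hr0 hr1 hr2 hu hcls hsw

/-- ★★ **THE MIXED-COMPANY RISER CELL IN EULER CURRENCY, EVERY COUPLING** (✓ p695855, rev 28 wiring): under the same … [docstring → card § «Skeleton header archive G» block G.10, rev 34] -/
theorem oneRiser_mixed_euler_roots_le_three {m : ℕ} (d : Fin 3 → ℕ) (e₁ e₂ : ℕ)
    (he₁ : d 1 = d 0 + e₁ + 1) (he₂ : d 2 = d 1 + e₂ + 1)
    (a : Fin m → Fin 3 → ℝ) (j₀ : Fin m) (hr0 : 0 ≤ a j₀ 0) (hr1 : a j₀ 1 < 0) (hr2 : a j₀ 2 < 0)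
    (l₀ : Fin 3) {u v : ℝ} (hu : 0 < u) (huv : u ≤ v)
    (hcls : ∀ j, j ≠ j₀ →
      (0 < a j 0 ∧ a j 1 ≤ 0 ∧ a j 2 ≤ 0 ∧ a j 1 + a j 2 < 0 ∧ 0 < (fewnomial d (a j)).eval v) ∨
      (0 < a j 0 ∧ 0 < a j 1 ∧ a j 2 < 0 ∧ (fewnomial d (a j)).eval u < 0))
    (hsw : ∀ x ∈ Set.Icc u v, (fewnomial d (a j₀)).eval x < 0) :
    ((eulerNumerator d a l₀).roots.toFinset.filter (fun t => u ≤ t ∧ t ≤ v)).card ≤ 3 :=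
  ProductPlusOne.oneRiser_mixedCompany_eulerNumerator_roots_le_three d e₁ e₂ he₁ he₂ a j₀ hr0 hr1 hr2 l₀ hu huv hcls hsw

/-! ### Rev 29 wiring — the REAL-ROOTED WINDOW LAW in LINE currency (val-lit-p5 g15 ✓ p696284 `…RealRooted`, every `K`) and the located
constant C ≥ 3 of EB2-W as a kernel fact (val-v1x-eng-11 g3 ✓ p696134 `…WronskianBudgetThree`) -/

/-- ★★ **REAL-ROOTED WINDOW LAW, inner window** (val-lit-p5 g15 … [docstring → card § «Skeleton header archive G» block G.11, rev 34] -/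
theorem realRooted_wronskian_roots_inner_le_two {m K : ℕ} (d : Fin K → ℕ) (a : Fin m → Fin K → ℝ)
    (hreal : ∀ j, Multiset.card (fewnomial d (a j)).roots = (fewnomial d (a j)).natDegree)
    {u v : ℝ} (hu0 : 0 < u) (huv : u < v) (hu : (∏ j, fewnomial d (a j)).IsRoot u) (hv : (∏ j, fewnomial d (a j)).IsRoot v)
    (hno : ∀ t, u < t → t < v → ¬ (∏ j, fewnomial d (a j)).IsRoot t) :
    (((∏ j, fewnomial d (a j)) * (X * derivative (X * derivative (∏ j, fewnomial d (a j))))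
        - (X * derivative (∏ j, fewnomial d (a j))) ^ 2).roots.toFinset.filter (fun t => u < t ∧ t < v)).card ≤ 2 :=
  ProductPlusOne.company_logWronskian_roots_inner_le_two d a hreal hu0 huv hu hv hno

/-- ★★ **REAL-ROOTED WINDOW LAW, left outer window** (✓ p696284, rev 29 wiring): rows real-rooted, `v` the least positive … [docstring → card § «Skeleton header archive G» block G.12, rev 34] -/
theorem realRooted_wronskian_roots_leftOuter_le_one {m K : ℕ} (d : Fin K → ℕ) (a : Fin m → Fin K → ℝ)
    (hreal : ∀ j, Multiset.card (fewnomial d (a j)).roots = (fewnomial d (a j)).natDegree)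
    {v : ℝ} (hv0 : 0 < v) (hv : (∏ j, fewnomial d (a j)).IsRoot v) (hno : ∀ t, 0 < t → t < v → ¬ (∏ j, fewnomial d (a j)).IsRoot t) :
    (((∏ j, fewnomial d (a j)) * (X * derivative (X * derivative (∏ j, fewnomial d (a j))))
        - (X * derivative (∏ j, fewnomial d (a j))) ^ 2).roots.toFinset.filter (fun t => 0 < t ∧ t < v)).card ≤ 1 :=
  ProductPlusOne.company_logWronskian_roots_leftOuter_le_one d a hreal hv0 hv hno

/-- ★★ **REAL-ROOTED WINDOW LAW, right outer window** (✓ p696284, rev 29 wiring): rows real-rooted, `u` the largest … [docstring → card § «Skeleton header archive G» block G.13, rev 34] -/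
theorem realRooted_wronskian_roots_rightOuter_le_one {m K : ℕ} (d : Fin K → ℕ) (a : Fin m → Fin K → ℝ)
    (hreal : ∀ j, Multiset.card (fewnomial d (a j)).roots = (fewnomial d (a j)).natDegree)
    {u : ℝ} (hu0 : 0 < u) (hu : (∏ j, fewnomial d (a j)).IsRoot u) (hno : ∀ t, u < t → ¬ (∏ j, fewnomial d (a j)).IsRoot t) :
    (((∏ j, fewnomial d (a j)) * (X * derivative (X * derivative (∏ j, fewnomial d (a j))))
        - (X * derivative (∏ j, fewnomial d (a j))) ^ 2).roots.toFinset.filter (fun t => u < t)).card ≤ 1 :=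
  ProductPlusOne.company_logWronskian_roots_rightOuter_le_one d a hreal hu0 hu hno

/-- ★ **EB2-W'S CONSTANT IS AT LEAST THREE — kernel** (val-v1x-eng-11 g3 … [docstring → card § «Skeleton header archive G» block G.14, rev 34] -/
theorem three_le_of_wronskianBudgetK3_witness (c : ℕ)
    (h : ∀ (m : ℕ) (d : Fin 3 → ℕ) (a : Fin m → Fin 3 → ℝ), d 0 < d 1 → d 1 < d 2 →
      (∀ j, ¬ (a j 0 * a j 1 < 0 ∧ a j 1 * a j 2 < 0)) →
      (((∏ j, fewnomial d (a j)) * (X * derivative (X * derivative (∏ j, fewnomial d (a j))))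
          - (X * derivative (∏ j, fewnomial d (a j))) ^ 2).roots.toFinset.filter (fun t => 0 < t)).card ≤ c * m + c) :
    3 ≤ c :=
  ProductPlusOne.WronskianBudgetThree.three_le_of_wronskianBudget c h

/-! ### Rev 30 wiring — MIXED-RATE W-cells in LINE currency … [prose → card § «Skeleton header archive E» block E3.13, rev 32] -/

/-- ★ **LATE WINDOW ≤ 1** (✓ p699759, rev 30 wiring): gap letters, window `0 < u`; every row is EITHER a switched … [docstring → card § «Skeleton header archive G» block G.15, rev 34] -/
theorem incoherent_lateWindow_wronskian_roots_le_one {m : ℕ} (d : Fin 3 → ℕ) (e₁ e₂ : ℕ)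
    (he₁ : d 1 = d 0 + e₁ + 1) (he₂ : d 2 = d 1 + e₂ + 1) (a : Fin m → Fin 3 → ℝ) {u v : ℝ} (hu : 0 < u)
    (hcls : ∀ j,
      (0 ≤ a j 0 ∧ a j 1 < 0 ∧ a j 2 < 0 ∧ (∀ x ∈ Set.Icc u v, (fewnomial d (a j)).eval x < 0) ∧
          ProductPlusOne.rowPsi1 e₁ e₂ (a j 0) (-(a j 1)) (-(a j 2)) u < 0 ∧ 0 ≤ ProductPlusOne.rowPsi2 e₁ e₂ (a j 0) (-(a j 1)) (-(a j 2)) u) ∨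
      (0 < a j 0 ∧ a j 1 ≤ 0 ∧ a j 2 ≤ 0 ∧ a j 1 + a j 2 < 0 ∧ 0 < (fewnomial d (a j)).eval v)) :
    (((∏ j, fewnomial d (a j)) * (X * derivative (X * derivative (∏ j, fewnomial d (a j))))
        - (X * derivative (∏ j, fewnomial d (a j))) ^ 2).roots.toFinset.filter (fun w => u < w ∧ w < v)).card ≤ 1 :=
  ProductPlusOne.lateWindow_wronskian_roots_le_one d e₁ e₂ he₁ he₂ a hu hcls

/-- ★ **LATE WINDOW, EULER CURRENCY ≤ 2, EVERY COUPLING** (✓ p699759, rev 30 wiring; via the crossing interlace ✓ … [docstring → card § «Skeleton header archive G» block G.16, rev 34] -/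
theorem incoherent_lateWindow_euler_roots_le_two {m : ℕ} (d : Fin 3 → ℕ) (e₁ e₂ : ℕ)
    (he₁ : d 1 = d 0 + e₁ + 1) (he₂ : d 2 = d 1 + e₂ + 1) (a : Fin m → Fin 3 → ℝ) (l₀ : Fin 3) {u v : ℝ} (hu : 0 < u) (huv : u ≤ v)
    (hcls : ∀ j,
      (0 ≤ a j 0 ∧ a j 1 < 0 ∧ a j 2 < 0 ∧ (∀ x ∈ Set.Icc u v, (fewnomial d (a j)).eval x < 0) ∧
          ProductPlusOne.rowPsi1 e₁ e₂ (a j 0) (-(a j 1)) (-(a j 2)) u < 0 ∧ 0 ≤ ProductPlusOne.rowPsi2 e₁ e₂ (a j 0) (-(a j 1)) (-(a j 2)) u) ∨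
      (0 < a j 0 ∧ a j 1 ≤ 0 ∧ a j 2 ≤ 0 ∧ a j 1 + a j 2 < 0 ∧ 0 < (fewnomial d (a j)).eval v)) :
    ((eulerNumerator d a l₀).roots.toFinset.filter (fun t => u ≤ t ∧ t ≤ v)).card ≤ 2 :=
  ProductPlusOne.lateWindow_eulerNumerator_roots_le_two d e₁ e₂ he₁ he₂ a l₀ hu huv hcls

/-- ★ **EARLY WINDOW ≤ 1** (✓ p699759, rev 30 wiring): every row a switched incoherent riser still before its turning … [docstring → card § «Skeleton header archive G» block G.17, rev 34] -/
theorem incoherent_earlyWindow_wronskian_roots_le_one {m : ℕ} (d : Fin 3 → ℕ) (e₁ e₂ : ℕ)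
    (he₁ : d 1 = d 0 + e₁ + 1) (he₂ : d 2 = d 1 + e₂ + 1) (a : Fin m → Fin 3 → ℝ) {u v : ℝ} (hu : 0 < u)
    (hcls : ∀ j, 0 ≤ a j 0 ∧ a j 1 < 0 ∧ a j 2 < 0 ∧ (∀ x ∈ Set.Icc u v, (fewnomial d (a j)).eval x < 0) ∧
      ProductPlusOne.rowPsi2 e₁ e₂ (a j 0) (-(a j 1)) (-(a j 2)) v ≤ 0) :
    (((∏ j, fewnomial d (a j)) * (X * derivative (X * derivative (∏ j, fewnomial d (a j))))
        - (X * derivative (∏ j, fewnomial d (a j))) ^ 2).roots.toFinset.filter (fun w => u < w ∧ w < v)).card ≤ 1 :=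
  ProductPlusOne.earlyWindow_wronskian_roots_le_one d e₁ e₂ he₁ he₂ a hu hcls

/-- ★ **EARLY WINDOW, EULER CURRENCY ≤ 2, EVERY COUPLING** (✓ p699759, rev 30 wiring).  closes NO stub; in NO head's cone. … [docstring → card § «Skeleton header archive G» block G.18, rev 34] -/
theorem incoherent_earlyWindow_euler_roots_le_two {m : ℕ} (d : Fin 3 → ℕ) (e₁ e₂ : ℕ)
    (he₁ : d 1 = d 0 + e₁ + 1) (he₂ : d 2 = d 1 + e₂ + 1) (a : Fin m → Fin 3 → ℝ) (l₀ : Fin 3) {u v : ℝ} (hu : 0 < u)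
    (hcls : ∀ j, 0 ≤ a j 0 ∧ a j 1 < 0 ∧ a j 2 < 0 ∧ (∀ x ∈ Set.Icc u v, (fewnomial d (a j)).eval x < 0) ∧
      ProductPlusOne.rowPsi2 e₁ e₂ (a j 0) (-(a j 1)) (-(a j 2)) v ≤ 0) :
    ((eulerNumerator d a l₀).roots.toFinset.filter (fun t => u ≤ t ∧ t ≤ v)).card ≤ 2 :=
  ProductPlusOne.earlyWindow_eulerNumerator_roots_le_two d e₁ e₂ he₁ he₂ a l₀ hu hcls

/-- ★★ **ONE RISER OVER A MIXED-RATE BACKGROUND ≤ 2** (✓ p700041, rev 30 wiring; kernel `hump_poleCloud_no_three_zeros`: … [docstring → card § «Skeleton header archive G» block G.19, rev 34] -/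
theorem oneRiser_background_wronskian_roots_le_two {m : ℕ} (d : Fin 3 → ℕ) (e₁ e₂ : ℕ)
    (he₁ : d 1 = d 0 + e₁ + 1) (he₂ : d 2 = d 1 + e₂ + 1)
    (a : Fin m → Fin 3 → ℝ) (j₀ : Fin m) (hr0 : 0 ≤ a j₀ 0) (hr1 : a j₀ 1 < 0) (hr2 : a j₀ 2 < 0)
    {u v : ℝ} (hu : 0 < u)
    (hcls : ∀ j, j ≠ j₀ →
      (0 < a j 0 ∧ a j 1 ≤ 0 ∧ a j 2 ≤ 0 ∧ a j 1 + a j 2 < 0 ∧ 0 < (fewnomial d (a j)).eval v) ∨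
      (0 < a j 0 ∧ 0 < a j 1 ∧ a j 2 < 0 ∧ (fewnomial d (a j)).eval u < 0) ∨
      (0 < a j 0 ∧ a j 1 ≤ 0 ∧ a j 2 ≤ 0 ∧ a j 1 * a j 2 = 0 ∧ a j 1 + a j 2 < 0 ∧ (fewnomial d (a j)).eval u < 0))
    (hsw : ∀ x ∈ Set.Icc u v, (fewnomial d (a j₀)).eval x < 0) :
    (((∏ j, fewnomial d (a j)) * (X * derivative (X * derivative (∏ j, fewnomial d (a j))))
        - (X * derivative (∏ j, fewnomial d (a j))) ^ 2).roots.toFinset.filter (fun w => u < w ∧ w < v)).card ≤ 2 :=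
  ProductPlusOne.oneRiser_poleCompany_wronskian_roots_le_two d e₁ e₂ he₁ he₂ a j₀ hr0 hr1 hr2 hu hcls hsw

/-- ★★ **THE SAME CELL IN EULER CURRENCY ≤ 3, EVERY COUPLING** (✓ p700041, rev 30 wiring).  closes NO stub; in NO head's … [docstring → card § «Skeleton header archive G» block G.20, rev 34] -/
theorem oneRiser_background_euler_roots_le_three {m : ℕ} (d : Fin 3 → ℕ) (e₁ e₂ : ℕ)
    (he₁ : d 1 = d 0 + e₁ + 1) (he₂ : d 2 = d 1 + e₂ + 1)
    (a : Fin m → Fin 3 → ℝ) (j₀ : Fin m) (hr0 : 0 ≤ a j₀ 0) (hr1 : a j₀ 1 < 0) (hr2 : a j₀ 2 < 0)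
    (l₀ : Fin 3) {u v : ℝ} (hu : 0 < u) (huv : u ≤ v)
    (hcls : ∀ j, j ≠ j₀ →
      (0 < a j 0 ∧ a j 1 ≤ 0 ∧ a j 2 ≤ 0 ∧ a j 1 + a j 2 < 0 ∧ 0 < (fewnomial d (a j)).eval v) ∨
      (0 < a j 0 ∧ 0 < a j 1 ∧ a j 2 < 0 ∧ (fewnomial d (a j)).eval u < 0) ∨
      (0 < a j 0 ∧ a j 1 ≤ 0 ∧ a j 2 ≤ 0 ∧ a j 1 * a j 2 = 0 ∧ a j 1 + a j 2 < 0 ∧ (fewnomial d (a j)).eval u < 0))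
    (hsw : ∀ x ∈ Set.Icc u v, (fewnomial d (a j₀)).eval x < 0) :
    ((eulerNumerator d a l₀).roots.toFinset.filter (fun t => u ≤ t ∧ t ≤ v)).card ≤ 3 :=
  ProductPlusOne.oneRiser_poleCompany_eulerNumerator_roots_le_three d e₁ e₂ he₁ he₂ a j₀ hr0 hr1 hr2 l₀ hu huv hcls hsw

/-! ### Rev 31 wiring — W-CB cells with `K^> = 0` in LINE currency, and the W∘W identity … [prose → card § «Skeleton header archive E» block E3.14, rev 32] -/

/-- ★ **THE PURE BACKGROUND CELL = 0** (W2 ✓ p701266, rev 31 wiring; memo §21 `BackgroundCellK3`): gap letters, window … [docstring → card § «Skeleton header archive G» block G.21, rev 34] -/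
theorem backgroundCell_wronskian_roots_eq_zero {m : ℕ} (d : Fin 3 → ℕ) (e₁ e₂ : ℕ)
    (he₁ : d 1 = d 0 + e₁ + 1) (he₂ : d 2 = d 1 + e₂ + 1) (a : Fin m → Fin 3 → ℝ) {u v : ℝ} (hu : 0 < u)
    (hrow : ∀ j, ((((a j 2 = 0 ∧ a j 0 * a j 1 < 0) ∨ (a j 0 = 0 ∧ a j 1 * a j 2 < 0) ∨ (a j 1 = 0 ∧ a j 0 * a j 2 < 0)) ∧
          0 < (fewnomial d (a j)).eval u * (fewnomial d (a j)).eval v) ∨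
        (0 < a j 0 ∧ a j 1 ≤ 0 ∧ a j 2 ≤ 0 ∧ a j 1 + a j 2 < 0 ∧ 0 < (fewnomial d (a j)).eval v) ∨
        (0 < a j 0 ∧ 0 < a j 1 ∧ a j 2 < 0 ∧ (fewnomial d (a j)).eval u < 0))) :
    (((∏ j, fewnomial d (a j)) * (X * derivative (X * derivative (∏ j, fewnomial d (a j))))
        - (X * derivative (∏ j, fewnomial d (a j))) ^ 2).roots.toFinset.filter (fun t => u < t ∧ t < v)).card = 0 :=
  ProductPlusOne.background_logWronskian_roots_eq_zero_gaps d e₁ e₂ he₁ he₂ a hu hrow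

/-- ★★ **THE SLOW-KNEE CLOUD CELL ≤ 2** (#18b ✓ p700813, rev 31 wiring; memo §19 `SlowKneeCloudCellK3` = E4, the … [docstring → card § «Skeleton header archive G» block G.22, rev 34] -/
theorem slowKneeCloudCell_wronskian_roots_le_two {m : ℕ} (d : Fin 3 → ℕ) (h01 : d 0 < d 1) (h12 : d 1 < d 2)
    (hgap : d 1 - d 0 ≤ d 2 - d 1) (a : Fin m → Fin 3 → ℝ) {u v : ℝ} (hu : 0 < u)
    (hrow : ∀ j, (0 < a j 0 ∧ 0 < a j 1 ∧ a j 2 = 0) ∨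
      (0 < a j 0 ∧ a j 1 < 0 ∧ a j 2 = 0 ∧ (fewnomial d (a j)).eval u ≤ 0) ∨
      (0 < a j 0 ∧ a j 1 ≤ 0 ∧ a j 2 ≤ 0 ∧ a j 1 + a j 2 < 0 ∧ 0 < (fewnomial d (a j)).eval v))
    (hex : ∃ j, a j 1 < 0 ∧ a j 2 = 0 ∧ (fewnomial d (a j)).eval u ≤ 0) :
    (((∏ j, fewnomial d (a j)) * (X * derivative (X * derivative (∏ j, fewnomial d (a j))))
        - (X * derivative (∏ j, fewnomial d (a j))) ^ 2).roots.toFinset.filter (fun t => u < t ∧ t < v)).card ≤ 2 :=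
  ProductPlusOne.slowKneeCloud_wronskian_roots_le_two d h01 h12 hgap a hu hrow hex

/-- ★ **THE W∘W IDENTITY on a `K = 3` row** (W1 ✓ p701240, rev 31 wiring; memo §21 `WWIdentity`): for … [docstring → card § «Skeleton header archive G» block G.23, rev 34] -/
theorem thetaW_thetaW_fewnomial_three (d : Fin 3 → ℕ) (a : Fin 3 → ℝ) :
    ((fewnomial d a) * (X * derivative (X * derivative (fewnomial d a))) - (X * derivative (fewnomial d a)) ^ 2) *
          (X * derivative (X * derivative
            ((fewnomial d a) * (X * derivative (X * derivative (fewnomial d a))) - (X * derivative (fewnomial d a)) ^ 2)))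
        - (X * derivative
            ((fewnomial d a) * (X * derivative (X * derivative (fewnomial d a))) - (X * derivative (fewnomial d a)) ^ 2)) ^ 2
      = C ((((d 1 : ℝ) - d 0) * ((d 2 : ℝ) - d 0) * ((d 2 : ℝ) - d 1)) ^ 2 * (a 0 * a 1 * a 2)) * X ^ (d 0 + d 1 + d 2) *
          fewnomial d a := by
  have hg : fewnomial d a = C (a 0) * X ^ (d 0) + C (a 1) * X ^ (d 1) + C (a 2) * X ^ (d 2) := by
    simp only [fewnomial, Fin.sum_univ_three]
  rw [hg]
  exact ProductPlusOne.thetaW_thetaW_trinomial (a 0) (a 1) (a 2) (d 0) (d 1) (d 2)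

/-! ### Rev 32 wiring — the FAST/SLOW-KNEE W-CB CELLS of record in LINE currency (rate-free slow-knee cell #20b/#20c, fast-knee shell, (NEG1″) one-bump cell; owner memos §21–§24) … [prose → card § «Skeleton header archive J» block J.1, rev 38] -/

/-- ★★ **THE RATE-FREE SLOW-KNEE CELL ≤ 2** (#20b ✓ p703728, rev 32 wiring; memo §21/§23 `SlowKneeCellK3` without gap … [docstring → card § «Skeleton header archive H» block H.1, rev 35] -/
theorem slowKneeRateFreeCell_wronskian_roots_le_two {m : ℕ} (d : Fin 3 → ℕ) (h01 : d 0 < d 1) (h12 : d 1 < d 2)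
    (a : Fin m → Fin 3 → ℝ) {u v : ℝ} (hu : 0 < u)
    (hrow : ∀ j,
      (a j 2 = 0 ∧ a j 0 ≠ 0 ∧ a j 1 ≠ 0 ∧ 0 ≤ (fewnomial d (a j)).eval u * (fewnomial d (a j)).eval v) ∨
      (a j 1 = 0 ∧ a j 0 * a j 2 < 0 ∧ 0 ≤ (fewnomial d (a j)).eval u * (fewnomial d (a j)).eval v) ∨
      (a j 0 = 0 ∧ a j 1 * a j 2 < 0 ∧ d 1 - d 0 ≤ d 2 - d 1 ∧ 0 ≤ (fewnomial d (a j)).eval u * (fewnomial d (a j)).eval v) ∨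
      (a j 0 = 0 ∧ 0 < a j 1 * a j 2 ∧ d 2 - d 1 ≤ d 1 - d 0) ∨
      (0 < a j 0 ∧ a j 1 ≤ 0 ∧ a j 2 ≤ 0 ∧ a j 1 + a j 2 < 0 ∧ 0 < (fewnomial d (a j)).eval v)) :
    (((∏ j, fewnomial d (a j)) * (X * derivative (X * derivative (∏ j, fewnomial d (a j))))
        - (X * derivative (∏ j, fewnomial d (a j))) ^ 2).roots.toFinset.filter (fun t => u < t ∧ t < v)).card ≤ 2 :=
  ProductPlusOne.slowKneeCellRateFree_wronskian_roots_le_two d h01 h12 a hu hrow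

/-- ★★ **THE RATE-FREE SLOW-KNEE CELL, Euler currency ≤ 3 at EVERY coupling** (#20c ✓ p703935, rev 32 wiring): the same … [docstring → card § «Skeleton header archive H» block H.2, rev 35] -/
theorem slowKneeRateFreeCell_euler_roots_le_three {m : ℕ} (d : Fin 3 → ℕ) (h01 : d 0 < d 1) (h12 : d 1 < d 2)
    (a : Fin m → Fin 3 → ℝ) (l₀ : Fin 3) {u v : ℝ} (hu : 0 < u)
    (hrow : ∀ j,
      (a j 2 = 0 ∧ a j 0 ≠ 0 ∧ a j 1 ≠ 0 ∧ 0 ≤ (fewnomial d (a j)).eval u * (fewnomial d (a j)).eval v) ∨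
      (a j 1 = 0 ∧ a j 0 * a j 2 < 0 ∧ 0 ≤ (fewnomial d (a j)).eval u * (fewnomial d (a j)).eval v) ∨
      (a j 0 = 0 ∧ a j 1 * a j 2 < 0 ∧ d 1 - d 0 ≤ d 2 - d 1 ∧ 0 ≤ (fewnomial d (a j)).eval u * (fewnomial d (a j)).eval v) ∨
      (a j 0 = 0 ∧ 0 < a j 1 * a j 2 ∧ d 2 - d 1 ≤ d 1 - d 0) ∨
      (0 < a j 0 ∧ a j 1 ≤ 0 ∧ a j 2 ≤ 0 ∧ a j 1 + a j 2 < 0 ∧ 0 < (fewnomial d (a j)).eval v)) :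
    ((eulerNumerator d a l₀).roots.toFinset.filter (fun t => u < t ∧ t < v)).card ≤ 3 :=
  ProductPlusOne.slowKneeCellRateFree_eulerNumerator_roots_le_three d h01 h12 a l₀ hu hrow

/-- ★★ **THE MIXED-RATE ONE-BUMP CELL ≤ 2** (#3c ✓ p703889, rev 32 wiring; memo §21.2 `MixedRateOneBumpCellK3`; kernel ★★ … [docstring → card § «Skeleton header archive H» block H.3, rev 35] -/
theorem oneBumpCell_wronskian_roots_le_two {m : ℕ} (d : Fin 3 → ℕ) (e₁ e₂ : ℕ)
    (he₁ : d 1 = d 0 + e₁ + 1) (he₂ : d 2 = d 1 + e₂ + 1) (a : Fin m → Fin 3 → ℝ) (j₀ : Fin m) {u v : ℝ} (hu : 0 < u)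
    (hbump : (a j₀ 2 = 0 ∧ 0 < a j₀ 0 * a j₀ 1) ∨ (a j₀ 0 = 0 ∧ 0 < a j₀ 1 * a j₀ 2) ∨ (a j₀ 1 = 0 ∧ 0 < a j₀ 0 * a j₀ 2) ∨
      (0 < a j₀ 0 ∧ a j₀ 1 < 0 ∧ a j₀ 2 < 0 ∧ (fewnomial d (a j₀)).eval u < 0) ∨
      (0 < a j₀ 0 ∧ 0 < a j₀ 1 ∧ a j₀ 2 < 0 ∧ 0 < (fewnomial d (a j₀)).eval v))
    (hbg : ∀ j, j ≠ j₀ →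
      (((a j 2 = 0 ∧ a j 0 * a j 1 < 0) ∨ (a j 0 = 0 ∧ a j 1 * a j 2 < 0) ∨ (a j 1 = 0 ∧ a j 0 * a j 2 < 0)) ∧
          0 < (fewnomial d (a j)).eval u * (fewnomial d (a j)).eval v) ∨
      (0 < a j 0 ∧ a j 1 ≤ 0 ∧ a j 2 ≤ 0 ∧ a j 1 + a j 2 < 0 ∧ 0 < (fewnomial d (a j)).eval v) ∨
      (0 < a j 0 ∧ 0 < a j 1 ∧ a j 2 < 0 ∧ (fewnomial d (a j)).eval u < 0)) :
    (((∏ j, fewnomial d (a j)) * (X * derivative (X * derivative (∏ j, fewnomial d (a j))))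
        - (X * derivative (∏ j, fewnomial d (a j))) ^ 2).roots.toFinset.filter (fun t => u < t ∧ t < v)).card ≤ 2 :=
  ProductPlusOne.oneBump_company_wronskian_roots_le_two d e₁ e₂ he₁ he₂ a j₀ hu hbump hbg

/-- ★★ **THE MIXED-RATE ONE-BUMP CELL, Euler currency ≤ 3 at EVERY coupling** (#3c ✓ p703889, rev 32 wiring): the same … [docstring → card § «Skeleton header archive H» block H.4, rev 35] -/
theorem oneBumpCell_euler_roots_le_three {m : ℕ} (d : Fin 3 → ℕ) (e₁ e₂ : ℕ)
    (he₁ : d 1 = d 0 + e₁ + 1) (he₂ : d 2 = d 1 + e₂ + 1) (a : Fin m → Fin 3 → ℝ) (j₀ : Fin m) (l₀ : Fin 3) {u v : ℝ} (hu : 0 < u)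
    (huv : u ≤ v)
    (hbump : (a j₀ 2 = 0 ∧ 0 < a j₀ 0 * a j₀ 1) ∨ (a j₀ 0 = 0 ∧ 0 < a j₀ 1 * a j₀ 2) ∨ (a j₀ 1 = 0 ∧ 0 < a j₀ 0 * a j₀ 2) ∨
      (0 < a j₀ 0 ∧ a j₀ 1 < 0 ∧ a j₀ 2 < 0 ∧ (fewnomial d (a j₀)).eval u < 0) ∨
      (0 < a j₀ 0 ∧ 0 < a j₀ 1 ∧ a j₀ 2 < 0 ∧ 0 < (fewnomial d (a j₀)).eval v))
    (hbg : ∀ j, j ≠ j₀ →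
      (((a j 2 = 0 ∧ a j 0 * a j 1 < 0) ∨ (a j 0 = 0 ∧ a j 1 * a j 2 < 0) ∨ (a j 1 = 0 ∧ a j 0 * a j 2 < 0)) ∧
          0 < (fewnomial d (a j)).eval u * (fewnomial d (a j)).eval v) ∨
      (0 < a j 0 ∧ a j 1 ≤ 0 ∧ a j 2 ≤ 0 ∧ a j 1 + a j 2 < 0 ∧ 0 < (fewnomial d (a j)).eval v) ∨
      (0 < a j 0 ∧ 0 < a j 1 ∧ a j 2 < 0 ∧ (fewnomial d (a j)).eval u < 0)) :
    ((eulerNumerator d a l₀).roots.toFinset.filter (fun t => u ≤ t ∧ t ≤ v)).card ≤ 3 :=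
  ProductPlusOne.oneBump_company_eulerNumerator_roots_le_three d e₁ e₂ he₁ he₂ a j₀ l₀ hu huv hbump hbg

/-- ★★ **THE OUTER-KNEES CELL ≤ 1** (#4 ✓ p703690, rev 32 wiring; memo §22 phase cells with knees): gap letters, window … [docstring → card § «Skeleton header archive H» block H.5, rev 35] -/
theorem outerKneesCell_wronskian_roots_le_one {m : ℕ} (d : Fin 3 → ℕ) (e₁ e₂ : ℕ)
    (he₁ : d 1 = d 0 + e₁ + 1) (he₂ : d 2 = d 1 + e₂ + 1) (a : Fin m → Fin 3 → ℝ) {u v : ℝ} (hu : 0 < u)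
    (hcls : ∀ j,
      (a j 0 = 0 ∧ 0 < a j 1 * a j 2) ∨
      (a j 0 = 0 ∧ a j 1 * a j 2 < 0 ∧ 0 < a j 2 * (fewnomial d (a j)).eval u) ∨
      (a j 1 = 0 ∧ a j 0 * a j 2 < 0 ∧ 0 < a j 2 * (fewnomial d (a j)).eval u) ∨
      (e₂ ≤ e₁ ∧ a j 2 = 0 ∧ a j 0 * a j 1 < 0 ∧ 0 < a j 1 * (fewnomial d (a j)).eval u)) :
    (((∏ j, fewnomial d (a j)) * (X * derivative (X * derivative (∏ j, fewnomial d (a j))))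
        - (X * derivative (∏ j, fewnomial d (a j))) ^ 2).roots.toFinset.filter (fun t => u < t ∧ t < v)).card ≤ 1 :=
  ProductPlusOne.outerKnees_wronskian_roots_le_one d e₁ e₂ he₁ he₂ a hu hcls

/-- ★★ **THE OUTER-KNEES CELL, Euler currency ≤ 2 at EVERY coupling** (#4 ✓ p703690, rev 32 wiring): the same menu ⇒ … [docstring → card § «Skeleton header archive H» block H.6, rev 35] -/
theorem outerKneesCell_euler_roots_le_two {m : ℕ} (d : Fin 3 → ℕ) (e₁ e₂ : ℕ)
    (he₁ : d 1 = d 0 + e₁ + 1) (he₂ : d 2 = d 1 + e₂ + 1) (a : Fin m → Fin 3 → ℝ) (l₀ : Fin 3) {u v : ℝ} (hu : 0 < u)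
    (hcls : ∀ j,
      (a j 0 = 0 ∧ 0 < a j 1 * a j 2) ∨
      (a j 0 = 0 ∧ a j 1 * a j 2 < 0 ∧ 0 < a j 2 * (fewnomial d (a j)).eval u) ∨
      (a j 1 = 0 ∧ a j 0 * a j 2 < 0 ∧ 0 < a j 2 * (fewnomial d (a j)).eval u) ∨
      (e₂ ≤ e₁ ∧ a j 2 = 0 ∧ a j 0 * a j 1 < 0 ∧ 0 < a j 1 * (fewnomial d (a j)).eval u)) :
    ((eulerNumerator d a l₀).roots.toFinset.filter (fun t => u ≤ t ∧ t ≤ v)).card ≤ 2 :=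
  ProductPlusOne.outerKnees_eulerNumerator_roots_le_two d e₁ e₂ he₁ he₂ a l₀ hu hcls

/-- ★★ **THE FORWARD-POLES CELL ≤ 1** (#5 ✓ p703754, rev 32 wiring; mirror of the outer-knees cell): gap letters, window … [docstring → card § «Skeleton header archive H» block H.7, rev 35] -/
theorem forwardPolesCell_wronskian_roots_le_one {m : ℕ} (d : Fin 3 → ℕ) (e₁ e₂ : ℕ)
    (he₁ : d 1 = d 0 + e₁ + 1) (he₂ : d 2 = d 1 + e₂ + 1) (a : Fin m → Fin 3 → ℝ) {u v : ℝ} (hu : 0 < u) (huv : u ≤ v)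
    (hcls : ∀ j,
      (a j 0 = 0 ∧ 0 < a j 1 * a j 2) ∨
      (a j 0 = 0 ∧ a j 1 * a j 2 < 0 ∧ 0 < a j 1 * (fewnomial d (a j)).eval v) ∨
      (a j 1 = 0 ∧ a j 0 * a j 2 < 0 ∧ 0 < a j 0 * (fewnomial d (a j)).eval v) ∨
      (e₂ ≤ e₁ ∧ a j 2 = 0 ∧ a j 0 * a j 1 < 0 ∧ 0 < a j 0 * (fewnomial d (a j)).eval v)) :
    (((∏ j, fewnomial d (a j)) * (X * derivative (X * derivative (∏ j, fewnomial d (a j))))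
        - (X * derivative (∏ j, fewnomial d (a j))) ^ 2).roots.toFinset.filter (fun t => u < t ∧ t < v)).card ≤ 1 :=
  ProductPlusOne.forwardPoles_wronskian_roots_le_one d e₁ e₂ he₁ he₂ a hu huv hcls

/-- ★★ **THE FORWARD-POLES CELL, Euler currency ≤ 2 at EVERY coupling** (#5 ✓ p703754, rev 32 wiring): the same menu ⇒ … [docstring → card § «Skeleton header archive H» block H.8, rev 35] -/
theorem forwardPolesCell_euler_roots_le_two {m : ℕ} (d : Fin 3 → ℕ) (e₁ e₂ : ℕ)
    (he₁ : d 1 = d 0 + e₁ + 1) (he₂ : d 2 = d 1 + e₂ + 1) (a : Fin m → Fin 3 → ℝ) (l₀ : Fin 3) {u v : ℝ} (hu : 0 < u) (huv : u ≤ v)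
    (hcls : ∀ j,
      (a j 0 = 0 ∧ 0 < a j 1 * a j 2) ∨
      (a j 0 = 0 ∧ a j 1 * a j 2 < 0 ∧ 0 < a j 1 * (fewnomial d (a j)).eval v) ∨
      (a j 1 = 0 ∧ a j 0 * a j 2 < 0 ∧ 0 < a j 0 * (fewnomial d (a j)).eval v) ∨
      (e₂ ≤ e₁ ∧ a j 2 = 0 ∧ a j 0 * a j 1 < 0 ∧ 0 < a j 0 * (fewnomial d (a j)).eval v)) :
    ((eulerNumerator d a l₀).roots.toFinset.filter (fun t => u ≤ t ∧ t ≤ v)).card ≤ 2 :=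
  ProductPlusOne.forwardPoles_eulerNumerator_roots_le_two d e₁ e₂ he₁ he₂ a l₀ hu huv hcls

/-- ★ **B-SHARP2 — THE {SLOW, FAST} WINDOW ATTAINS FOUR** (✓ p702354, val-lit-p3 g19, rev 32 wiring; memo §22.3): … [docstring → card § «Skeleton header archive H» block H.9, rev 35] -/
theorem wronskianSharpTwoBump_slowFast_four_zeros_K3 :
    ∃ x₁ x₂ x₃ x₄ : ℝ, 1 / 50 < x₁ ∧ x₁ < x₂ ∧ x₂ < x₃ ∧ x₃ < x₄ ∧ x₄ < 10000 ∧
      ∀ x ∈ ({x₁, x₂, x₃, x₄} : Set ℝ),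
        ((∏ j, fewnomial (![0, 1, 6] : Fin 3 → ℕ) ((![![(1 : ℝ), -100, 0], ![1, 10, 0], ![1, 0, 1 / 10 ^ 19], ![1, -1 / 10 ^ 5, 0]] : Fin 4 → Fin 3 → ℝ) j))
            * (X * derivative (X * derivative (∏ j, fewnomial (![0, 1, 6] : Fin 3 → ℕ)
                ((![![(1 : ℝ), -100, 0], ![1, 10, 0], ![1, 0, 1 / 10 ^ 19], ![1, -1 / 10 ^ 5, 0]] : Fin 4 → Fin 3 → ℝ) j))))
          - (X * derivative (∏ j, fewnomial (![0, 1, 6] : Fin 3 → ℕ)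
                ((![![(1 : ℝ), -100, 0], ![1, 10, 0], ![1, 0, 1 / 10 ^ 19], ![1, -1 / 10 ^ 5, 0]] : Fin 4 → Fin 3 → ℝ) j))) ^ 2).eval x = 0 :=
  ProductPlusOne.wronskianSharpTwoBump_slowFast_four_zeros

/-- ★ **B-SHARP2 — TWO FAST KNEES OF DIFFERENT RATES ATTAIN FOUR** (✓ p702354, rev 32 wiring): `d = (0,1,6)`, rows … [docstring → card § «Skeleton header archive H» block H.10, rev 35] -/
theorem wronskianSharpTwoBump_fastFast_four_zeros_K3 :
    ∃ x₁ x₂ x₃ x₄ : ℝ, 1 / 1000 < x₁ ∧ x₁ < x₂ ∧ x₂ < x₃ ∧ x₃ < x₄ ∧ x₄ < 1000 ∧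
      ∀ x ∈ ({x₁, x₂, x₃, x₄} : Set ℝ),
        ((∏ j, fewnomial (![0, 1, 6] : Fin 3 → ℕ) ((![![(1 : ℝ), 0, 1 / 10], ![0, 1, 1 / 10 ^ 10], ![1, -1 / 10 ^ 4, 0]] : Fin 3 → Fin 3 → ℝ) j))
            * (X * derivative (X * derivative (∏ j, fewnomial (![0, 1, 6] : Fin 3 → ℕ)
                ((![![(1 : ℝ), 0, 1 / 10], ![0, 1, 1 / 10 ^ 10], ![1, -1 / 10 ^ 4, 0]] : Fin 3 → Fin 3 → ℝ) j))))
          - (X * derivative (∏ j, fewnomial (![0, 1, 6] : Fin 3 → ℕ)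
                ((![![(1 : ℝ), 0, 1 / 10], ![0, 1, 1 / 10 ^ 10], ![1, -1 / 10 ^ 4, 0]] : Fin 3 → Fin 3 → ℝ) j))) ^ 2).eval x = 0 :=
  ProductPlusOne.wronskianSharpTwoBump_fastFast_four_zeros

/-! ### Rev 33 wiring — the `K_trop = 0` EULER TWIN and the B-SHARP3 member in LINE currency (owner memos §21 / §23 / §25) … [prose → card § «Skeleton header archive J» block J.2, rev 38] -/

/-- ★ **THE PURE BACKGROUND CELL — EULER TWIN ≤ 1, CLOSED WINDOW** (W2-E ✓ p704433, rev 33 wiring; memo §21 … [docstring → card § «Skeleton header archive H» block H.11, rev 35] -/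
theorem backgroundCell_euler_roots_Icc_le_one {m : ℕ} (d : Fin 3 → ℕ) (h01 : d 0 < d 1) (h12 : d 1 < d 2)
    (a : Fin m → Fin 3 → ℝ) (l₀ : Fin 3) {u v : ℝ} (hu : 0 < u)
    (hrow : ∀ j, ((((a j 2 = 0 ∧ a j 0 * a j 1 < 0) ∨ (a j 0 = 0 ∧ a j 1 * a j 2 < 0) ∨ (a j 1 = 0 ∧ a j 0 * a j 2 < 0)) ∧
          0 < (fewnomial d (a j)).eval u * (fewnomial d (a j)).eval v) ∨
        (0 < a j 0 ∧ a j 1 ≤ 0 ∧ a j 2 ≤ 0 ∧ a j 1 + a j 2 < 0 ∧ 0 < (fewnomial d (a j)).eval v) ∨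
        (0 < a j 0 ∧ 0 < a j 1 ∧ a j 2 < 0 ∧ (fewnomial d (a j)).eval u < 0))) :
    ((eulerNumerator d a l₀).roots.toFinset.filter (fun t => u ≤ t ∧ t ≤ v)).card ≤ 1 :=
  ProductPlusOne.backgroundCell_eulerNumerator_roots_Icc_le_one d h01 h12 a l₀ hu hrow

/-- **THE PURE BACKGROUND CELL — EULER TWIN ≤ 1, OPEN WINDOW, GAP LETTERS** (W2-E ✓ p704433, rev 33 wiring): the same … [docstring → card § «Skeleton header archive H» block H.12, rev 35] -/
theorem backgroundCell_euler_roots_le_one_gaps {m : ℕ} (d : Fin 3 → ℕ) (e₁ e₂ : ℕ)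
    (he₁ : d 1 = d 0 + e₁ + 1) (he₂ : d 2 = d 1 + e₂ + 1) (a : Fin m → Fin 3 → ℝ) (l₀ : Fin 3) {u v : ℝ} (hu : 0 < u)
    (hrow : ∀ j, ((((a j 2 = 0 ∧ a j 0 * a j 1 < 0) ∨ (a j 0 = 0 ∧ a j 1 * a j 2 < 0) ∨ (a j 1 = 0 ∧ a j 0 * a j 2 < 0)) ∧
          0 < (fewnomial d (a j)).eval u * (fewnomial d (a j)).eval v) ∨
        (0 < a j 0 ∧ a j 1 ≤ 0 ∧ a j 2 ≤ 0 ∧ a j 1 + a j 2 < 0 ∧ 0 < (fewnomial d (a j)).eval v) ∨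
        (0 < a j 0 ∧ 0 < a j 1 ∧ a j 2 < 0 ∧ (fewnomial d (a j)).eval u < 0))) :
    ((eulerNumerator d a l₀).roots.toFinset.filter (fun t => u < t ∧ t < v)).card ≤ 1 :=
  ProductPlusOne.backgroundCell_eulerNumerator_roots_le_one_gaps d e₁ e₂ he₁ he₂ a l₀ hu hrow

/-- ★ **B-SHARP3 MEMBER: SIX ZEROS IN ONE WINDOW** (✓ p704431, rev 33 wiring; located law `min(2N, 2 + 2F)` of record at … [docstring → card § «Skeleton header archive H» block H.13, rev 35] -/
theorem wronskianSharpThreeBump_six_zeros_K3 :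
    ∃ x₁ x₂ x₃ x₄ x₅ x₆ : ℝ, 1 / 5000 < x₁ ∧ x₁ < x₂ ∧ x₂ < x₃ ∧ x₃ < x₄ ∧ x₄ < x₅ ∧ x₅ < x₆ ∧ x₆ < 5000 ∧
      ∀ x ∈ ({x₁, x₂, x₃, x₄, x₅, x₆} : Set ℝ),
        ((∏ j, fewnomial (![0, 1, 6] : Fin 3 → ℕ)
              ((![![(1 : ℝ), -10 ^ 4, 0], ![1, 1, 0], ![0, 1 / 10 ^ 15, 1], ![1, 0, 1 / 10 ^ 18], ![1, -1 / 10 ^ 4, 0]] : Fin 5 → Fin 3 → ℝ) j))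
            * (X * derivative (X * derivative (∏ j, fewnomial (![0, 1, 6] : Fin 3 → ℕ)
                ((![![(1 : ℝ), -10 ^ 4, 0], ![1, 1, 0], ![0, 1 / 10 ^ 15, 1], ![1, 0, 1 / 10 ^ 18], ![1, -1 / 10 ^ 4, 0]] : Fin 5 → Fin 3 → ℝ) j))))
          - (X * derivative (∏ j, fewnomial (![0, 1, 6] : Fin 3 → ℕ)
                ((![![(1 : ℝ), -10 ^ 4, 0], ![1, 1, 0], ![0, 1 / 10 ^ 15, 1], ![1, 0, 1 / 10 ^ 18], ![1, -1 / 10 ^ 4, 0]] : Fin 5 → Fin 3 → ℝ) j))) ^ 2).eval x = 0 :=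
  ProductPlusOne.wronskianSharpThreeBump_six_zeros

/-! ### Rev 34 wiring — brick G (val-lit-p7 g18): the FIRST GLOBAL, WINDOW-FREE sub-class counts of `WronskianBudgetK3` (EB2-W) in LINE currency … [prose → card § «Skeleton header archive J» block J.3, rev 38] -/

/-- ★★ EB2-W slow-knee binomial class `Z₊(W) ≤ 3m+2` (G-1 ✓ p706565, rev 34) … [prose → card § «Skeleton header archive K» block K.5, rev 39]; closes NO stub. -/
theorem slowKneeBinomialClass_wronskian_card_le {m : ℕ} (d : Fin 3 → ℕ) (a : Fin m → Fin 3 → ℝ) (h01 : d 0 < d 1) (h12 : d 1 < d 2)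
    (hrow : ∀ j, (a j 2 = 0 ∧ a j 0 ≠ 0 ∧ a j 1 ≠ 0) ∨ (a j 1 = 0 ∧ a j 0 * a j 2 < 0) ∨
      (a j 0 = 0 ∧ a j 1 * a j 2 < 0 ∧ d 1 - d 0 ≤ d 2 - d 1) ∨ (a j 0 = 0 ∧ 0 < a j 1 * a j 2 ∧ d 2 - d 1 ≤ d 1 - d 0)) :
    (((∏ j, fewnomial d (a j)) * (X * derivative (X * derivative (∏ j, fewnomial d (a j))))
        - (X * derivative (∏ j, fewnomial d (a j))) ^ 2).roots.toFinset.filter (fun t => 0 < t)).card ≤ 3 * m + 2 :=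
  ProductPlusOne.slowKneeBinomial_wronskian_card_le d a h01 h12 hrow

/-- **EB2-W ON THE SLOW-KNEE BINOMIAL CLASS, Euler currency: `Z₊(R_{l₀}) ≤ 5·m + 3` at every coupling** (brick G part 1 ✓ p706565, rev 34 wiring). -/
theorem slowKneeBinomialClass_euler_card_le {m : ℕ} (d : Fin 3 → ℕ) (a : Fin m → Fin 3 → ℝ) (h01 : d 0 < d 1) (h12 : d 1 < d 2)
    (hrow : ∀ j, (a j 2 = 0 ∧ a j 0 ≠ 0 ∧ a j 1 ≠ 0) ∨ (a j 1 = 0 ∧ a j 0 * a j 2 < 0) ∨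
      (a j 0 = 0 ∧ a j 1 * a j 2 < 0 ∧ d 1 - d 0 ≤ d 2 - d 1) ∨ (a j 0 = 0 ∧ 0 < a j 1 * a j 2 ∧ d 2 - d 1 ≤ d 1 - d 0)) (l₀ : Fin 3) :
    ((eulerNumerator d a l₀).roots.toFinset.filter (fun t => 0 < t)).card ≤ 5 * m + 3 :=
  ProductPlusOne.slowKneeBinomial_eulerNumerator_card_le d a h01 h12 hrow l₀

/-- ★★ EB2-W one knee vs poles `Z₊(W) ≤ 3m+2` (G-2 ✓ p706829, rev 34) … [prose → card § «Skeleton header archive K» block K.9, rev 39]; closes NO stub. -/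
theorem oneKneePoles_wronskian_card_le {m : ℕ} (d : Fin 3 → ℕ) (a : Fin m → Fin 3 → ℝ) (h01 : d 0 < d 1) (h12 : d 1 < d 2) (j₀ : Fin m)
    (hknee : (a j₀ 2 = 0 ∧ 0 < a j₀ 0 * a j₀ 1) ∨ (a j₀ 0 = 0 ∧ 0 < a j₀ 1 * a j₀ 2) ∨ (a j₀ 1 = 0 ∧ 0 < a j₀ 0 * a j₀ 2))
    (hpole : ∀ j, j ≠ j₀ → (a j 2 = 0 ∧ a j 0 * a j 1 < 0) ∨ (a j 0 = 0 ∧ a j 1 * a j 2 < 0) ∨ (a j 1 = 0 ∧ a j 0 * a j 2 < 0)) :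
    (((∏ j, fewnomial d (a j)) * (X * derivative (X * derivative (∏ j, fewnomial d (a j))))
        - (X * derivative (∏ j, fewnomial d (a j))) ^ 2).roots.toFinset.filter (fun t => 0 < t)).card ≤ 3 * m + 2 :=
  ProductPlusOne.oneKnee_poles_wronskian_card_le d a h01 h12 j₀ hknee hpole

/-- **… its Euler twin `≤ 5·m + 3` at every coupling** (brick G part 2 ✓ p706829, rev 34 wiring). -/
theorem oneKneePoles_euler_card_le {m : ℕ} (d : Fin 3 → ℕ) (a : Fin m → Fin 3 → ℝ) (h01 : d 0 < d 1) (h12 : d 1 < d 2) (j₀ : Fin m)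
    (hknee : (a j₀ 2 = 0 ∧ 0 < a j₀ 0 * a j₀ 1) ∨ (a j₀ 0 = 0 ∧ 0 < a j₀ 1 * a j₀ 2) ∨ (a j₀ 1 = 0 ∧ 0 < a j₀ 0 * a j₀ 2))
    (hpole : ∀ j, j ≠ j₀ → (a j 2 = 0 ∧ a j 0 * a j 1 < 0) ∨ (a j 0 = 0 ∧ a j 1 * a j 2 < 0) ∨ (a j 1 = 0 ∧ a j 0 * a j 2 < 0)) (l₀ : Fin 3) :
    ((eulerNumerator d a l₀).roots.toFinset.filter (fun t => 0 < t)).card ≤ 5 * m + 3 :=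
  ProductPlusOne.oneKnee_poles_eulerNumerator_card_le d a h01 h12 j₀ hknee hpole l₀

/-- ★★ EB2-W one riser vs poles `Z₊(W) ≤ 3m+2` (G-2 ✓ p706829, rev 34) … [prose → card § «Skeleton header archive K» block K.15, rev 39]; closes NO stub. -/
theorem oneRiserPoles_wronskian_card_le {m : ℕ} (d : Fin 3 → ℕ) (a : Fin m → Fin 3 → ℝ) (h01 : d 0 < d 1) (h12 : d 1 < d 2) (j₀ : Fin m)
    (hriser : 0 < a j₀ 0 ∧ a j₀ 1 < 0 ∧ a j₀ 2 < 0)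
    (hpole : ∀ j, j ≠ j₀ → (a j 2 = 0 ∧ a j 0 * a j 1 < 0) ∨ (a j 0 = 0 ∧ a j 1 * a j 2 < 0) ∨ (a j 1 = 0 ∧ a j 0 * a j 2 < 0)) :
    (((∏ j, fewnomial d (a j)) * (X * derivative (X * derivative (∏ j, fewnomial d (a j))))
        - (X * derivative (∏ j, fewnomial d (a j))) ^ 2).roots.toFinset.filter (fun t => 0 < t)).card ≤ 3 * m + 2 :=
  ProductPlusOne.oneRiser_poles_wronskian_card_le d a h01 h12 j₀ hriser hpole

/-- ★★ EB2-W one coherent row vs poles `Z₊(W) ≤ 3m+2` (G-2 ✓ p706829, rev 34) … [prose → card § «Skeleton header archive K» block K.14, rev 39]; closes NO stub. -/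
theorem oneCoherentPoles_wronskian_card_le {m : ℕ} (d : Fin 3 → ℕ) (a : Fin m → Fin 3 → ℝ) (h01 : d 0 < d 1) (h12 : d 1 < d 2) (j₀ : Fin m)
    (hcoh : 0 < a j₀ 0 ∧ 0 < a j₀ 1 ∧ a j₀ 2 < 0)
    (hpole : ∀ j, j ≠ j₀ → (a j 2 = 0 ∧ a j 0 * a j 1 < 0) ∨ (a j 0 = 0 ∧ a j 1 * a j 2 < 0) ∨ (a j 1 = 0 ∧ a j 0 * a j 2 < 0)) :
    (((∏ j, fewnomial d (a j)) * (X * derivative (X * derivative (∏ j, fewnomial d (a j))))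
        - (X * derivative (∏ j, fewnomial d (a j))) ^ 2).roots.toFinset.filter (fun t => 0 < t)).card ≤ 3 * m + 2 :=
  ProductPlusOne.oneCoherent_poles_wronskian_card_le d a h01 h12 j₀ hcoh hpole

/-! ### Rev 35 wiring — the RATE-SEPARATED CELL and its GLOBAL COUNTS in LINE currency (brick G parts 3/4, val-lit-p7 g18) … [prose → card § «Skeleton header archive J» block J.4, rev 38] -/

/-- ★★ RATE-SEPARATED CELL ≤ 2 per window (G3 ✓, rev 35) … [prose → card § «Skeleton header archive K» block K.8, rev 39]; closes NO stub. -/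
theorem rateSeparatedCell_wronskian_roots_le_two {m : ℕ} (d : Fin 3 → ℕ) (a : Fin m → Fin 3 → ℝ) (h01 : d 0 < d 1) (h12 : d 1 < d 2)
    (ρ : ℕ) {u v : ℝ} (hu : 0 < u)
    (hrow : ∀ j,
      (a j 2 = 0 ∧ 0 < a j 0 * a j 1 ∧ d 1 - d 0 ≤ ρ) ∨
      (a j 2 = 0 ∧ a j 0 * a j 1 < 0 ∧ ρ ≤ d 1 - d 0 ∧ 0 ≤ (fewnomial d (a j)).eval u * (fewnomial d (a j)).eval v) ∨
      (a j 0 = 0 ∧ 0 < a j 1 * a j 2 ∧ d 2 - d 1 ≤ ρ) ∨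
      (a j 0 = 0 ∧ a j 1 * a j 2 < 0 ∧ ρ ≤ d 2 - d 1 ∧ 0 ≤ (fewnomial d (a j)).eval u * (fewnomial d (a j)).eval v) ∨
      (a j 1 = 0 ∧ 0 < a j 0 * a j 2 ∧ d 2 - d 0 ≤ ρ) ∨
      (a j 1 = 0 ∧ a j 0 * a j 2 < 0 ∧ ρ ≤ d 2 - d 0 ∧ 0 ≤ (fewnomial d (a j)).eval u * (fewnomial d (a j)).eval v)) :
    (((∏ j, fewnomial d (a j)) * (X * derivative (X * derivative (∏ j, fewnomial d (a j))))
        - (X * derivative (∏ j, fewnomial d (a j))) ^ 2).roots.toFinset.filter (fun t => u < t ∧ t < v)).card ≤ 2 :=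
  ProductPlusOne.rateSeparated_wronskian_roots_le_two d h01 h12 ρ a hu hrow

/-- ★ RATE-SEPARATED CLASS `Z₊(W) ≤ 3m+2` globally (G4 ✓, rev 35) … [prose → card § «Skeleton header archive K» block K.16, rev 39]; closes NO stub. -/
theorem rateSeparatedClass_wronskian_card_le {m : ℕ} (d : Fin 3 → ℕ) (a : Fin m → Fin 3 → ℝ) (h01 : d 0 < d 1) (h12 : d 1 < d 2) (ρ : ℕ)
    (hrow : ∀ j,
      (a j 2 = 0 ∧ 0 < a j 0 * a j 1 ∧ d 1 - d 0 ≤ ρ) ∨ (a j 2 = 0 ∧ a j 0 * a j 1 < 0 ∧ ρ ≤ d 1 - d 0) ∨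
      (a j 0 = 0 ∧ 0 < a j 1 * a j 2 ∧ d 2 - d 1 ≤ ρ) ∨ (a j 0 = 0 ∧ a j 1 * a j 2 < 0 ∧ ρ ≤ d 2 - d 1) ∨
      (a j 1 = 0 ∧ 0 < a j 0 * a j 2 ∧ d 2 - d 0 ≤ ρ) ∨ (a j 1 = 0 ∧ a j 0 * a j 2 < 0 ∧ ρ ≤ d 2 - d 0)) :
    (((∏ j, fewnomial d (a j)) * (X * derivative (X * derivative (∏ j, fewnomial d (a j))))
        - (X * derivative (∏ j, fewnomial d (a j))) ^ 2).roots.toFinset.filter (fun t => 0 < t)).card ≤ 3 * m + 2 :=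
  ProductPlusOne.rateSeparated_wronskian_card_le d a h01 h12 ρ hrow

/-- **ALL KNEES + FASTEST POLES: `Z₊(W) ≤ 3·m + 2`** (G4 ✓, rev 35 wiring; the `ρ = d 2 − d 0` instance): every row a knee binomial on any pair or a
pole binomial on the outer pair `(0,2)`.  closes NO stub; in NO head's cone. -/
theorem allKneesFastPoles_wronskian_card_le {m : ℕ} (d : Fin 3 → ℕ) (a : Fin m → Fin 3 → ℝ) (h01 : d 0 < d 1) (h12 : d 1 < d 2)
    (hrow : ∀ j, (a j 2 = 0 ∧ 0 < a j 0 * a j 1) ∨ (a j 0 = 0 ∧ 0 < a j 1 * a j 2) ∨ (a j 1 = 0 ∧ 0 < a j 0 * a j 2) ∨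
      (a j 1 = 0 ∧ a j 0 * a j 2 < 0)) :
    (((∏ j, fewnomial d (a j)) * (X * derivative (X * derivative (∏ j, fewnomial d (a j))))
        - (X * derivative (∏ j, fewnomial d (a j))) ^ 2).roots.toFinset.filter (fun t => 0 < t)).card ≤ 3 * m + 2 :=
  ProductPlusOne.allKnees_fastPoles_wronskian_card_le d a h01 h12 hrow

/-- RATE-SEPARATED CLASS Euler twin `≤ 5m+3` (G4 ✓, rev 35) … [prose → card § «Skeleton header archive K» block K.13, rev 39]; closes NO stub. -/
theorem rateSeparatedClass_euler_card_le {m : ℕ} (d : Fin 3 → ℕ) (a : Fin m → Fin 3 → ℝ) (h01 : d 0 < d 1) (h12 : d 1 < d 2) (ρ : ℕ)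
    (hrow : ∀ j,
      (a j 2 = 0 ∧ 0 < a j 0 * a j 1 ∧ d 1 - d 0 ≤ ρ) ∨ (a j 2 = 0 ∧ a j 0 * a j 1 < 0 ∧ ρ ≤ d 1 - d 0) ∨
      (a j 0 = 0 ∧ 0 < a j 1 * a j 2 ∧ d 2 - d 1 ≤ ρ) ∨ (a j 0 = 0 ∧ a j 1 * a j 2 < 0 ∧ ρ ≤ d 2 - d 1) ∨
      (a j 1 = 0 ∧ 0 < a j 0 * a j 2 ∧ d 2 - d 0 ≤ ρ) ∨ (a j 1 = 0 ∧ a j 0 * a j 2 < 0 ∧ ρ ≤ d 2 - d 0))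
    (l₀ : Fin 3) :
    ((eulerNumerator d a l₀).roots.toFinset.filter (fun t => 0 < t)).card ≤ 5 * m + 3 :=
  ProductPlusOne.rateSeparated_eulerNumerator_card_le d a h01 h12 ρ hrow l₀

/-! ### Rev 37 wiring — the ORDER-6 RING-FREE WINDOW LAW in LINE currency + imports of the accepted (ACC-Λ) bricks (pen val-idea-25 g6; owner memo §28/§30) … [prose → card § «Skeleton header archive J» block J.5, rev 38] -/

/-- ★★ ORDER-6 RING-FREE WINDOW LAW ≤ 6 (E3b ✓ p712823, rev 37) … [prose → card § «Skeleton header archive K» block K.3, rev 39]; closes NO stub. -/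
theorem sixthOrderRingFree_wronskian_roots_le_six {m : ℕ} (d : Fin 3 → ℕ) (e₁ e₂ : ℕ) (he₁ : d 1 = d 0 + e₁ + 1)
    (he₂ : d 2 = d 1 + e₂ + 1) (h2p : 2 * (e₁ + 1) ≤ e₂ + 1) (a : Fin m → Fin 3 → ℝ) {u v : ℝ} (hu : 0 < u)
    (hrow : ∀ j,
      (a j 2 = 0 ∧ 0 < a j 0 * a j 1) ∨
      (a j 2 = 0 ∧ a j 0 * a j 1 < 0 ∧ 0 ≤ (fewnomial d (a j)).eval u * (fewnomial d (a j)).eval v) ∨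
      (a j 0 = 0 ∧ 0 < a j 1 * a j 2 ∧ ∀ x ∈ Set.Ioo u v,
          0 < 6 * ((((e₂ : ℝ) + 1) - ((e₁ : ℝ) + 1)) * (2 * ((e₂ : ℝ) + 1) - ((e₁ : ℝ) + 1)) * (2 * ((e₂ : ℝ) + 1) + ((e₁ : ℝ) + 1))
                * (3 * ((e₂ : ℝ) + 1) + ((e₁ : ℝ) + 1)))
            + 240 * ((3 * ((e₂ : ℝ) + 1) + ((e₁ : ℝ) + 1)) * (2 * ((e₂ : ℝ) + 1) - ((e₁ : ℝ) + 1)))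
                * ProductPlusOne.rowPsi1 e₁ e₂ (a j 0) (-(a j 1)) (-(a j 2)) x
            + 5040 * ProductPlusOne.rowPsi1 e₁ e₂ (a j 0) (-(a j 1)) (-(a j 2)) x ^ 2) ∨
      (a j 0 = 0 ∧ a j 1 * a j 2 < 0 ∧ 0 ≤ (fewnomial d (a j)).eval u * (fewnomial d (a j)).eval v) ∨
      (a j 1 = 0 ∧ 0 < a j 0 * a j 2 ∧ ∀ x ∈ Set.Ioo u v,
          0 < 6 * (12 * ((e₁ : ℝ) + 1) ^ 4 + 56 * ((e₁ : ℝ) + 1) ^ 3 * ((e₂ : ℝ) + 1) + 89 * ((e₁ : ℝ) + 1) ^ 2 * ((e₂ : ℝ) + 1) ^ 2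
                + 56 * ((e₁ : ℝ) + 1) * ((e₂ : ℝ) + 1) ^ 3 + 12 * ((e₂ : ℝ) + 1) ^ 4)
            + 120 * (12 * ((e₁ : ℝ) + 1) ^ 2 + 26 * ((e₁ : ℝ) + 1) * ((e₂ : ℝ) + 1) + 12 * ((e₂ : ℝ) + 1) ^ 2)
                * ProductPlusOne.rowPsi1 e₁ e₂ (a j 0) (-(a j 1)) (-(a j 2)) x
            + 5040 * ProductPlusOne.rowPsi1 e₁ e₂ (a j 0) (-(a j 1)) (-(a j 2)) x ^ 2) ∨
      (a j 1 = 0 ∧ a j 0 * a j 2 < 0 ∧ 0 ≤ (fewnomial d (a j)).eval u * (fewnomial d (a j)).eval v)) :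
    (((∏ j, fewnomial d (a j)) * (X * derivative (X * derivative (∏ j, fewnomial d (a j))))
        - (X * derivative (∏ j, fewnomial d (a j))) ^ 2).roots.toFinset.filter (fun t => u < t ∧ t < v)).card ≤ 6 :=
  ProductPlusOne.sixthOrder_ringfree_wronskian_roots_le_six d e₁ e₂ he₁ he₂ h2p a hu hrow

/-! ### Rev 38 wiring — the EQUAL-GAP RING-FREE WINDOW LAW ≤ 6 in LINE currency (E3c ✓ p714588) … [prose → `Lines/product_plus_one-header-archive-2.md` block L.2, rev 40]; closes NO stub; 18050 OPEN; VP ≠ VNP NOT proved. -/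

/-- ★★ EQUAL-GAP RING-FREE WINDOW LAW ≤ 6 (E3c ✓ p714588, rev 38) … [prose → card § «Skeleton header archive K» block K.4, rev 39]; closes NO stub. -/
theorem equalGapRingFree_wronskian_roots_le_six {m : ℕ} (d : Fin 3 → ℕ) (e : ℕ) (he₁ : d 1 = d 0 + e + 1)
    (he₂ : d 2 = d 1 + e + 1) (a : Fin m → Fin 3 → ℝ) {u v : ℝ} (hu : 0 < u)
    (hrow : ∀ j,
      (a j 2 = 0 ∧ 0 < a j 0 * a j 1) ∨
      (a j 2 = 0 ∧ a j 0 * a j 1 < 0 ∧ 0 ≤ (fewnomial d (a j)).eval u * (fewnomial d (a j)).eval v) ∨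
      (a j 0 = 0 ∧ 0 < a j 1 * a j 2) ∨
      (a j 0 = 0 ∧ a j 1 * a j 2 < 0 ∧ 0 ≤ (fewnomial d (a j)).eval u * (fewnomial d (a j)).eval v) ∨
      (a j 1 = 0 ∧ 0 < a j 0 * a j 2 ∧ ∀ x ∈ Set.Ioo u v,
          0 < 630 * ((e : ℝ) + 1) ^ 4 + 5040 * ((e : ℝ) + 1) ^ 2 * ProductPlusOne.rowPsi1 e e (a j 0) (-(a j 1)) (-(a j 2)) x
            + 5040 * ProductPlusOne.rowPsi1 e e (a j 0) (-(a j 1)) (-(a j 2)) x ^ 2) ∨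
      (a j 1 = 0 ∧ a j 0 * a j 2 < 0 ∧ 0 ≤ (fewnomial d (a j)).eval u * (fewnomial d (a j)).eval v)) :
    (((∏ j, fewnomial d (a j)) * (X * derivative (X * derivative (∏ j, fewnomial d (a j))))
        - (X * derivative (∏ j, fewnomial d (a j))) ^ 2).roots.toFinset.filter (fun t => u < t ∧ t < v)).card ≤ 6 :=
  ProductPlusOne.equalGap_ringfree_wronskian_roots_le_six d e he₁ he₂ a hu hrow

/-! ### Rev 39 wiring (val-idea-25 g7) — ★★ the FULL ORDER-6 WINDOW CELL WITH CLOUDS (✓ p723034) and ★★ the FIRST IN-RING CELL ≤ 8 (✓ p722904) … [prose → `Lines/product_plus_one-header-archive-2.md` block L.3, rev 40]; closes NO stub; 18050 OPEN; VP ≠ VNP NOT proved. -/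

/-- ★★ **FULL ORDER-6 WINDOW LAW ≤ 6, CLOUDS INCLUDED** (✓ p723034 `…SixthOrderFullCell`, val-lit-p5 g17; rev 39; memo §30.5).  closes NO stub. -/
theorem fullCellOrderSix_wronskian_roots_le_six {m : ℕ} (d : Fin 3 → ℕ) (hd : StrictMono d) (h3 : 3 * (d 1 - d 0) ≤ d 2 - d 0)
    (a : Fin m → Fin 3 → ℝ) {u v : ℝ} (hu : 0 < u)
    (hrow : ∀ j,
      (a j 2 = 0 ∧ 0 < a j 0 * a j 1) ∨
      (a j 2 = 0 ∧ a j 0 * a j 1 < 0 ∧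
          0 ≤ (fewnomial d (a j)).eval u * (fewnomial d (a j)).eval v) ∨
      (a j 0 = 0 ∧ 0 < a j 1 * a j 2 ∧ ∀ x ∈ Set.Ioo u v,
          0 < 6 * (((((d 2 - d 0 : ℕ) : ℝ) - ((d 1 - d 0 : ℕ) : ℝ)) - ((d 1 - d 0 : ℕ) : ℝ))
                * (2 * (((d 2 - d 0 : ℕ) : ℝ) - ((d 1 - d 0 : ℕ) : ℝ)) - ((d 1 - d 0 : ℕ) : ℝ))
                * (2 * (((d 2 - d 0 : ℕ) : ℝ) - ((d 1 - d 0 : ℕ) : ℝ)) + ((d 1 - d 0 : ℕ) : ℝ))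
                * (3 * (((d 2 - d 0 : ℕ) : ℝ) - ((d 1 - d 0 : ℕ) : ℝ)) + ((d 1 - d 0 : ℕ) : ℝ)))
            + 240 * ((3 * (((d 2 - d 0 : ℕ) : ℝ) - ((d 1 - d 0 : ℕ) : ℝ)) + ((d 1 - d 0 : ℕ) : ℝ))
                * (2 * (((d 2 - d 0 : ℕ) : ℝ) - ((d 1 - d 0 : ℕ) : ℝ)) - ((d 1 - d 0 : ℕ) : ℝ)))
                * ProductPlusOne.rowPsiK1 (fun l : Fin 2 => d l.succ - d 0) (a j 0) (fun l : Fin 2 => -(a j l.succ)) x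
            + 5040 * ProductPlusOne.rowPsiK1 (fun l : Fin 2 => d l.succ - d 0) (a j 0) (fun l : Fin 2 => -(a j l.succ)) x ^ 2) ∨
      (a j 0 = 0 ∧ a j 1 * a j 2 < 0 ∧
          0 ≤ (fewnomial d (a j)).eval u * (fewnomial d (a j)).eval v) ∨
      (a j 1 = 0 ∧ 0 < a j 0 * a j 2 ∧ ∀ x ∈ Set.Ioo u v,
          0 < 6 * (12 * ((d 1 - d 0 : ℕ) : ℝ) ^ 4 + 56 * ((d 1 - d 0 : ℕ) : ℝ) ^ 3 * (((d 2 - d 0 : ℕ) : ℝ) - ((d 1 - d 0 : ℕ) : ℝ))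
                + 89 * ((d 1 - d 0 : ℕ) : ℝ) ^ 2 * (((d 2 - d 0 : ℕ) : ℝ) - ((d 1 - d 0 : ℕ) : ℝ)) ^ 2
                + 56 * ((d 1 - d 0 : ℕ) : ℝ) * (((d 2 - d 0 : ℕ) : ℝ) - ((d 1 - d 0 : ℕ) : ℝ)) ^ 3
                + 12 * (((d 2 - d 0 : ℕ) : ℝ) - ((d 1 - d 0 : ℕ) : ℝ)) ^ 4)
            + 120 * (12 * ((d 1 - d 0 : ℕ) : ℝ) ^ 2 + 26 * ((d 1 - d 0 : ℕ) : ℝ) * (((d 2 - d 0 : ℕ) : ℝ) - ((d 1 - d 0 : ℕ) : ℝ))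
                + 12 * (((d 2 - d 0 : ℕ) : ℝ) - ((d 1 - d 0 : ℕ) : ℝ)) ^ 2)
                * ProductPlusOne.rowPsiK1 (fun l : Fin 2 => d l.succ - d 0) (a j 0) (fun l : Fin 2 => -(a j l.succ)) x
            + 5040 * ProductPlusOne.rowPsiK1 (fun l : Fin 2 => d l.succ - d 0) (a j 0) (fun l : Fin 2 => -(a j l.succ)) x ^ 2) ∨
      (a j 1 = 0 ∧ a j 0 * a j 2 < 0 ∧
          0 ≤ (fewnomial d (a j)).eval u * (fewnomial d (a j)).eval v) ∨
      (a j 0 * a j 1 < 0 ∧ a j 0 * a j 2 < 0 ∧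
          ∀ x ∈ Set.Ioo u v, 0 < a j 0 * (a j 0 + a j 1 * x ^ (d 1 - d 0) + a j 2 * x ^ (d 2 - d 0))) ∨
      (0 < a j 0 * a j 1 ∧ a j 0 * a j 2 < 0 ∧
          ∀ x ∈ Set.Ioo u v, a j 0 * (a j 0 + a j 1 * x ^ (d 1 - d 0) + a j 2 * x ^ (d 2 - d 0)) < 0) ∨
      (∀ x ∈ Set.Ioo u v, a j 0 + a j 1 * x ^ (d 1 - d 0) + a j 2 * x ^ (d 2 - d 0) ≠ 0 ∧
          0 < ProductPlusOne.rowPsiK7 (fun l : Fin 2 => d l.succ - d 0) (a j 0) (fun l : Fin 2 => -(a j l.succ)) x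
            - (((d 1 - d 0 : ℕ) : ℝ) ^ 2 + (((d 2 - d 0 : ℕ) : ℝ) - ((d 1 - d 0 : ℕ) : ℝ)) ^ 2 + ((d 2 - d 0 : ℕ) : ℝ) ^ 2)
                * ProductPlusOne.rowPsiK5 (fun l : Fin 2 => d l.succ - d 0) (a j 0) (fun l : Fin 2 => -(a j l.succ)) x
            + (((d 1 - d 0 : ℕ) : ℝ) ^ 2 * (((d 2 - d 0 : ℕ) : ℝ) - ((d 1 - d 0 : ℕ) : ℝ)) ^ 2
                  + ((d 1 - d 0 : ℕ) : ℝ) ^ 2 * ((d 2 - d 0 : ℕ) : ℝ) ^ 2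
                  + (((d 2 - d 0 : ℕ) : ℝ) - ((d 1 - d 0 : ℕ) : ℝ)) ^ 2 * ((d 2 - d 0 : ℕ) : ℝ) ^ 2)
                * ProductPlusOne.rowPsiK3 (fun l : Fin 2 => d l.succ - d 0) (a j 0) (fun l : Fin 2 => -(a j l.succ)) x
            - (((d 1 - d 0 : ℕ) : ℝ) ^ 2 * (((d 2 - d 0 : ℕ) : ℝ) - ((d 1 - d 0 : ℕ) : ℝ)) ^ 2 * ((d 2 - d 0 : ℕ) : ℝ) ^ 2)
                * ProductPlusOne.rowPsiK1 (fun l : Fin 2 => d l.succ - d 0) (a j 0) (fun l : Fin 2 => -(a j l.succ)) x)) :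
    (((∏ j, fewnomial d (a j)) * (X * derivative (X * derivative (∏ j, fewnomial d (a j))))
        - (X * derivative (∏ j, fewnomial d (a j))) ^ 2).roots.toFinset.filter (fun t => u < t ∧ t < v)).card ≤ 6 :=
  ProductPlusOne.sixthOrderFullCell_wronskian_roots_le_six d hd h3 a hu hrow

/-- ★★ **FIRST IN-RING CELL ≤ 8: one ringed hull knee against poles** (C3a ✓ p722904 `…RingIsoPoles`, val-lit-p7 g18; rev 39; memo §32).  closes NO stub. -/
theorem ringIsoPoles_wronskian_roots_le_eight {m : ℕ} (d : Fin 3 → ℕ) (e₁ e₂ : ℕ) (he₁ : d 1 = d 0 + e₁ + 1)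
    (he₂ : d 2 = d 1 + e₂ + 1) (h2p : 2 * (e₁ + 1) ≤ e₂ + 1) (a : Fin m → Fin 3 → ℝ) {u v : ℝ} (hu : 0 < u) (j₀ : Fin m)
    (hknee :
      (a j₀ 0 = 0 ∧ 0 < a j₀ 1 * a j₀ 2 ∧ ∀ x ∈ Set.Ioo u v,
          6 * ((((e₂ : ℝ) + 1) - ((e₁ : ℝ) + 1)) * (2 * ((e₂ : ℝ) + 1) - ((e₁ : ℝ) + 1)) * (2 * ((e₂ : ℝ) + 1) + ((e₁ : ℝ) + 1))
                * (3 * ((e₂ : ℝ) + 1) + ((e₁ : ℝ) + 1)))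
            + 240 * ((3 * ((e₂ : ℝ) + 1) + ((e₁ : ℝ) + 1)) * (2 * ((e₂ : ℝ) + 1) - ((e₁ : ℝ) + 1)))
                * ProductPlusOne.rowPsi1 e₁ e₂ (a j₀ 0) (-(a j₀ 1)) (-(a j₀ 2)) x
            + 5040 * ProductPlusOne.rowPsi1 e₁ e₂ (a j₀ 0) (-(a j₀ 1)) (-(a j₀ 2)) x ^ 2 < 0) ∨
      (a j₀ 1 = 0 ∧ 0 < a j₀ 0 * a j₀ 2 ∧ ∀ x ∈ Set.Ioo u v,
          6 * (12 * ((e₁ : ℝ) + 1) ^ 4 + 56 * ((e₁ : ℝ) + 1) ^ 3 * ((e₂ : ℝ) + 1) + 89 * ((e₁ : ℝ) + 1) ^ 2 * ((e₂ : ℝ) + 1) ^ 2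
                + 56 * ((e₁ : ℝ) + 1) * ((e₂ : ℝ) + 1) ^ 3 + 12 * ((e₂ : ℝ) + 1) ^ 4)
            + 120 * (12 * ((e₁ : ℝ) + 1) ^ 2 + 26 * ((e₁ : ℝ) + 1) * ((e₂ : ℝ) + 1) + 12 * ((e₂ : ℝ) + 1) ^ 2)
                * ProductPlusOne.rowPsi1 e₁ e₂ (a j₀ 0) (-(a j₀ 1)) (-(a j₀ 2)) x
            + 5040 * ProductPlusOne.rowPsi1 e₁ e₂ (a j₀ 0) (-(a j₀ 1)) (-(a j₀ 2)) x ^ 2 < 0))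
    (hpoles : ∀ j, j ≠ j₀ →
      (a j 0 = 0 ∧ a j 1 * a j 2 < 0 ∧ 0 ≤ (fewnomial d (a j)).eval u * (fewnomial d (a j)).eval v) ∨
      (a j 1 = 0 ∧ a j 0 * a j 2 < 0 ∧ 0 ≤ (fewnomial d (a j)).eval u * (fewnomial d (a j)).eval v)) :
    (((∏ j, fewnomial d (a j)) * (X * derivative (X * derivative (∏ j, fewnomial d (a j))))
        - (X * derivative (∏ j, fewnomial d (a j))) ^ 2).roots.toFinset.filter (fun t => u < t ∧ t < v)).card ≤ 8 :=
  ProductPlusOne.ringIsoPoles_wronskian_roots_le_eight d e₁ e₂ he₁ he₂ h2p a hu j₀ hknee hpoles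

/-! ### Rev 40 wiring (val-idea-25 g7) — record wires on two ✓ kernel files of the cloud lane: (W0) of the phase-lens W-polynomial (✓ p724926 `…LensWronskian`,
val-lit-p5 g17: the `WronskianBudgetK3` polynomial `P·θθP − (θP)²` vanishes at a nonzero root of the company product iff the root is MULTIPLE) and (C↓) of the
cloud sides (✓ p723223 `…CloudSides`, val-lit-p5 g17: a bottom-cloud row's side hypothesis propagates from the right endpoint to the whole window, the shape
used by `fullCellOrderSix_wronskian_roots_le_six`); plus ARCHIVE-2 move L (R519 / R525 (4)).  BOOKS unchanged from rev 39 (Theorems A/B/C/W PAPER on the binomial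
sub-class; owner memos §38–§39: the cloud term factorises `R_f = S̃(V + κ)·V′`, far field = PF_∞ sech mixture, located law ≤ 2T − 1).  One-line terms; closes NO
stub; in NO head's cone; `WronskianBudgetK3` / `OneChangeFloorK3` / 18050 stay OPEN; VP ≠ VNP is NOT proved. -/

/-- ★ **(W0) THE W-POLYNOMIAL AT A ROOT OF THE COMPANY PRODUCT: zero iff the root is multiple** (✓ p724926 `…LensWronskian`, val-lit-p5 g17; rev 40;
the polynomial is def #20 `WronskianBudgetK3`'s `P·θθP − (θP)²` with `P = ∏ fewnomial`).  closes NO stub. -/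
theorem companyW_eval_root_eq_zero_iff {m K : ℕ} (d : Fin K → ℕ) (a : Fin m → Fin K → ℝ)
    (hP : (∏ j, fewnomial d (a j)) ≠ 0) {x₀ : ℝ} (hx : x₀ ≠ 0) (h : (∏ j, fewnomial d (a j)).IsRoot x₀) :
    ((∏ j, fewnomial d (a j)) * (X * derivative (X * derivative (∏ j, fewnomial d (a j))))
        - (X * derivative (∏ j, fewnomial d (a j))) ^ 2).eval x₀ = 0
      ↔ 1 < (∏ j, fewnomial d (a j)).rootMultiplicity x₀ :=
  ProductPlusOne.lensW_eval_root_eq_zero_iff _ hP hx h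

/-- **(C↓) A BOTTOM-CLOUD ROW'S SIDE PROPAGATES FROM THE RIGHT ENDPOINT TO THE WINDOW** (✓ p723223 `…CloudSides`, val-lit-p5 g17; rev 40;
row `j` with `a j 0·a j 1 < 0`, `a j 0·a j 2 < 0`, reduced trinomial in the gaps `d 1 − d 0`, `d 2 − d 0`).  closes NO stub. -/
theorem cloudRow_bottom_side_on_window {m : ℕ} (d : Fin 3 → ℕ) (hd : StrictMono d) (a : Fin m → Fin 3 → ℝ) (j : Fin m)
    {u v : ℝ} (hu : 0 ≤ u) (h01 : a j 0 * a j 1 < 0) (h02 : a j 0 * a j 2 < 0)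
    (hv : 0 ≤ a j 0 * (a j 0 + a j 1 * v ^ (d 1 - d 0) + a j 2 * v ^ (d 2 - d 0))) :
    ∀ x ∈ Set.Ioo u v, 0 < a j 0 * (a j 0 + a j 1 * x ^ (d 1 - d 0) + a j 2 * x ^ (d 2 - d 0)) :=
  ProductPlusOne.cloud_bottom_side_on_window d hd (a j) hu h01 h02 hv


end Wiring

/-! ### Registered stubs (sorry ONLY in S4′, S4″, S4⁗ = the floor, S5) -/

/-- **stub S3 — CLOSED BY NAME (rev 2):** `Theorems/LacunarySymmetroidMatrixDescartesProductPlusOnePosCoeff.lean`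
`ProductPlusOne.posCoeffRung` (val-lit-p7 g14, p646279; sign-variation count — in fact `≤ 1` off the coupled exponent). -/
theorem stub_posCoeffRung : PosCoeffRung := by
  intro m K d a c ha hc
  exact Summit.ValiantsHypothesis.ValiantsHypothesis.Theorems.LacunarySymmetroidMatrixDescartes.ProductPlusOne.posCoeffRung
    m K d a c ha hc

/-- **stub S4″ (optional sufficient rung above S4′; research / engine column «Z₊(R)/m at K = 3» of E-PPO-1): the c-free Euler bound.**
Sectors closed by name above (`eulerBoundK3_tameBottom` / `_sharp` / `_mixed`, rev 6; `_tameTop` / `_mixedTop`, rev 7; `_coherentBottom` / `_coherentTop` ANY ratio, rev 10; `eulerBoundK3_lowerSigned` / `eulerBoundK3_upperSigned` ANY ratio, any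
T1/T4-type company at the bottom / top coupling, and `eulerBoundK3_tameWeak` / `eulerBoundK3_tameWeakTop` 2m+1 (weak tame rows, ratio ≤ 4), rev 16); RESIDUE as for S4′.  May be FALSE with S4′ true; a kill
re-confines the line to S4′, nothing else moves. -/
theorem stub_eulerBoundK3 : EulerBoundK3 := by
  sorry

/-- **stub S4⁗ — THE FLOOR (NEW rev 15; R297 (7): «the pen states the floor as ONE registered stub»; research — val-lit-p7 g15 lane, memo
NOTE-p7g15-18050-LINEA-incoherent-cell.md).**  K = 3, bottom coupling, every support ratio, rows of factors with at most one sign change each, in any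
company ⇒ `Z₊(R) ≤ C·m + C`.  KERNEL SUB-SECTORS (evidence only; the constant must be ratio- and company-free): tame ratio ≤ 4 (`eulerBoundK3_tameBottom`, weak form `eulerBoundK3_tameWeak` 2m+1 rev 16),
coherent-all (`eulerBoundK3_coherentBottom`, `eulerBoundPoly_coherentK`), lower-signed-all = any T1/T4-type company (`eulerBoundK3_lowerSigned` 2m+1,
val-lit-p7 g15 p671438, rev 16).  OPEN CORE (re-cut rev 16): rows with a T5-type factor (`a j 0·a j 1 < 0`) — at ratio > 4 in any company (pure = memo §6),
and at ANY ratio in company with a one-signed T1 factor (no sector at any ratio; memo rev 3 §7: «risers vs pullers») — no per-factor multiplier (memo §2), aggregate-pull Riccati structure (memo §3; kernel: p674257 `…ProductPlusOneRiccati`, cited rev 17), certified two-hump member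
`Z₊(R) ≥ m+3` (memo §4), conjecture `(m−1) + 2V`, `V ≤ min(r/4, √m) + O(1)` (memo §5).  A rung BELOW S4″ (`oneChangeFloorK3_of_eulerBoundK3`), not in the head's cone;
MAY BE FALSE in Euler currency with the member cell (`oneChangeFloorK3_members` shape) true — a kill takes `stub_eulerBoundK3` with it and re-confines
the floor to the member currency; zero-free strict dips and the middle coupling stay OUTSIDE the floor (residue of S4′/S4″ proper).  RE-CUT rev 18 (AB-reduction,
header): on the upper-signed sub-cell (T1 ∪ T5 companies, any ratio) every extra pair lives in a type-α window (AB0–AB3, kernel ✓ p678363 wired rev 19 —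
`letterSum_antitoneOn`, `letterSums_opposite_of_euler_zero`, `euler_roots_Icc_le_one_of_letterSum_one_pos/_two_neg`: type-β intervals ≤ 1 zero; rev 20: middle twin
`eulerMiddle_roots_Icc_le_one_of_letterSum{Two,Zero}_neg`, chart-free `euler_roots_Icc_le_crossingBudget` = every window claim is an UP-CROSSING budget; rev 21: top twin `eulerTop_roots_Icc_le_one_of_letterSum{One_pos,
Zero_neg}`, every-K `eulerK_roots_Icc_le_one_of_letterSums_{pos,neg}`, log-Wronskian identities `company_logWronskian_prod` / `row_logWronskian`; rev 22: AB5-0′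
`company_logWronskian_nonpos_at_root`, AB5-1 `exists_companyWronskian_{neg,pos}_between_zeros`, `row_logWronskian_nonneg_of_pairwise`, the trinomial-cloud one-riser theorem
`oneRiser_trinomialCloud_euler_no_four_zeros` (first gap of every T5-all member ≤ 3 zeros), the SIGN-FREE window count
`euler_roots_Icc_le_one_of_reducedMoment_neg` (AB6); rev 23: its eight sign-free
instances `…_signfree`, the letter-sign count `euler_roots_Icc_le_one_of_letterSigns`, the crossing-interlace count
`euler_roots_Icc_le_companyWronskian_roots_add_one`) and the
FIRST INTERACTION COUNT is kernel — `oneRiser_eulerNumerator_no_four_zeros` (✓ p678091: one switched T5 riser vs a binomial cloud ⇒ ≤ 3 zeros per interval);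
located target AB4-riser `V_I ≤ ρ_I` (CONJECTURE; AB4-strong refuted by p5's m = 104 certificate); open core after rev 18 = {type-α windows of upper-signed
companies: riser budget} ∪ {T4 + T5 at ratio > 4, T1 + T4 + T5 at any ratio}. -/
theorem stub_oneChangeFloorK3 : OneChangeFloorK3 := by
  sorry

/-- **stub S4′ (engine rung E-PPO-1 / research): class row `K = 3` linear in `m`.**  Sectors closed by name above
(`classRowK3_tameBottom` / `_tameTop` / `classRowK3_sharp` / `classRowK3_mixed` / `_mixedTop`, each with a `_signed` 2m+2-type constant (tame m+2), `classRowK3_coherentBottom` / `_coherentTop` 2m+3; `classRowK3_lowerSigned` / `classRowK3_upperSigned` 2m+2 and `classRowK3_lowerSigned_signed`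
≤ #{sign-changing j} + 2 at ANY ratio for any company of lower-signed (bottom) / upper-signed (top) factors, `classRowK3_tameWeak(Top)` 2m+2 (weak tame rows), rev 16; sign-aware rows `classRowK3_upperSigned_signed` / `classRowK3_coherentTop_signed` / `classRowK3_coherentBottom_signed` (m+2) /
`classRowK3_tameWeak_signed`, rev 17; S5's `polyLaw_sharpK(_signed)` covers sharp at every K); RESIDUE = mixed company outside its ratio
window or at the middle coupling, INCOHERENT one-zero factors at ratio > 4 (and, at any ratio, in company with one-signed factors), middle coupling in the no-dip sector, zero-free strict dips («interaction at a distance»).  May be FALSE — a kill demotes `PPOLinearLaw`, not `PPOPolyLaw`. -/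
theorem stub_classRowK3 : ClassRowK3Linear := by
  sorry

/-- **stub S5 (research, THE LINE'S LAW): the class law `PPOPolyLaw`** (uniform in `m`; bottom rung of real τ at top fan-in 2);
c-free sufficient form `ppoPolyLaw_of_eulerBoundPoly`; general-`K` sectors closed by name: sharp (`polyLaw_sharpK(_signed)`, `eulerBoundPoly_sharpK`) and coherent one-zero, linear in `m` (`eulerBoundPoly_coherentK` / `eulerBoundPoly_coherentK_top` at the two extreme couplings, members `polyLaw_coherentK_signed ≤ m+2` / `polyLaw_coherentK_top ≤ 2m+2`,
revs 13–16) and LOWER-SIGNED + UPPER-SIGNED, linear in `m`, every `K ≥ 2` (`eulerBoundPoly_lowerSignedK` / `eulerBoundPoly_upperSignedK` 2m+1, members `polyLaw_lowerSignedK` /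
`polyLaw_upperSignedK` 2m+2, `polyLaw_lowerSignedK_signed ≤ #{sign-changing}+2`, rev 16; contains S3 and the coherent sectors) and TAME every `K ≥ 2` in the
support window 4× the first / last gap (`eulerBoundPoly_tameK(_top)` 2m+1, `polyLaw_tameK(_top)` 2m+2, rev 16); SIGN-AWARE member constants on every wired sector
(`polyLaw_upperSignedK_signed`, `polyLaw_coherentK_top_signed` m+2, `polyLaw_tameK_signed`, rev 17); located fine form S4‴ (BA) in the header. -/
theorem stub_polyLaw : PPOPolyLaw := by
  sorry

/-- the floor through S4″ (kernel joint; records that closing `stub_eulerBoundK3` closes the floor). -/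
theorem oneChangeFloorK3_of_stub_eulerBoundK3 : OneChangeFloorK3 := oneChangeFloorK3_of_eulerBoundK3 stub_eulerBoundK3

/-- S4′ through S4″ (kernel joint; records that closing `stub_eulerBoundK3` closes `stub_classRowK3`). -/
theorem classRowK3_of_stub_eulerBoundK3 : ClassRowK3Linear := classRowK3_of_eulerBoundK3 stub_eulerBoundK3

/-- **closure modulo ONE stub:** the restricted V1 follows from exactly `stub_polyLaw` (the class law); S0 is proved. -/
theorem productPlusOneMDR_of_stubs : ProductPlusOneMDR := productPlusOneMDR_of windowArith_holds stub_polyLaw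

end Summit.ValiantsHypothesis.ValiantsHypothesis.Cruxes.MatrixDescartes.ProductPlusOneLine
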